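import Mathlib
import Literature.RingTheory.CohomologyAnnihilator.StableAnnihilation
import Literature.RingTheory.CohomologyAnnihilator.SyzygyBasic
import Literature.RingTheory.CohomologyAnnihilator.SyzygyDescent
import Literature.RingTheory.CohomologyAnnihilator.SyzygyBaseChange
import Literature.RingTheory.CohomologyAnnihilator.Completion
import Literature.RingTheory.CohomologyAnnihilator.RegularLocalRing
import Literature.AlgebraicGeometry.Resolution.AdicCompletionRegular
import HarnessLib

/-!
# The cohomology annihilator under completion — [BHST15, Theorem 4.5]: `caⁿ(R̂) ∩ R ⊆ caⁿ(R)` (faithfully flat descent) and `caⁿ(R) ⊆ caⁿ⁺ᵈ(R̂) ∩ R` for an isolated singularity (ascent) — `caCompletion_comap_le` and `le_caCompletion_comap` HOLD (re-homed proofs)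

**The cohomology annihilator of a local ring and its completion** — [Bahlekeh–Hakimian–Salarian–Takahashi 2015, Theorem 4.5]:
for a commutative noetherian local ring `R` with `𝔪`-adic completion `R̂`, (1) `caⁿ(R̂) ∩ R ⊆ caⁿ(R)` for every `n`, and (2) if
`R̂` is an isolated singularity and `d = dim R` then `caⁿ(R) ⊆ caⁿ⁺ᵈ(R̂) ∩ R` — hence `ca(R) = ca(R̂) ∩ R` (the tree's conditional
`cohomologyAnnihilator_eq_comap_completion` in `Completion.lean`) — RE-HOMED into `Literature/` by the Hodge foundations lane
(`lit-hodgefound`, seat p20, generation 36) from the cell `res-hironaka` (crux chain W4.4 / w44b, seats res-D-pv-037, res-type-015 …):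
verbatim ports, in dependency order and each with its original module docstring (Parts 1–11), of the modules
`Summits/ResolutionOfSingularities/ResolutionOfSingularities/Theorems/{HomologicalConductorNoZenoStableAnnihilatorReduction,
HomologicalConductorPersistenceFaithfullyFlatDescent, HomologicalConductorPersistenceFaithfullyFlatDescentCompletion,
HomologicalConductorPersistenceCompletionAscent{OneStep, Lifting, Punctured, QuotientPair, SyzygyRetract, Retract, Isolated, Holds}}.lean`
(the two discharges re-rooted to the facts' exact names), namespaces
`Summit.ResolutionOfSingularities.ResolutionOfSingularities.Theorems.NoZeno.SandwichCluster` re-rooted as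
`Literature.RingTheory.CohomologyAnnihilator` (so the stable annihilator is `Literature.RingTheory.CohomologyAnnihilator.StablyAnnihilates`)
and `….Theorems.HomologicalConductor.<Step>` as `Literature.RingTheory.CohomologyAnnihilator.BHST2015.<Step>`.

CONTENT: Part 1 — the STABLE ANNIHILATOR `StablyAnnihilates T x M` (the homothety `x • 𝟙 M` factors through a finitely generated
projective; Iyengar–Takahashi 2014 §2, Remarks 2.3 / 2.13), `x ∈ caⁿ⁺¹(T) ↔ x` stably annihilates every `n`-th syzygy module (CA1),
and duality for reflexive modules (CA3), over the tree's `StableAnnihilation.lean` / `SyzygyBasic.lean` / `SyzygyDescent.lean`;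
Parts 2–3 — Theorem 4.5 (1) by FAITHFULLY FLAT DESCENT of stable annihilation (presentation criterion, `R → R̂` faithfully flat);
Parts 4–11 — Theorem 4.5 (2) by ASCENT: over an isolated singularity of dimension `d` every `d`-th syzygy is punctured-free, hence a
retract of a base change `R̂ ⊗_R N` (the printed Cor. 4.4 replaced by a Koszul-free retract argument, as the source headers explain),
syzygies of retracts of base changes, and CA1 on both sides.  One definition (`StablyAnnihilates`, body verbatim), theorems otherwise;
no named fact; imports Mathlib/Literature only; every declaration carries the citation of the printed step it formalises (the
Summits originals' `[folklore]` helpers are re-tagged with the citation of the theorem they serve).  The EXACT discharges are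
`Literature.RingTheory.CohomologyAnnihilator.caCompletion_comap_le_holds` and `….le_caCompletion_comap_holds` of the two Literature
named facts of `Completion.lean` (ends of Parts 3 and 11); their only previous proofs were the Summits-side
`….PersistenceFaithfullyFlatDescentCompletion.caCompletion_comap_le_holds` / `….CompletionAscentHolds.le_caCompletion_comap_holds`,
which `Literature/` cannot import.  The Summits originals stay in place (transitional duplication).  Nothing here is a statement of
Hironaka's manuscript; resolution of singularities is not touched.
-/

noncomputable section

/-!
## Part 1 — port of `Summits/ResolutionOfSingularities/ResolutionOfSingularities/Theorems/HomologicalConductorNoZenoStableAnnihilatorReduction.lean`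

# Crux `NoZenoR` / `NoZeno` (stmt-ResolutionOfSingularities-19943 / -16483), line
# `sandwich-cluster`, S3 Layer 2 — CA-layer I: the STABLE ANNIHILATOR (A0), the REDUCTION
# LEMMA (CA1) and DUALITY (CA3)

Route `ResolutionOfSingularities/HomologicalConductor`.  OURS (cell res-hironaka, crux chain W4.4,
seat res-L0-w44-stub-5 = res-D-pv-037); nothing here is a statement of the manuscript under review
(Hironaka 2017); AI-written, weaker than expert review.

CRUX-PLAN W4.4 v5/v6 §A (planner res-L0-w44-plan-1, `SketchCALayer.lean` rev 2, items A0 / CA1 / CA3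
— signatures verbatim; audited 6/6 PASS-as-typed by res-L0-w44-tri-1, TRIAGE v4 §7).  THEOREM A
(principality of `ca(T_m)` at the sky points of a sandwiched stage, the residual `stub_skyPrincipal`
of the registered stub `stub_caPrincipalUpstairsCore`) consumes the tree's cohomology annihilator
ideals `caⁿ(T)` (`Literature.RingTheory.CohomologyAnnihilator.cohomologyAnnihilatorOfDegree`) in the
form «`x ∈ caⁿ(T)` iff `x` STABLY ANNIHILATES (the dual of) every high syzygy module» (CA4 =
CA1 + CA0 + CA3).  This file is the scheme-free commutative algebra behind that reformulation —
folklore in the style of [IyengarTakahashi2014, §2] (Remark 2.3: dimension shifting; Remark 2.13: a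
homothety killing the class of a projective presentation factors through the cover) over the tree's
`StableAnnihilation.lean`, `StrongGenerator.lean` (`IsSyzygy`), `SyzygyBasic.lean`,
`SyzygyDescent.lean`:

* `StablyAnnihilates T x M` (A0) — the homothety `x • 𝟙 M` factors through a finitely generated
  projective module, `M —ι→ P —π→ M` with `ι ≫ π = x • 𝟙 M` («`x ∈ s̲ann(M)`», the stable
  annihilator of `M`: `x • 𝟙 M` vanishes in the stable category `mod T / proj T`);
* `StablyAnnihilates.smul_ext_eq_zero` — then `x • Extⁱ(M, N) = 0` for every `N` and every `i ≥ 1`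
  (tree `smul_ext_eq_zero_of_comp_eq_smul_id`); conversely
  `stablyAnnihilates_of_forall_smul_ext_one_eq_zero` — over a noetherian ring a finitely generated
  `K` with `x • Ext¹(K, N) = 0` for all finitely generated `N` is stably annihilated by `x` (the
  class of `0 → ΩK → P → K → 0` is killed, so `x • 𝟙 K` lifts to the cover, Remark 2.13);
  together `stablyAnnihilates_iff_forall_smul_ext_one_eq_zero`; `StablyAnnihilates.of_iso`;
  `stablyAnnihilates_of_mem_of_isSyzygy_succ` (= tree `exists_comp_eq_smul_id_of_isSyzygy`);
* **CA1** `mem_cohomologyAnnihilatorOfDegree_succ_iff_forall_isSyzygy` — for noetherian `T` and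
  every `n`: `x ∈ caⁿ⁺¹(T)` iff `x` stably annihilates every `n`-th syzygy module of every finitely
  generated module (dimension shifting along the syzygy chain: tree `ext_smul_eq_zero_of_isSyzygy`,
  `mem_extAnnihilatorFrom_of_isSyzygy`); `mem_cohomologyAnnihilator_iff_exists_forall_isSyzygy`
  is the `ca(T)` form;
* **CA3** `stablyAnnihilates_iff_dual` — for a reflexive `L`: `x ∈ s̲ann(L)` iff `x ∈ s̲ann(L*)`
  (dualise a factorisation, `(x • 𝟙)* = x • 𝟙`, and `L ≅ L**` by `Module.evalEquiv`); the forward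
  direction `StablyAnnihilates.dual` holds for every module over every commutative ring.

References: S. B. Iyengar, R. Takahashi, *Annihilation of cohomology and strong generation of module
categories*, IMRN 2016; arXiv:1404.1476 — §2, Remark 2.3, Remark 2.13 [`IyengarTakahashi2014`].
-/

section Part1

noncomputable section

namespace Literature.RingTheory.CohomologyAnnihilator

open _root_.CategoryTheory CategoryTheory.Abelian Literature.RingTheory.CohomologyAnnihilator

universe u

variable (T : Type u) [CommRing T]

/-! ## A0: the stable annihilator -/

/-- `x` STABLY ANNIHILATES `M`: the homothety `x • 𝟙 M` factors through a finitely generated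
projective module, `M —ι→ P —π→ M` with `ι ≫ π = x • 𝟙 M` (`x ∈ s̲ann(M)`, the stable annihilator:
`x • 𝟙 M` vanishes in the stable category `mod T / proj T`; the shape of factorisation produced by
[IyengarTakahashi2014, Remark 2.13] and consumed by `smul_ext_eq_zero_of_comp_eq_smul_id`).
[cite: IyengarTakahashi2014, Remark 2.13] -/
def StablyAnnihilates (x : T) (M : ModuleCat.{u} T) : Prop :=
  ∃ (P : ModuleCat.{u} T) (_ : Module.Finite T P) (_ : Projective P) (ι : M ⟶ P) (π : P ⟶ M),
    ι ≫ π = x • 𝟙 M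

variable {T}

/-- Pointwise form of a factorisation `ι ≫ π = x • 𝟙 M` in `ModuleCat T`: `π (ι m) = x • m`.
[cite: IyengarTakahashi2014, §2 Remarks 2.3 and 2.13 (stable annihilation)] -/
theorem apply_apply_eq_smul_of_comp_eq_smul_id {M P : ModuleCat.{u} T} {ι : M ⟶ P} {π : P ⟶ M}
    {x : T} (h : ι ≫ π = x • 𝟙 M) (m : M) : π.hom (ι.hom m) = x • m := by
  have := congrArg (fun f : M ⟶ M => f.hom m) h
  simpa using this

/-- **Stable annihilation kills positive `Ext`**: if `x` stably annihilates `M` then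
`x • Extⁱ(M, N) = 0` for every `T`-module `N` and every `i ≥ 1` (the factor `Extⁱ(P, N)` vanishes).
[cite: IyengarTakahashi2014, Remark 2.13] -/
theorem StablyAnnihilates.smul_ext_eq_zero {x : T} {M : ModuleCat.{u} T}
    (h : StablyAnnihilates T x M) (N : ModuleCat.{u} T) {i : ℕ} (hi : 1 ≤ i) (e : Ext.{u} M N i) :
    x • e = 0 := by
  obtain ⟨P, _, hP, ι, π, hιπ⟩ := h
  haveI := hP
  exact smul_ext_eq_zero_of_comp_eq_smul_id ι π hιπ hi e

/-- Stable annihilation is invariant under isomorphism (conjugate the factorisation). [cite: IyengarTakahashi2014, §2 Remarks 2.3 and 2.13 (stable annihilation)] -/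
theorem StablyAnnihilates.of_iso {x : T} {M M' : ModuleCat.{u} T} (h : StablyAnnihilates T x M)
    (e : M ≅ M') : StablyAnnihilates T x M' := by
  obtain ⟨P, hPfin, hP, ι, π, hιπ⟩ := h
  refine ⟨P, hPfin, hP, e.inv ≫ ι, π ≫ e.hom, ?_⟩
  rw [Category.assoc, ← Category.assoc ι, hιπ, Linear.smul_comp, Linear.comp_smul, Category.id_comp,
    e.inv_hom_id]

/-- **`caᵗ⁺¹(T)` stably annihilates `(t+1)`-th syzygies** — the sibling file's
`exists_comp_eq_smul_id_of_isSyzygy` (`SyzygyDescent.lean`) in the present vocabulary: for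
noetherian `T`, `x ∈ caᵗ⁺¹(T)` and `K` a `(t+1)`-th syzygy of a finitely generated `M`, `x` stably
annihilates `K` (so `caᵗ⁺¹(T)` stably annihilates `Ωᵗ M` — the reduction lemma below — AND
`Ωᵗ⁺¹ M`). [cite: IyengarTakahashi2014, §2 Remarks 2.3 and 2.13 (stable annihilation)] -/
theorem stablyAnnihilates_of_mem_of_isSyzygy_succ [IsNoetherianRing T] {t : ℕ} {x : T}
    (hx : x ∈ cohomologyAnnihilatorOfDegree T (t + 1)) {M K : ModuleCat.{u} T} [Module.Finite T M]
    (hK : IsSyzygy (t + 1) M K) : StablyAnnihilates T x K :=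
  exists_comp_eq_smul_id_of_isSyzygy hx hK

/-- Over a noetherian ring, a finitely generated module `K` such that `x • Ext¹(K, N) = 0` for every
FINITELY GENERATED `N` is stably annihilated by `x`: for a finite presentation `0 → K₁ → P → K → 0`
(`P` finite free, `K₁` finitely generated) the class in `Ext¹(K, K₁)` is killed by `x`, so `x • 𝟙 K`
lifts along `P ↠ K` (tree `exists_comp_eq_smul_id_X₃_of_smul_extClass_eq_zero`).
[cite: IyengarTakahashi2014, Remark 2.13] -/
theorem stablyAnnihilates_of_forall_smul_ext_one_eq_zero [IsNoetherianRing T] {x : T}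
    (K : ModuleCat.{u} T) [Module.Finite T K]
    (h : ∀ N : ModuleCat.{u} T, Module.Finite T N → ∀ e : Ext.{u} K N 1, x • e = 0) :
    StablyAnnihilates T x K := by
  obtain ⟨P, _, _, _, _, f, surjf⟩ := Module.exists_finite_presentation T K
  have hS := LinearMap.shortExact_shortComplexKer surjf
  haveI : Module.Finite T (LinearMap.ker f) := Module.IsNoetherian.finite T _
  have hcl : x • hS.extClass = 0 := h (ModuleCat.of T (LinearMap.ker f)) inferInstance _
  obtain ⟨ψ, hψ⟩ := exists_comp_eq_smul_id_X₃_of_smul_extClass_eq_zero hS hcl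
  exact ⟨ModuleCat.of T P, inferInstance, inferInstance, ψ, ModuleCat.ofHom f, hψ⟩

/-- Over a noetherian ring and for `K` finitely generated: `x` stably annihilates `K` iff
`x • Ext¹(K, N) = 0` for every finitely generated `N`. [cite: IyengarTakahashi2014, Remark 2.13] -/
theorem stablyAnnihilates_iff_forall_smul_ext_one_eq_zero [IsNoetherianRing T] (x : T)
    (K : ModuleCat.{u} T) [Module.Finite T K] :
    StablyAnnihilates T x K ↔
      ∀ N : ModuleCat.{u} T, Module.Finite T N → ∀ e : Ext.{u} K N 1, x • e = 0 :=
  ⟨fun h N _ e => h.smul_ext_eq_zero N le_rfl e, stablyAnnihilates_of_forall_smul_ext_one_eq_zero K⟩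

/-! ## CA1, the reduction lemma: `caⁿ⁺¹(T)` is the stable annihilator of `n`-th syzygies -/

/-- **The REDUCTION LEMMA** (Iyengar–Takahashi §2 folklore; item CA1 of the W4.4 CA-layer):
for a noetherian ring `T` and any `n` (`n = 0` included: `IsSyzygy 0 M K` is `K ≅ M`),
`x ∈ caⁿ⁺¹(T)` iff `x` stably annihilates every `n`-th syzygy module `K = Ωⁿ M` of every finitely
generated `T`-module `M`.  `⇒`: `x` kills `Extⁿ⁺¹(M, N) ↩ Ext¹(Ωⁿ M, N)` (injective dimension
shifting, `ext_smul_eq_zero_of_isSyzygy`), hence the class of `0 → Ωⁿ⁺¹M → P → ΩⁿM → 0`, so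
`x • 𝟙 (Ωⁿ M)` lifts to the cover.  `⇐`: a factorisation through a projective kills
`Ext^{≥ 1}(Ωⁿ M, −)`, which maps ONTO `Ext^{≥ n+1}(M, −)` (surjective dimension shifting,
`mem_extAnnihilatorFrom_of_isSyzygy`). [cite: IyengarTakahashi2014, Remark 2.3, Remark 2.13] -/
theorem mem_cohomologyAnnihilatorOfDegree_succ_iff_forall_isSyzygy [IsNoetherianRing T] {n : ℕ}
    (x : T) :
    x ∈ cohomologyAnnihilatorOfDegree T (n + 1) ↔
      ∀ (M K : ModuleCat.{u} T), Module.Finite T M → IsSyzygy n M K → StablyAnnihilates T x K := by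
  constructor
  · intro hx M K hM hK
    haveI := hM
    haveI : Module.Finite T K := finite_of_isSyzygy n hM hK
    refine stablyAnnihilates_of_forall_smul_ext_one_eq_zero K fun N hN e => ?_
    haveI := hN
    refine ext_smul_eq_zero_of_isSyzygy n hK N 1 le_rfl x (fun e' => ?_) e
    exact smul_eq_zero_of_mem_cohomologyAnnihilatorOfDegree hx (i := 1 + n) (by omega) e'
  · intro h
    rw [mem_cohomologyAnnihilatorOfDegree_iff_forall_mem_extAnnihilatorFrom]
    intro M hM
    haveI := hM
    obtain ⟨K, _, hK⟩ := exists_isSyzygy M n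
    have h1 : x ∈ extAnnihilatorFrom K 1 := by
      rw [mem_extAnnihilatorFrom_iff]
      intro i hi N _ e
      exact (h M K hM hK).smul_ext_eq_zero N hi e
    have := mem_extAnnihilatorFrom_of_isSyzygy n hK h1
    rwa [Nat.add_comm] at this

/-- The reduction lemma in `ca(T)`-language: for noetherian `T`, `x ∈ ca(T)` iff for SOME `n`, `x`
stably annihilates every `n`-th syzygy of every finitely generated module (`ca(T) = ⋃ₙ caⁿ⁺¹(T)`
as `ca⁰ ⊆ ca¹`). [cite: IyengarTakahashi2014, Definition 2.1, Remark 2.13] -/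
theorem mem_cohomologyAnnihilator_iff_exists_forall_isSyzygy [IsNoetherianRing T] (x : T) :
    x ∈ cohomologyAnnihilator T ↔ ∃ n : ℕ,
      ∀ (M K : ModuleCat.{u} T), Module.Finite T M → IsSyzygy n M K → StablyAnnihilates T x K := by
  rw [mem_cohomologyAnnihilator_iff]
  constructor
  · rintro ⟨n, hn⟩
    exact ⟨n, (mem_cohomologyAnnihilatorOfDegree_succ_iff_forall_isSyzygy x).mp
      (cohomologyAnnihilatorOfDegree_mono (Nat.le_succ n) hn)⟩
  · rintro ⟨n, hn⟩
    exact ⟨n + 1, (mem_cohomologyAnnihilatorOfDegree_succ_iff_forall_isSyzygy x).mpr hn⟩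

/-! ## CA3: stable annihilation is self-dual on reflexive modules -/

/-- The factorisation `ι ≫ π = x • 𝟙 M` dualises: `π* ∘ ι*`… precisely, for `ψ ∈ M*`,
`ι* (π* ψ) = ψ ∘ π ∘ ι = x • ψ`. [cite: IyengarTakahashi2014, §2 Remarks 2.3 and 2.13 (stable annihilation)] -/
theorem dualMap_dualMap_apply_of_comp_eq_smul_id {M P : ModuleCat.{u} T} {ι : M ⟶ P} {π : P ⟶ M}
    {x : T} (h : ι ≫ π = x • 𝟙 M) (ψ : Module.Dual T M) :
    ι.hom.dualMap (π.hom.dualMap ψ) = x • ψ := by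
  ext m
  simp only [LinearMap.dualMap_apply, apply_apply_eq_smul_of_comp_eq_smul_id h m, map_smul,
    LinearMap.smul_apply]

/-- **Duality, forward direction (any module, any commutative ring)**: if `x` stably annihilates `M`
then `x` stably annihilates the dual `M* = Hom_T(M, T)` — dualise `M —ι→ P —π→ M` to
`M* —π*→ P* —ι*→ M*`; the dual of a finitely generated projective is finitely generated projective
(Mathlib `Module.dual_finite`, `Module.dual_projective`). [cite: IyengarTakahashi2014, §2 Remarks 2.3 and 2.13 (stable annihilation)] -/
theorem StablyAnnihilates.dual {x : T} {M : ModuleCat.{u} T} (h : StablyAnnihilates T x M) :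
    StablyAnnihilates T x (ModuleCat.of T (Module.Dual T M)) := by
  obtain ⟨P, hPfin, hP, ι, π, hιπ⟩ := h
  haveI := hPfin
  haveI := hP
  haveI : Module.Projective T P := P.projective_of_module_projective
  refine ⟨ModuleCat.of T (Module.Dual T P), inferInstance, inferInstance,
    ModuleCat.ofHom π.hom.dualMap, ModuleCat.ofHom ι.hom.dualMap, ?_⟩
  ext ψ m
  simp only [ModuleCat.hom_comp, ModuleCat.hom_ofHom, LinearMap.coe_comp, Function.comp_apply,
    LinearMap.dualMap_apply, apply_apply_eq_smul_of_comp_eq_smul_id hιπ m, map_smul,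
    ModuleCat.hom_smul, ModuleCat.hom_id, LinearMap.smul_apply, LinearMap.id_coe, id_eq]

/-- **Duality** (item CA3 of the W4.4 CA-layer): for a REFLEXIVE module `L` (`L ≅ L**` via
`Module.Dual.eval`), `x` stably annihilates `L` iff it stably annihilates the dual
`L* = Hom_T(L, T)`.  `⇒` is `StablyAnnihilates.dual`; for `⇐` dualise a factorisation
`L* —ι→ P —π→ L*` to `L ≅ L** —π*→ P* —ι*→ L** ≅ L`. [cite: IyengarTakahashi2014, §2 Remarks 2.3 and 2.13 (stable annihilation)] -/
theorem stablyAnnihilates_iff_dual (x : T) (L : ModuleCat.{u} T) (hL : Module.IsReflexive T L) :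
    StablyAnnihilates T x L ↔ StablyAnnihilates T x (ModuleCat.of T (Module.Dual T L)) := by
  refine ⟨StablyAnnihilates.dual, fun h => ?_⟩
  obtain ⟨P, hPfin, hP, ι, π, hιπ⟩ := h
  haveI := hPfin
  haveI := hP
  haveI := hL
  haveI : Module.Projective T P := P.projective_of_module_projective
  let e : L ≃ₗ[T] Module.Dual T (Module.Dual T L) := Module.evalEquiv T L
  refine ⟨ModuleCat.of T (Module.Dual T P), inferInstance, inferInstance,
    ModuleCat.ofHom (π.hom.dualMap ∘ₗ e.toLinearMap),
    ModuleCat.ofHom (e.symm.toLinearMap ∘ₗ ι.hom.dualMap), ?_⟩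
  ext l
  have hψ : ι.hom.dualMap (π.hom.dualMap (e l)) = x • e l :=
    dualMap_dualMap_apply_of_comp_eq_smul_id hιπ (e l)
  simp only [ModuleCat.hom_comp, ModuleCat.hom_ofHom, LinearMap.coe_comp, LinearEquiv.coe_coe,
    Function.comp_apply, hψ, map_smul, LinearEquiv.symm_apply_apply, ModuleCat.hom_smul,
    ModuleCat.hom_id, LinearMap.smul_apply, LinearMap.id_coe, id_eq]

end Literature.RingTheory.CohomologyAnnihilator

end

end Part1

/-!
## Part 2 — port of `Summits/ResolutionOfSingularities/ResolutionOfSingularities/Theorems/HomologicalConductorPersistenceFaithfullyFlatDescent.lean`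

# Faithfully flat descent of cohomology annihilators (same index)

`[OURS · L1 w44b · ORDER w44b-o8b (res-L1-w44b-plan-1 gen 9, CHAIN v8 §V8.3)]` — helper for the
surface rung `PersistenceSurface` (stmt-ResolutionOfSingularities-19970) of the crux
`HomologicalConductor.Persistence` (stmt-ResolutionOfSingularities-16484): it supplies the DESCENT
conjunct of the step-dual-cover interface of ORDER w44b-o8 (`StepDualCover.descent`,
«`caᵐ⁺¹(T₂) ∩ T' ⊆ caᵐ⁺¹(T')`») for the model `T₂` = a faithfully flat noetherian `T'`-algebra, e.g.
an étale neighbourhood of a local `T'`.  NOT a statement of the manuscript under adjudication in cell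
res-hironaka; nothing here is attributed to its author.  Pure commutative algebra over Mathlib and
the tree's `Literature.RingTheory.CohomologyAnnihilator` library, in the vocabulary of the W4.4
CA-layer (`StablyAnnihilates`, CA1 `mem_cohomologyAnnihilatorOfDegree_succ_iff_forall_isSyzygy`).

Write `caⁿ(R)` for `cohomologyAnnihilatorOfDegree R n`, `s̲ann(M)` for the stable annihilator
(`x ∈ s̲ann(M)` iff `x • 𝟙 M` factors through a finitely generated projective, `StablyAnnihilates`).

* **(P) presentation criterion.** For a surjection `π : F₀ ↠ M` from a finitely generated
  projective: `x ∈ s̲ann(M)` iff `x • 𝟙 M` lifts along `π`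
  (`stablyAnnihilates_iff_exists_comp_eq_smul_id`); and for a presentation `F₁ →ρ F₀ →π M → 0`
  with `F₀` projective: such a lift exists iff `ρ ∘ β ∘ ρ = -x ρ` for some `β : F₀ → F₁`
  (`exists_comp_eq_smul_id_iff_exists_sandwich`).  So for finitely presented `M`, membership in
  `s̲ann(M)` is the solvability of ONE linear equation between Hom-modules of finite free modules.
* **(D) descent of solvability.** For `S` faithfully flat over `T`, `y ∈ range Γ` as soon as
  `1 ⊗ y ∈ range (Γ ⊗ S)` (`mem_range_of_one_tmul_mem_range_baseChange`, from Mathlib's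
  `Module.FaithfullyFlat.one_tmul_eq_zero_iff` on `W ⧸ range Γ`); the Hom-modules of finite free
  modules commute with base change (Mathlib `IsBaseChange.linearMapLeftRight`), compatibly with the
  sandwich map `β ↦ ρ β ρ` (`exists_sandwich_of_baseChange`).
* **(D1)** `StablyAnnihilates.of_faithfullyFlat_baseChange`: for `S` faithfully flat over `T` and `M`
  finitely presented, `algebraMap x ∈ s̲ann_S(S ⊗ M)` implies `x ∈ s̲ann_T(M)`.
* **(D2)** `comap_cohomologyAnnihilatorOfDegree_succ_le_of_faithfullyFlat`: for `T`, `S` noetherian,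
  `S` faithfully flat over `T`: `caⁿ⁺¹(S) ∩ T ⊆ caⁿ⁺¹(T)` (same index) — CA1 on both sides, flat base
  change of syzygies (tree `IsSyzygy.baseChange`) and (D1); `ca(S) ∩ T ⊆ ca(T)`
  (`comap_cohomologyAnnihilator_le_of_faithfullyFlat`).
* **(D3)** local corollaries: a FLAT LOCAL homomorphism of noetherian local rings is faithfully flat
  (Mathlib `Module.FaithfullyFlat.of_flat_of_isLocalHom`), so `caⁿ⁺¹` descends along it
  (`comap_cohomologyAnnihilatorOfDegree_succ_le_of_flat_of_isLocalHom`); in particular along an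
  ÉTALE NEIGHBOURHOOD `T' → E_𝔮` (`E` étale over local noetherian `T'`, `𝔮` over the closed point;
  `comap_cohomologyAnnihilatorOfDegree_succ_le_of_etale_neighbourhood`).

## References

* S. B. Iyengar, R. Takahashi, *Annihilation of cohomology and strong generation of module
  categories*, IMRN 2016; arXiv:1404.1476 — §2 (syzygies, `caⁿ`), Remark 2.13.
  [`IyengarTakahashi2014`]
* Descent of solvability of linear equations along faithfully flat ring maps is folklore (fpqc
  descent for modules, e.g. the injectivity of `N → S ⊗_T N`); here via Mathlib's
  `Module.FaithfullyFlat.one_tmul_eq_zero_iff`.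
-/

section Part2

noncomputable section

open _root_.CategoryTheory Literature.RingTheory.CohomologyAnnihilator
open Literature.RingTheory.CohomologyAnnihilator
open scoped _root_.TensorProduct

universe u

namespace Literature.RingTheory.CohomologyAnnihilator.BHST2015.PersistenceFaithfullyFlatDescent

/-! ## (P) The presentation criterion for stable annihilation -/

section Presentation

variable {T : Type u} [CommRing T] {M F₀ F₁ : Type u} [AddCommGroup M] [Module T M]
  [AddCommGroup F₀] [Module T F₀] [AddCommGroup F₁] [Module T F₁]

/-- **Stable annihilation is lifting along one projective cover.**  For a surjection `π : F₀ ↠ M`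
with `F₀` finitely generated projective, `x` stably annihilates `M` iff `x • 𝟙 M` lifts along `π`:
`π ∘ σ = x • 𝟙 M` for some `σ : M → F₀` (a factorisation `M → P → M` through any projective `P`
lifts along `π` by the lifting property of `P`). [cite: IyengarTakahashi2014, Remark 2.13] -/
theorem stablyAnnihilates_iff_exists_comp_eq_smul_id [Module.Finite T F₀] [Module.Projective T F₀]
    (x : T) (π : F₀ →ₗ[T] M) (hπ : Function.Surjective π) :
    StablyAnnihilates T x (ModuleCat.of T M) ↔
      ∃ σ : M →ₗ[T] F₀, π ∘ₗ σ = x • LinearMap.id := by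
  constructor
  · rintro ⟨P, hPfin, hP, ι, π', h⟩
    haveI := hP
    haveI : Module.Projective T P := P.projective_of_module_projective
    obtain ⟨l, hl⟩ := Module.projective_lifting_property π π'.hom hπ
    refine ⟨l ∘ₗ ι.hom, ?_⟩
    ext m
    have h1 : π (l (ι.hom m)) = π'.hom (ι.hom m) := LinearMap.congr_fun hl (ι.hom m)
    simp only [LinearMap.coe_comp, Function.comp_apply, LinearMap.smul_apply, LinearMap.id_coe,
      id_eq, h1]
    exact apply_apply_eq_smul_of_comp_eq_smul_id h m
  · rintro ⟨σ, hσ⟩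
    refine ⟨ModuleCat.of T F₀, ‹_›, (IsProjective.iff_projective (R := T) F₀).mp ‹_›,
      ModuleCat.ofHom σ, ModuleCat.ofHom π, ?_⟩
    ext m
    have h1 : π (σ m) = x • m := by
      simpa using LinearMap.congr_fun hσ m
    simpa [ModuleCat.hom_comp, ModuleCat.hom_ofHom] using h1

/-- **The sandwich equation.**  For a presentation `F₁ →ρ F₀ →π M → 0` (`ρ`, `π` exact, `π`
surjective) with `F₀` projective: `x • 𝟙 M` lifts along `π` iff `ρ ∘ β ∘ ρ = -(x • ρ)` for some
`β : F₀ → F₁`.  (`⇒`: `σ π - x • 𝟙` maps into `ker π = range ρ`, lift it along `ρ` to `β`;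
`⇐`: `x • 𝟙 + ρ β` kills `range ρ = ker π`, so it factors as `σ ∘ π`, and `π σ π = x • π`.)
[cite: BahlekehHakimianSalarianTakahashi2015, Theorem 4.5 (1) (proof: faithfully flat descent)] -/
theorem exists_comp_eq_smul_id_iff_exists_sandwich [Module.Projective T F₀] (x : T)
    (ρ : F₁ →ₗ[T] F₀) (π : F₀ →ₗ[T] M) (hex : Function.Exact ρ π)
    (hπ : Function.Surjective π) :
    (∃ σ : M →ₗ[T] F₀, π ∘ₗ σ = x • LinearMap.id) ↔
      ∃ β : F₀ →ₗ[T] F₁, ρ ∘ₗ β ∘ₗ ρ = -(x • ρ) := by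
  constructor
  · rintro ⟨σ, hσ⟩
    have hmem : ∀ v : F₀, (σ ∘ₗ π - x • (LinearMap.id : F₀ →ₗ[T] F₀)) v ∈ LinearMap.range ρ := by
      intro v
      rw [← hex.linearMap_ker_eq, LinearMap.mem_ker]
      have h1 : π (σ (π v)) = x • π v := by
        simpa using LinearMap.congr_fun hσ (π v)
      simp only [LinearMap.sub_apply, LinearMap.coe_comp, Function.comp_apply, LinearMap.smul_apply,
        LinearMap.id_coe, id_eq, map_sub, map_smul, h1, sub_self]
    obtain ⟨β, hβ⟩ := Module.projective_lifting_property ρ.rangeRestrict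
      (LinearMap.codRestrict (LinearMap.range ρ) (σ ∘ₗ π - x • LinearMap.id) hmem)
      ρ.surjective_rangeRestrict
    refine ⟨β, ?_⟩
    have hρβ : ρ ∘ₗ β = σ ∘ₗ π - x • LinearMap.id := by
      ext v
      have h1 := congrArg Subtype.val (LinearMap.congr_fun hβ v)
      simpa using h1
    have hπρ : π ∘ₗ ρ = 0 := hex.linearMap_comp_eq_zero
    calc ρ ∘ₗ β ∘ₗ ρ = (ρ ∘ₗ β) ∘ₗ ρ := (LinearMap.comp_assoc _ _ _).symm
      _ = (σ ∘ₗ π - x • LinearMap.id) ∘ₗ ρ := by rw [hρβ]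
      _ = σ ∘ₗ (π ∘ₗ ρ) - x • ρ := by
          rw [LinearMap.sub_comp, LinearMap.smul_comp, LinearMap.id_comp, LinearMap.comp_assoc]
      _ = -(x • ρ) := by rw [hπρ, LinearMap.comp_zero, zero_sub]
  · rintro ⟨β, hβ⟩
    set α : F₀ →ₗ[T] F₀ := x • LinearMap.id + ρ ∘ₗ β with hα
    have hαρ : α ∘ₗ ρ = 0 := by
      rw [hα, LinearMap.add_comp, LinearMap.smul_comp, LinearMap.id_comp, LinearMap.comp_assoc, hβ,
        add_neg_cancel]
    have hker : LinearMap.ker π ≤ LinearMap.ker α := by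
      rw [hex.linearMap_ker_eq]
      rintro _ ⟨w, rfl⟩
      rw [LinearMap.mem_ker, ← LinearMap.comp_apply, hαρ, LinearMap.zero_apply]
    let σ : M →ₗ[T] F₀ :=
      (LinearMap.ker π).liftQ α hker ∘ₗ (π.quotKerEquivOfSurjective hπ).symm.toLinearMap
    have hσπ : σ ∘ₗ π = α := by
      ext v
      simp only [σ, LinearMap.coe_comp, Function.comp_apply, LinearEquiv.coe_coe,
        LinearMap.quotKerEquivOfSurjective_symm_apply, Submodule.liftQ_apply]
    refine ⟨σ, ?_⟩
    rw [← LinearMap.cancel_right hπ, LinearMap.comp_assoc, hσπ, hα, LinearMap.comp_add,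
      LinearMap.comp_smul, LinearMap.comp_id, ← LinearMap.comp_assoc, hex.linearMap_comp_eq_zero,
      LinearMap.zero_comp, add_zero, LinearMap.smul_comp, LinearMap.id_comp]

end Presentation

/-! ## (D) Descent of solvability along a faithfully flat algebra -/

section Descent

variable {T : Type u} [CommRing T] (S : Type u) [CommRing S] [Algebra T S]

/-- **Membership in the image of a linear map descends along a faithfully flat algebra**: if
`1 ⊗ y` lies in the range of `Γ ⊗ S`, then `y` lies in the range of `Γ` — the class of `y` in
`W ⧸ range Γ` dies after `S ⊗_T -`, hence is zero (Mathlib `Module.FaithfullyFlat.one_tmul_eq_zero_iff`).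
[cite: BahlekehHakimianSalarianTakahashi2015, Theorem 4.5 (1) (proof: faithfully flat descent)] -/
theorem mem_range_of_one_tmul_mem_range_baseChange [Module.FaithfullyFlat T S] {V W : Type u}
    [AddCommGroup V] [Module T V] [AddCommGroup W] [Module T W] (Γ : V →ₗ[T] W) {y : W}
    (h : (1 : S) ⊗ₜ[T] y ∈ LinearMap.range (Γ.baseChange S)) : y ∈ LinearMap.range Γ := by
  obtain ⟨b, hb⟩ := h
  have h0 : ((LinearMap.range Γ).mkQ.baseChange S) ((1 : S) ⊗ₜ[T] y) = 0 := by
    rw [← hb, ← LinearMap.comp_apply, ← LinearMap.baseChange_comp, LinearMap.range_mkQ_comp,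
      LinearMap.baseChange_zero, LinearMap.zero_apply]
  rw [LinearMap.baseChange_tmul, Module.FaithfullyFlat.one_tmul_eq_zero_iff, Submodule.mkQ_apply,
    Submodule.Quotient.mk_eq_zero] at h0
  exact h0

/-- Mathlib's base-change map for linear maps out of a finite free module
(`IsBaseChange.linearMapLeftRightHom` for the standard base changes `S ⊗_T -`) IS
`LinearMap.baseChange`. [cite: BahlekehHakimianSalarianTakahashi2015, Theorem 4.5 (1) (proof: faithfully flat descent)] -/
theorem linearMapLeftRightHom_mk_eq_baseChange {F F' : Type u} [AddCommGroup F] [Module T F]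
    [AddCommGroup F'] [Module T F'] (f : F →ₗ[T] F') :
    IsBaseChange.linearMapLeftRightHom (TensorProduct.isBaseChange T F S)
        (TensorProduct.mk T S F' 1) f = f.baseChange S :=
  (TensorProduct.isBaseChange T F S).algHom_ext _ _ fun m => by
    rw [IsBaseChange.linearMapLeftRightHom_comp_apply, TensorProduct.mk_apply,
      TensorProduct.mk_apply, LinearMap.baseChange_tmul]

/-- **Descent of the sandwich equation.**  For `S` faithfully flat over `T` and `ρ : F₁ → F₀` a map
of finite free `T`-modules: if `ρ_S ∘ β' ∘ ρ_S = -(x • ρ_S)` is solvable over `S` (`ρ_S = ρ ⊗ S`),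
then `ρ ∘ β ∘ ρ = -(x • ρ)` is solvable over `T`.  The sandwich map `β ↦ ρ β ρ` is `T`-linear between
Hom-modules of finite free modules, which commute with base change (Mathlib
`IsBaseChange.linearMapLeftRight`) compatibly with the sandwich; conclude by
`mem_range_of_one_tmul_mem_range_baseChange`. [cite: BahlekehHakimianSalarianTakahashi2015, Theorem 4.5 (1) (proof: faithfully flat descent)] -/
theorem exists_sandwich_of_baseChange [Module.FaithfullyFlat T S] {F₀ F₁ : Type u}
    [AddCommGroup F₀] [Module T F₀] [AddCommGroup F₁] [Module T F₁]
    [Module.Free T F₀] [Module.Finite T F₀] [Module.Free T F₁] [Module.Finite T F₁]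
    (x : T) (ρ : F₁ →ₗ[T] F₀)
    (h : ∃ β' : S ⊗[T] F₀ →ₗ[S] S ⊗[T] F₁,
      ρ.baseChange S ∘ₗ β' ∘ₗ ρ.baseChange S = -(x • ρ.baseChange S)) :
    ∃ β : F₀ →ₗ[T] F₁, ρ ∘ₗ β ∘ₗ ρ = -(x • ρ) := by
  obtain ⟨β', hβ'⟩ := h
  -- the sandwich map `β ↦ ρ ∘ β ∘ ρ`
  let Γ : (F₀ →ₗ[T] F₁) →ₗ[T] (F₁ →ₗ[T] F₀) :=
    (LinearMap.lcomp T F₀ ρ) ∘ₗ (LinearMap.compRight T ρ)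
  have hΓ : ∀ β : F₀ →ₗ[T] F₁, Γ β = ρ ∘ₗ β ∘ₗ ρ := fun β => rfl
  suffices hy : -(x • ρ) ∈ LinearMap.range Γ by
    obtain ⟨β, hβ⟩ := hy
    exact ⟨β, by rw [← hΓ, hβ]⟩
  apply mem_range_of_one_tmul_mem_range_baseChange S Γ
  -- the base-change isomorphisms of the two Hom-modules
  let eV : S ⊗[T] (F₀ →ₗ[T] F₁) ≃ₗ[S] (S ⊗[T] F₀ →ₗ[S] S ⊗[T] F₁) :=
    (IsBaseChange.linearMapLeftRight (TensorProduct.isBaseChange T F₀ S)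
      (TensorProduct.isBaseChange T F₁ S)).equiv
  let eW : S ⊗[T] (F₁ →ₗ[T] F₀) ≃ₗ[S] (S ⊗[T] F₁ →ₗ[S] S ⊗[T] F₀) :=
    (IsBaseChange.linearMapLeftRight (TensorProduct.isBaseChange T F₁ S)
      (TensorProduct.isBaseChange T F₀ S)).equiv
  have heV : ∀ (s : S) (β : F₀ →ₗ[T] F₁), eV (s ⊗ₜ[T] β) = s • β.baseChange S := fun s β => by
    simp only [eV, IsBaseChange.equiv_tmul, linearMapLeftRightHom_mk_eq_baseChange]
  have heW : ∀ (s : S) (γ : F₁ →ₗ[T] F₀), eW (s ⊗ₜ[T] γ) = s • γ.baseChange S := fun s γ => by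
    simp only [eW, IsBaseChange.equiv_tmul, linearMapLeftRightHom_mk_eq_baseChange]
  -- compatibility of the sandwich with the base change
  have hsq : ∀ b : S ⊗[T] (F₀ →ₗ[T] F₁),
      eW (Γ.baseChange S b) = ρ.baseChange S ∘ₗ eV b ∘ₗ ρ.baseChange S := by
    intro b
    induction b using TensorProduct.induction_on with
    | zero => simp only [map_zero, LinearMap.zero_comp, LinearMap.comp_zero]
    | add b₁ b₂ h₁ h₂ => simp only [map_add, h₁, h₂, LinearMap.add_comp, LinearMap.comp_add]
    | tmul s β =>
      rw [LinearMap.baseChange_tmul, heW, heV, hΓ, LinearMap.baseChange_comp,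
        LinearMap.baseChange_comp, LinearMap.smul_comp, LinearMap.comp_smul]
  refine ⟨eV.symm β', eW.injective ?_⟩
  rw [hsq, LinearEquiv.apply_symm_apply, hβ', heW, one_smul, LinearMap.baseChange_neg,
    LinearMap.baseChange_smul]

end Descent

/-! ## (D1) Faithfully flat descent of stable annihilation -/

/-- **(D1) Stable annihilation descends along a faithfully flat algebra.**  For `S` faithfully flat
over `T`, `M` a finitely presented `T`-module and `x ∈ T`: if `algebraMap T S x` stably annihilates
`S ⊗_T M` over `S`, then `x` stably annihilates `M` over `T`.  Proof: choose a finite presentation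
`F₁ →ρ F₀ →π M → 0`; by (P) (over `S`, for the base-changed presentation, which stays a
presentation by right exactness of `S ⊗_T -`) the hypothesis is the solvability of
`ρ_S β' ρ_S = -x ρ_S` over `S`; by (D) it is solvable over `T`; by (P) again `x ∈ s̲ann(M)`.
(Declared in the namespace of `StablyAnnihilates`, so that `hS.of_faithfullyFlat_baseChange x M`
works by dot notation.) [folklore; vocabulary of IyengarTakahashi2014, Remark 2.13]
[cite: BahlekehHakimianSalarianTakahashi2015, Theorem 4.5 (1) (proof: faithfully flat descent)] -/
theorem _root_.Literature.RingTheory.CohomologyAnnihilator.StablyAnnihilates.of_faithfullyFlat_baseChange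
    {T S : Type u} [CommRing T] [CommRing S]
    [Algebra T S] [Module.FaithfullyFlat T S] (x : T) (M : ModuleCat.{u} T)
    [Module.FinitePresentation T M]
    (h : StablyAnnihilates S (algebraMap T S x) (ModuleCat.of S (S ⊗[T] M))) :
    StablyAnnihilates T x M := by
  -- a finite presentation `(Fin k → T) →ρ (Fin n → T) →π M → 0`
  obtain ⟨n, K, e, hK⟩ := Module.FinitePresentation.exists_fin T M
  haveI : Module.Finite T K := Module.Finite.iff_fg.mpr hK
  obtain ⟨k, f, hf⟩ := Module.Finite.exists_fin' T K
  let ρ : (Fin k → T) →ₗ[T] (Fin n → T) := K.subtype ∘ₗ f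
  let π : (Fin n → T) →ₗ[T] M := (e.symm : ((Fin n → T) ⧸ K) →ₗ[T] M) ∘ₗ K.mkQ
  have hπ : Function.Surjective π := e.symm.surjective.comp K.mkQ_surjective
  have hex : Function.Exact ρ π := by
    rw [LinearMap.exact_iff, LinearEquiv.ker_comp, Submodule.ker_mkQ, LinearMap.range_comp,
      LinearMap.range_eq_top.mpr hf, Submodule.map_top, Submodule.range_subtype]
  -- its base change is a presentation of `S ⊗ M`
  have hexS : Function.Exact (ρ.baseChange S) (π.baseChange S) := by
    rw [LinearMap.baseChange_eq_ltensor, LinearMap.baseChange_eq_ltensor]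
    exact lTensor_exact S hex hπ
  have hπS : Function.Surjective (π.baseChange S) := by
    rw [LinearMap.baseChange_eq_ltensor]
    exact LinearMap.lTensor_surjective S hπ
  -- over `S`: the sandwich equation is solvable
  have h1 := (stablyAnnihilates_iff_exists_comp_eq_smul_id (algebraMap T S x) (π.baseChange S)
    hπS).mp h
  obtain ⟨β', hβ'⟩ := (exists_comp_eq_smul_id_iff_exists_sandwich (algebraMap T S x)
    (ρ.baseChange S) (π.baseChange S) hexS hπS).mp h1
  have h2 : ∃ β' : S ⊗[T] (Fin n → T) →ₗ[S] S ⊗[T] (Fin k → T),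
      ρ.baseChange S ∘ₗ β' ∘ₗ ρ.baseChange S = -(x • ρ.baseChange S) :=
    ⟨β', by rw [hβ', algebraMap_smul]⟩
  -- descend, and read the solution over `T` as a factorisation
  obtain ⟨β, hβ⟩ := exists_sandwich_of_baseChange S x ρ h2
  exact (stablyAnnihilates_iff_exists_comp_eq_smul_id x π hπ).mpr
    ((exists_comp_eq_smul_id_iff_exists_sandwich x ρ π hex hπ).mpr ⟨β, hβ⟩)

/-! ## (D2) Faithfully flat descent of `caⁿ⁺¹` and `ca` -/

/-- **(D2) `caⁿ⁺¹` descends along a faithfully flat map of noetherian rings (same index).**  For `T`,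
`S` noetherian and `S` faithfully flat over `T`: `caⁿ⁺¹(S) ∩ T ⊆ caⁿ⁺¹(T)`, i.e.
`(caⁿ⁺¹ S).comap (algebraMap T S) ≤ caⁿ⁺¹ T`.  By CA1 (`mem_cohomologyAnnihilatorOfDegree_succ_iff_forall_isSyzygy`)
it suffices that `x` stably annihilates every `n`-th syzygy `K` of a finitely generated `T`-module
`M`; `S ⊗ K` is an `n`-th syzygy of `S ⊗ M` (tree `IsSyzygy.baseChange`, `S` flat), so `algebraMap x`
stably annihilates it (CA1 over `S`), and (D1) descends this to `K` (finitely generated over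
noetherian `T`, hence finitely presented). [folklore; IyengarTakahashi2014 §2 vocabulary]
[cite: BahlekehHakimianSalarianTakahashi2015, Theorem 4.5 (1) (proof: faithfully flat descent)] -/
theorem comap_cohomologyAnnihilatorOfDegree_succ_le_of_faithfullyFlat {T S : Type u} [CommRing T]
    [CommRing S] [Algebra T S] [IsNoetherianRing T] [IsNoetherianRing S] [Module.FaithfullyFlat T S]
    (n : ℕ) :
    (cohomologyAnnihilatorOfDegree S (n + 1)).comap (algebraMap T S) ≤
      cohomologyAnnihilatorOfDegree T (n + 1) := by
  intro x hx
  rw [Ideal.mem_comap] at hx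
  rw [mem_cohomologyAnnihilatorOfDegree_succ_iff_forall_isSyzygy]
  intro M K hM hK
  haveI := hM
  haveI : Module.Finite T K := finite_of_isSyzygy n hM hK
  haveI : Module.FinitePresentation T K := Module.finitePresentation_of_finite T K
  have hKS : IsSyzygy n (ModuleCat.of S (S ⊗[T] M)) (ModuleCat.of S (S ⊗[T] K)) :=
    IsSyzygy.baseChange S n hK
  have hS : StablyAnnihilates S (algebraMap T S x) (ModuleCat.of S (S ⊗[T] K)) :=
    (mem_cohomologyAnnihilatorOfDegree_succ_iff_forall_isSyzygy (algebraMap T S x)).mp hx _ _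
      (Module.Finite.base_change T S M) hKS
  exact StablyAnnihilates.of_faithfullyFlat_baseChange (S := S) x K hS

/-- **(D2, `ca` form)** For `T`, `S` noetherian and `S` faithfully flat over `T`: `ca(S) ∩ T ⊆ ca(T)`
(`ca = ⋃ₙ caⁿ`, and `caⁿ ⊆ caⁿ⁺¹`). [cite: BahlekehHakimianSalarianTakahashi2015, Theorem 4.5 (1) (proof: faithfully flat descent)] -/
theorem comap_cohomologyAnnihilator_le_of_faithfullyFlat {T S : Type u} [CommRing T] [CommRing S]
    [Algebra T S] [IsNoetherianRing T] [IsNoetherianRing S] [Module.FaithfullyFlat T S] :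
    (cohomologyAnnihilator S).comap (algebraMap T S) ≤ cohomologyAnnihilator T := by
  intro x hx
  rw [Ideal.mem_comap, mem_cohomologyAnnihilator_iff] at hx
  obtain ⟨n, hn⟩ := hx
  rw [mem_cohomologyAnnihilator_iff]
  refine ⟨n + 1, comap_cohomologyAnnihilatorOfDegree_succ_le_of_faithfullyFlat (S := S) n ?_⟩
  rw [Ideal.mem_comap]
  exact cohomologyAnnihilatorOfDegree_mono (Nat.le_succ n) hn

/-- **(D2, elementwise)** For `T`, `S` noetherian, `S` faithfully flat over `T`, and `x ∈ T` with
`algebraMap T S x ∈ caⁿ⁺¹(S)`: `x ∈ caⁿ⁺¹(T)`. [cite: BahlekehHakimianSalarianTakahashi2015, Theorem 4.5 (1) (proof: faithfully flat descent)] -/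
theorem mem_cohomologyAnnihilatorOfDegree_succ_of_faithfullyFlat {T S : Type u} [CommRing T]
    [CommRing S] [Algebra T S] [IsNoetherianRing T] [IsNoetherianRing S] [Module.FaithfullyFlat T S]
    {n : ℕ} {x : T} (hx : algebraMap T S x ∈ cohomologyAnnihilatorOfDegree S (n + 1)) :
    x ∈ cohomologyAnnihilatorOfDegree T (n + 1) :=
  comap_cohomologyAnnihilatorOfDegree_succ_le_of_faithfullyFlat (S := S) n (Ideal.mem_comap.mpr hx)

/-! ## (D3) Flat local homomorphisms and étale neighbourhoods -/

/-- **(D3) `caⁿ⁺¹` descends along a flat local homomorphism of noetherian local rings** (same index):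
such a map is faithfully flat (Mathlib `Module.FaithfullyFlat.of_flat_of_isLocalHom`), so (D2)
applies.  This covers every (pointed) étale neighbourhood `T' → E_𝔮` of a noetherian local `T'` and the
maps `T' → T'ʰ`, `T' → T̂'` whenever the target is known to be noetherian. [cite: BahlekehHakimianSalarianTakahashi2015, Theorem 4.5 (1) (proof: faithfully flat descent)] -/
theorem comap_cohomologyAnnihilatorOfDegree_succ_le_of_flat_of_isLocalHom {T S : Type u} [CommRing T]
    [CommRing S] [Algebra T S] [IsNoetherianRing T] [IsNoetherianRing S] [IsLocalRing T]
    [IsLocalRing S] [Module.Flat T S] [IsLocalHom (algebraMap T S)] (n : ℕ) :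
    (cohomologyAnnihilatorOfDegree S (n + 1)).comap (algebraMap T S) ≤
      cohomologyAnnihilatorOfDegree T (n + 1) := by
  haveI : Module.FaithfullyFlat T S := Module.FaithfullyFlat.of_flat_of_isLocalHom
  exact comap_cohomologyAnnihilatorOfDegree_succ_le_of_faithfullyFlat n

/-- **(D3, étale neighbourhoods)** `caⁿ⁺¹` descends along every pointed ÉTALE NEIGHBOURHOOD of a
noetherian local ring (same index): for `T` local noetherian, `E` an étale `T`-algebra, `𝔮` a prime
of `E` over the closed point of `T` and `S = E_𝔮` (any localisation of `E` at `𝔮`, with the composite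
algebra structure `T → E → S`): `caⁿ⁺¹(S) ∩ T ⊆ caⁿ⁺¹(T)`.  Indeed `S` is local, noetherian (`E` is of
finite type over `T`), flat over `T` (étale ⇒ smooth ⇒ flat, and localisations are flat), and
`T → S` is a local homomorphism (`𝔪_S ∩ E = 𝔮`, `𝔮 ∩ T = 𝔪_T`); apply
`comap_cohomologyAnnihilatorOfDegree_succ_le_of_flat_of_isLocalHom`.  This is the model
`T₂ := E_𝔮` of the descent conjunct of ORDER w44b-o8's step dual cover. [cite: BahlekehHakimianSalarianTakahashi2015, Theorem 4.5 (1) (proof: faithfully flat descent)] -/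
theorem comap_cohomologyAnnihilatorOfDegree_succ_le_of_etale_neighbourhood {T E S : Type u}
    [CommRing T] [CommRing E] [CommRing S] [Algebra T E] [Algebra E S] [Algebra T S]
    [IsScalarTower T E S] [IsNoetherianRing T] [IsLocalRing T] [Algebra.Etale T E]
    (𝔮 : Ideal E) [𝔮.IsPrime] [IsLocalization.AtPrime S 𝔮]
    (h𝔮 : 𝔮.under T = IsLocalRing.maximalIdeal T) (n : ℕ) :
    (cohomologyAnnihilatorOfDegree S (n + 1)).comap (algebraMap T S) ≤
      cohomologyAnnihilatorOfDegree T (n + 1) := by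
  haveI : IsLocalRing S := IsLocalization.AtPrime.isLocalRing S 𝔮
  haveI : IsNoetherianRing E := Algebra.FiniteType.isNoetherianRing T E
  haveI : IsNoetherianRing S := IsLocalization.isNoetherianRing 𝔮.primeCompl S inferInstance
  haveI : Module.Flat E S := IsLocalization.flat S 𝔮.primeCompl
  haveI : Module.Flat T S := Module.Flat.trans T E S
  haveI : IsLocalHom (algebraMap T S) := by
    refine ((IsLocalRing.local_hom_TFAE (algebraMap T S)).out 0 4).mpr ?_
    have h1 : (IsLocalRing.maximalIdeal S).under T = IsLocalRing.maximalIdeal T := by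
      rw [← Ideal.under_under (B := E) (IsLocalRing.maximalIdeal S),
        IsLocalization.AtPrime.under_maximalIdeal S 𝔮, h𝔮]
    exact h1
  exact comap_cohomologyAnnihilatorOfDegree_succ_le_of_flat_of_isLocalHom n

/-- **(D3, étale neighbourhoods, `ca` form)** In the setting of
`comap_cohomologyAnnihilatorOfDegree_succ_le_of_etale_neighbourhood`: `ca(E_𝔮) ∩ T ⊆ ca(T)`.
[cite: BahlekehHakimianSalarianTakahashi2015, Theorem 4.5 (1) (proof: faithfully flat descent)] -/
theorem comap_cohomologyAnnihilator_le_of_etale_neighbourhood {T E S : Type u}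
    [CommRing T] [CommRing E] [CommRing S] [Algebra T E] [Algebra E S] [Algebra T S]
    [IsScalarTower T E S] [IsNoetherianRing T] [IsLocalRing T] [Algebra.Etale T E]
    (𝔮 : Ideal E) [𝔮.IsPrime] [IsLocalization.AtPrime S 𝔮]
    (h𝔮 : 𝔮.under T = IsLocalRing.maximalIdeal T) :
    (cohomologyAnnihilator S).comap (algebraMap T S) ≤ cohomologyAnnihilator T := by
  intro x hx
  rw [Ideal.mem_comap, mem_cohomologyAnnihilator_iff] at hx
  obtain ⟨n, hn⟩ := hx
  rw [mem_cohomologyAnnihilator_iff]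
  refine ⟨n + 1, comap_cohomologyAnnihilatorOfDegree_succ_le_of_etale_neighbourhood (S := S) 𝔮 h𝔮 n ?_⟩
  rw [Ideal.mem_comap]
  exact cohomologyAnnihilatorOfDegree_mono (Nat.le_succ n) hn

end Literature.RingTheory.CohomologyAnnihilator.BHST2015.PersistenceFaithfullyFlatDescent

end

end Part2

/-!
## Part 3 — port of `Summits/ResolutionOfSingularities/ResolutionOfSingularities/Theorems/HomologicalConductorPersistenceFaithfullyFlatDescentCompletion.lean`

# Faithfully flat descent of `caⁿ` without noetherianity upstairs; the completion case

`[OURS · L1 w44b · follow-up to ORDER w44b-o8b (res-L1-w44b-plan-1), res-type-015 gen 14]` —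
helper for the surface rung `PersistenceSurface` (stmt-ResolutionOfSingularities-19970) of the crux
`HomologicalConductor.Persistence` (stmt-ResolutionOfSingularities-16484) and for the «C-comp»
transfer of crux chain W4.4 (`NoZeno` / `NoZenoR`).  NOT a statement of the manuscript under
adjudication in cell res-hironaka; nothing here is attributed to its author.  Pure commutative
algebra over Mathlib and the tree's `Literature.RingTheory.CohomologyAnnihilator` library.

The sibling file `…PersistenceFaithfullyFlatDescent` (p509146) proves
`caⁿ⁺¹(S) ∩ T ⊆ caⁿ⁺¹(T)` for `S` faithfully flat over `T` with BOTH rings noetherian; the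
noetherianity of `S` entered only through the forward direction of the reduction lemma CA1 over `S`.
Here that use is removed: an element of `caⁿ⁺¹(S)` stably annihilates every FINITELY PRESENTED `n`-th
syzygy over any commutative ring (`stablyAnnihilates_of_mem_of_isSyzygy_of_finitePresentation`), and
the base change of a syzygy of a finitely generated module over noetherian `T` is finitely presented.
Hence:

* `comap_cohomologyAnnihilatorOfDegree_le_of_faithfullyFlat` — for `T` noetherian and `S` ANY
  faithfully flat `T`-algebra: `caⁿ(S) ∩ T ⊆ caⁿ(T)` for every `n` (degree `0` separately:
  `ca⁰ = ⊥` upstairs and `T → S` is injective); `comap_cohomologyAnnihilator_le_of_faithfullyFlat'`.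
* `caCompletion_comap_le_holds` — the NAMED FACT
  `Literature.RingTheory.CohomologyAnnihilator.caCompletion_comap_le`
  ([BahlekehHakimianSalarianTakahashi2015, Theorem 4.5 (1)]: `caⁿ(R̂) ∩ R ⊆ caⁿ(R)` for every
  noetherian local `R` and every `n`, `R̂ = AdicCompletion 𝔪 R`) is THEREBY PROVED: `R → R̂` is flat
  (Mathlib `AdicCompletion.flat_of_isNoetherian`), local (Mathlib's `IsLocalRing R̂` and
  `IsLocalHom (algebraMap R R̂)` instances), hence faithfully flat
  (`Module.FaithfullyFlat.of_flat_of_isLocalHom`) — no noetherianity of `R̂` is needed (the obstacle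
  recorded in `Completion.lean`'s docstring is bypassed, not solved).  The conditional consequences
  in `Completion.lean` (`cohomologyAnnihilator_eq_comap_completion`, …) can now be fed
  `caCompletion_comap_le_holds` for their hypothesis `h₁`.

## References

* A. Bahlekeh, E. Hakimian, S. Salarian, R. Takahashi, *Annihilation of cohomology, generation of
  modules and finiteness of derived dimension*, Q. J. Math. 67 (2016); arXiv:1503.03947 — Thm. 4.5 (1)
  («`R → R̂` is faithfully flat, hence pure»). [`BahlekehHakimianSalarianTakahashi2015`]
* S. B. Iyengar, R. Takahashi, *Annihilation of cohomology and strong generation of module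
  categories*, IMRN 2016; arXiv:1404.1476 — §2, Remark 2.13. [`IyengarTakahashi2014`]
-/

section Part3

noncomputable section

open _root_.CategoryTheory CategoryTheory.Abelian Literature.RingTheory.CohomologyAnnihilator
open Literature.RingTheory.CohomologyAnnihilator
open scoped _root_.TensorProduct

universe u

namespace Literature.RingTheory.CohomologyAnnihilator.BHST2015.PersistenceFaithfullyFlatDescentCompletion

open Literature.RingTheory.CohomologyAnnihilator.BHST2015.PersistenceFaithfullyFlatDescent

/-! ## CA1 forward without noetherianity, for finitely presented modules -/

/-- Over ANY commutative ring `S`: a finitely presented module `K` with `x • Ext¹(K, N) = 0` for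
every finitely generated `N` is stably annihilated by `x` — for a finite free cover `P ↠ K` the
kernel is finitely generated (Mathlib `Module.FinitePresentation.fg_ker`), so the class of
`0 → ker → P → K → 0` is killed by `x` and `x • 𝟙 K` lifts to `P`.  (The tree's
`stablyAnnihilates_of_forall_smul_ext_one_eq_zero` is the noetherian version.)
[cite: IyengarTakahashi2014, Remark 2.13] -/
theorem stablyAnnihilates_of_forall_smul_ext_one_eq_zero_of_finitePresentation {S : Type u}
    [CommRing S] {x : S} (K : ModuleCat.{u} S) [Module.FinitePresentation S K]
    (h : ∀ N : ModuleCat.{u} S, Module.Finite S N → ∀ e : Ext.{u} K N 1, x • e = 0) :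
    StablyAnnihilates S x K := by
  obtain ⟨P, _, _, _, _, f, surjf⟩ := Module.exists_finite_presentation S K
  have hS := LinearMap.shortExact_shortComplexKer surjf
  haveI : Module.Finite S (LinearMap.ker f) :=
    Module.Finite.iff_fg.mpr (Module.FinitePresentation.fg_ker f surjf)
  have hcl : x • hS.extClass = 0 := h (ModuleCat.of S (LinearMap.ker f)) inferInstance _
  obtain ⟨ψ, hψ⟩ := exists_comp_eq_smul_id_X₃_of_smul_extClass_eq_zero hS hcl
  exact ⟨ModuleCat.of S P, inferInstance, inferInstance, ψ, ModuleCat.ofHom f, hψ⟩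

/-- **CA1, forward direction, without noetherianity**: over any commutative ring `S`, an element
`x ∈ caⁿ⁺¹(S)` stably annihilates every finitely presented `n`-th syzygy module `K` of a finitely
generated module `M` (injective dimension shifting `Ext¹(K, N) ↪ Extⁿ⁺¹(M, N)`, tree
`ext_smul_eq_zero_of_isSyzygy`, then the previous lemma). [cite: IyengarTakahashi2014, Remark 2.3] -/
theorem stablyAnnihilates_of_mem_of_isSyzygy_of_finitePresentation {S : Type u} [CommRing S]
    {n : ℕ} {x : S} (hx : x ∈ cohomologyAnnihilatorOfDegree S (n + 1)) {M K : ModuleCat.{u} S}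
    [Module.Finite S M] [Module.FinitePresentation S K] (hK : IsSyzygy n M K) :
    StablyAnnihilates S x K := by
  refine stablyAnnihilates_of_forall_smul_ext_one_eq_zero_of_finitePresentation K fun N hN e => ?_
  haveI := hN
  refine ext_smul_eq_zero_of_isSyzygy n hK N 1 le_rfl x (fun e' => ?_) e
  exact smul_eq_zero_of_mem_cohomologyAnnihilatorOfDegree hx (i := 1 + n) (by omega) e'

/-! ## Faithfully flat descent of `caⁿ`, `S` arbitrary -/

/-- **`caⁿ⁺¹` descends along ANY faithfully flat algebra over a noetherian ring** (same index):
for `T` noetherian and `S` faithfully flat over `T` (not necessarily noetherian),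
`caⁿ⁺¹(S) ∩ T ⊆ caⁿ⁺¹(T)`.  As in the sibling file: CA1 over `T`; for an `n`-th syzygy `K` of a
finitely generated `T`-module `M`, `S ⊗ K` is a finitely presented `n`-th syzygy of `S ⊗ M`
(`IsSyzygy.baseChange`; `K` is finitely generated over noetherian `T`, hence finitely presented, and
finite presentation is stable under base change), so `algebraMap x` stably annihilates it
(`stablyAnnihilates_of_mem_of_isSyzygy_of_finitePresentation`), and (D1)
`StablyAnnihilates.of_faithfullyFlat_baseChange` descends. [cite: BahlekehHakimianSalarianTakahashi2015, Theorem 4.5 (1) (proof: faithfully flat descent)] -/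
theorem comap_cohomologyAnnihilatorOfDegree_succ_le_of_faithfullyFlat' {T S : Type u} [CommRing T]
    [CommRing S] [Algebra T S] [IsNoetherianRing T] [Module.FaithfullyFlat T S] (n : ℕ) :
    (cohomologyAnnihilatorOfDegree S (n + 1)).comap (algebraMap T S) ≤
      cohomologyAnnihilatorOfDegree T (n + 1) := by
  intro x hx
  rw [Ideal.mem_comap] at hx
  rw [mem_cohomologyAnnihilatorOfDegree_succ_iff_forall_isSyzygy]
  intro M K hM hK
  haveI := hM
  haveI : Module.Finite T K := finite_of_isSyzygy n hM hK
  haveI : Module.FinitePresentation T K := Module.finitePresentation_of_finite T K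
  have hKS : IsSyzygy n (ModuleCat.of S (S ⊗[T] M)) (ModuleCat.of S (S ⊗[T] K)) :=
    IsSyzygy.baseChange S n hK
  have hS : StablyAnnihilates S (algebraMap T S x) (ModuleCat.of S (S ⊗[T] K)) :=
    stablyAnnihilates_of_mem_of_isSyzygy_of_finitePresentation hx hKS
  exact StablyAnnihilates.of_faithfullyFlat_baseChange (S := S) x K hS

/-- **`caⁿ` descends along any faithfully flat algebra over a noetherian ring, every `n`**: degree
`n + 1` is the previous theorem; in degree `0`, `ca⁰(S) = ⊥` when `S` is nontrivial (tree
`cohomologyAnnihilatorOfDegree_zero`) and `T → S` is injective (`S` faithfully flat, Mathlib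
`Module.FaithfullyFlat.faithfulSMul`), while a trivial `S` forces a trivial `T`. [cite: BahlekehHakimianSalarianTakahashi2015, Theorem 4.5 (1) (proof: faithfully flat descent)] -/
theorem comap_cohomologyAnnihilatorOfDegree_le_of_faithfullyFlat {T S : Type u} [CommRing T]
    [CommRing S] [Algebra T S] [IsNoetherianRing T] [Module.FaithfullyFlat T S] (n : ℕ) :
    (cohomologyAnnihilatorOfDegree S n).comap (algebraMap T S) ≤ cohomologyAnnihilatorOfDegree T n := by
  cases n with
  | succ n => exact comap_cohomologyAnnihilatorOfDegree_succ_le_of_faithfullyFlat' n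
  | zero =>
    intro x hx
    rw [Ideal.mem_comap] at hx
    have hinj := FaithfulSMul.algebraMap_injective T S
    rcases subsingleton_or_nontrivial S with hS | hS
    · haveI : Subsingleton T := hinj.subsingleton
      rw [Subsingleton.elim x 0]
      exact Ideal.zero_mem _
    · rw [cohomologyAnnihilatorOfDegree_zero, Ideal.mem_bot] at hx
      rw [show x = 0 from hinj (by rw [hx, map_zero])]
      exact Ideal.zero_mem _

/-- **`ca` descends along any faithfully flat algebra over a noetherian ring**: `ca(S) ∩ T ⊆ ca(T)`
(no noetherianity of `S`). [cite: BahlekehHakimianSalarianTakahashi2015, Theorem 4.5 (1) (proof: faithfully flat descent)] -/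
theorem comap_cohomologyAnnihilator_le_of_faithfullyFlat' {T S : Type u} [CommRing T] [CommRing S]
    [Algebra T S] [IsNoetherianRing T] [Module.FaithfullyFlat T S] :
    (cohomologyAnnihilator S).comap (algebraMap T S) ≤ cohomologyAnnihilator T := by
  intro x hx
  rw [Ideal.mem_comap, mem_cohomologyAnnihilator_iff] at hx
  obtain ⟨n, hn⟩ := hx
  rw [mem_cohomologyAnnihilator_iff]
  exact ⟨n, comap_cohomologyAnnihilatorOfDegree_le_of_faithfullyFlat (S := S) n
    (Ideal.mem_comap.mpr hn)⟩

/-! ## The completion of a noetherian local ring -/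

/-- The `𝔪`-adic completion of a noetherian local ring is FAITHFULLY FLAT over it: flat (Mathlib
`AdicCompletion.flat_of_isNoetherian`), local with local structure map (Mathlib's instances in
`RingTheory/AdicCompletion/LocalRing.lean`), and a flat local homomorphism of local rings is
faithfully flat (Mathlib `Module.FaithfullyFlat.of_flat_of_isLocalHom`).
[cite: Matsumura1987, Theorem 8.14] -/
theorem faithfullyFlat_adicCompletion (R : Type u) [CommRing R] [IsNoetherianRing R]
    [IsLocalRing R] :
    Module.FaithfullyFlat R (AdicCompletion (IsLocalRing.maximalIdeal R) R) :=
  Module.FaithfullyFlat.of_flat_of_isLocalHom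

/-- **[BahlekehHakimianSalarianTakahashi2015, Theorem 4.5 (1)] PROVED** — the named fact
`Literature.RingTheory.CohomologyAnnihilator.caCompletion_comap_le` holds: for every noetherian local
ring `R` and every `n`, `caⁿ(R̂) ∩ R ⊆ caⁿ(R)` (`R̂ = AdicCompletion 𝔪 R`).  By
`comap_cohomologyAnnihilatorOfDegree_le_of_faithfullyFlat` applied to the faithfully flat map
`R → R̂` (`faithfullyFlat_adicCompletion`); the printed proof's «`R → R̂` is faithfully flat, hence
pure» is exactly the mechanism, with the base change of `Ext` replaced by the presentation criterion
for stable annihilation. [cite: BahlekehHakimianSalarianTakahashi2015, Theorem 4.5 (1)] -/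
theorem _root_.Literature.RingTheory.CohomologyAnnihilator.caCompletion_comap_le_holds :
    Literature.RingTheory.CohomologyAnnihilator.caCompletion_comap_le.{u} := by
  intro R _ _ _ n
  haveI := faithfullyFlat_adicCompletion R
  exact comap_cohomologyAnnihilatorOfDegree_le_of_faithfullyFlat n

end Literature.RingTheory.CohomologyAnnihilator.BHST2015.PersistenceFaithfullyFlatDescentCompletion

end

end Part3

/-!
## Part 4 — port of `Summits/ResolutionOfSingularities/ResolutionOfSingularities/Theorems/HomologicalConductorPersistenceCompletionAscentOneStep.lean`

# The one-step lemma of Iyengar–Takahashi (Remark 2.12), general form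

`[OURS · L w44b · completion model, ascent half · res-type-015 gen 15]` — first brick towards the
discharge of the named fact `Literature.RingTheory.CohomologyAnnihilator.le_caCompletion_comap`
([BahlekehHakimianSalarianTakahashi2015, Thm. 4.5 (2)]), helper for the surface rung
`PersistenceSurface` (stmt-ResolutionOfSingularities-19970) of crux chain w44b.  NOT a statement of
the manuscript under adjudication in cell res-hironaka; pure commutative algebra over Mathlib and the
tree's `Literature.RingTheory.CohomologyAnnihilator` library (`IsSyzygy`, `StablyAnnihilates`).

[IyengarTakahashi2014, Remark 2.12]: *if `a` annihilates `Ext¹(M, ΩM)` then there is an exact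
sequence `0 → (0 :_M a) → M ⊕ ΩM → Ω(M/aM) → 0`.*  The tree's
`exists_retract_isSyzygy_quotSMulTop` (`ReductionModRegular.lean`) is the special case `a`
`M`-regular (then `(0 :_M a) = 0` and `M` is a retract of `Ω(M/aM)`).  Here the general form, with
the hypothesis in the shape «`a • 𝟙 M` factors through a finitely generated projective»
(`StablyAnnihilates`, which is what `a • Ext¹(M, ΩM) = 0` yields by the splitting criterion):

* `exists_cover_lift_of_stablyAnnihilates` — a stable annihilation `M → P₀ → M` of a finitely
  generated `M` can be moved onto a SURJECTIVE finitely generated projective cover `π : P ↠ M`: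
  `π ψ = a • 𝟙` (add a finite free cover to `P₀`);
* `exists_shortExact_torsionBy_prod_syzygy` — **the one-step lemma**: for `M` finitely generated and
  stably annihilated by `a` there are a first syzygy `K = ΩM`, a first syzygy `L = Ω(M/aM)` of
  `M/aM` and a short exact sequence `0 → (0 :_M a) → M ⊕ K → L → 0` (`(0 :_M a)` = Mathlib's
  `Submodule.torsionBy`).  Construction: `K = Ker π`, `L = π⁻¹(aM) = Ker(P → M/aM)`,
  `(m, k) ↦ ψ m + k`, kernel `{(m, -ψ m) : a m = 0}`.

This is the engine of the induction «every punctured-free module over a completion-like pair is a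
retract of a base change» (sibling files `…CompletionAscent*`).

References: S. B. Iyengar, R. Takahashi, *Annihilation of cohomology and strong generation of module
categories*, IMRN 2016; arXiv:1404.1476 — Remark 2.12 [`IyengarTakahashi2014`].
-/

section Part4

noncomputable section

open _root_.CategoryTheory _root_.CategoryTheory.Limits Literature.RingTheory.CohomologyAnnihilator
open Literature.RingTheory.CohomologyAnnihilator
open scoped _root_.Pointwise

universe u

namespace Literature.RingTheory.CohomologyAnnihilator.BHST2015.CompletionAscentOneStep

variable {T : Type u} [CommRing T]

/-- A stable annihilation of a finitely generated module can be realised on a surjective cover: if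
`a • 𝟙 M` factors through a finitely generated projective, then there are a finitely generated
projective `P`, a SURJECTION `π : P ↠ M` and `ψ : M → P` with `π (ψ m) = a • m` (add a finite free
cover `F ↠ M` to the given `P₀` and let `ψ` land in the `P₀` summand). [cite: BahlekehHakimianSalarianTakahashi2015, Theorem 4.5 (2) (proof: completion ascent, Corollary 4.4)] -/
theorem exists_cover_lift_of_stablyAnnihilates {a : T} {M : ModuleCat.{u} T} [Module.Finite T M]
    (h : StablyAnnihilates T a M) :
    ∃ (P : ModuleCat.{u} T) (_ : Module.Finite T P) (_ : Projective P) (π : P →ₗ[T] M)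
      (ψ : M →ₗ[T] P), Function.Surjective π ∧ ∀ m : M, π (ψ m) = a • m := by
  obtain ⟨P₀, hP₀, hP₀proj, ι, π₀, hιπ⟩ := h
  obtain ⟨n, q, hq⟩ := Module.Finite.exists_fin' T M
  haveI := hP₀
  refine ⟨ModuleCat.of T (P₀ × (Fin n → T)), inferInstance,
    projective_prod hP₀proj ((IsProjective.iff_projective (R := T) (Fin n → T)).mp inferInstance),
    π₀.hom.coprod q, (LinearMap.inl T P₀ (Fin n → T)) ∘ₗ ι.hom, ?_, fun m => ?_⟩
  · intro m
    obtain ⟨f, rfl⟩ := hq m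
    exact ⟨(0, f), by simp⟩
  · have := congrArg (fun φ : M ⟶ M => φ.hom m) hιπ
    simpa using this

/-- **One-step lemma [IyengarTakahashi2014, Remark 2.12], general form.**  Let `M` be a finitely
generated `T`-module stably annihilated by `a` (`a • 𝟙 M` factors through a finitely generated
projective).  Then there are a first syzygy `K` of `M`, a first syzygy `L` of `M/aM`, and a short
exact sequence `0 → (0 :_M a) → M ⊕ K → L → 0`.  With a cover `π : P ↠ M` and `π ψ = a • 𝟙`
(`exists_cover_lift_of_stablyAnnihilates`): `K = Ker π`, `L = Ker(P ↠ M/aM) = π⁻¹(aM)` (a first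
syzygy of `M/aM`), the surjection `M ⊕ K → L` is `(m, k) ↦ ψ m + k`, and its kernel
`{(m, -ψ m) | a m = 0}` is `(0 :_M a) = Submodule.torsionBy T M a`.
[cite: IyengarTakahashi2014, Remark 2.12] -/
theorem exists_shortExact_torsionBy_prod_syzygy {a : T} {M : ModuleCat.{u} T} [Module.Finite T M]
    (h : StablyAnnihilates T a M) :
    ∃ (K L : ModuleCat.{u} T), IsSyzygy 1 M K ∧
      IsSyzygy 1 (ModuleCat.of T (M ⧸ (a • ⊤ : Submodule T M))) L ∧
      ∃ (f : ModuleCat.of T (Submodule.torsionBy T M a) ⟶ ModuleCat.of T (M × K))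
        (g : ModuleCat.of T (M × K) ⟶ L) (w : f ≫ g = 0), (ShortComplex.mk f g w).ShortExact := by
  obtain ⟨P, hPfin, hPproj, π, ψ, hπ, hψ⟩ := exists_cover_lift_of_stablyAnnihilates h
  haveI := hPfin
  -- `K = Ker π`, a first syzygy of `M`
  let K : Submodule T P := LinearMap.ker π
  obtain ⟨wK, hSK⟩ := exists_shortExact_of_linearMap (Y := ModuleCat.of T K) (M := P) (X := M)
    K.subtype π Subtype.val_injective hπ (LinearMap.exact_subtype_ker_map π)
  have hK : IsSyzygy 1 M (ModuleCat.of T K) := isSyzygy_one_iff.mpr ⟨P, hPfin, hPproj, _, _, wK, hSK⟩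
  -- `L = Ker (P → M/aM)`, a first syzygy of `M/aM`
  let ρ : P →ₗ[T] M ⧸ (a • ⊤ : Submodule T M) := (a • ⊤ : Submodule T M).mkQ ∘ₗ π
  have hρ : Function.Surjective ρ := (Submodule.mkQ_surjective _).comp hπ
  let L : Submodule T P := LinearMap.ker ρ
  obtain ⟨wL, hSL⟩ := exists_shortExact_of_linearMap (Y := ModuleCat.of T L) (M := P)
    (X := ModuleCat.of T (M ⧸ (a • ⊤ : Submodule T M))) L.subtype ρ Subtype.val_injective hρ
    (LinearMap.exact_subtype_ker_map ρ)
  have hL : IsSyzygy 1 (ModuleCat.of T (M ⧸ (a • ⊤ : Submodule T M))) (ModuleCat.of T L) :=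
    isSyzygy_one_iff.mpr ⟨P, hPfin, hPproj, _, _, wL, hSL⟩
  -- `θ : M ⊕ K → L`, `(m, k) ↦ ψ m + k`
  have hψL : ∀ m : M, ψ m ∈ L := fun m => by
    change (a • ⊤ : Submodule T M).mkQ (π (ψ m)) = 0
    rw [hψ, Submodule.mkQ_apply, Submodule.Quotient.mk_eq_zero]
    exact Submodule.smul_mem_pointwise_smul _ _ _ trivial
  have hKL : ∀ k : K, (k : P) ∈ L := fun k => by
    change (a • ⊤ : Submodule T M).mkQ (π k) = 0
    rw [LinearMap.mem_ker.mp k.2, map_zero]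
  let θ : (M × K) →ₗ[T] L :=
    LinearMap.codRestrict L (ψ ∘ₗ LinearMap.fst T M K ∘ₗ LinearMap.id + K.subtype ∘ₗ LinearMap.snd T M K)
      fun mk => L.add_mem (hψL mk.1) (hKL mk.2)
  have hθ : ∀ mk : M × K, (θ mk : P) = ψ mk.1 + mk.2 := fun mk => rfl
  have hθsurj : Function.Surjective θ := by
    intro l
    have hl : π (l : P) ∈ (a • ⊤ : Submodule T M) := by
      have h0 : ρ l = 0 := l.2
      change (a • ⊤ : Submodule T M).mkQ (π l) = 0 at h0
      rwa [Submodule.mkQ_apply, Submodule.Quotient.mk_eq_zero] at h0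
    obtain ⟨m, -, hm⟩ := (Submodule.mem_smul_pointwise_iff_exists _ _ _).1 hl
    have hk : (l : P) - ψ m ∈ K := by
      rw [LinearMap.mem_ker, map_sub, hψ, ← hm]
      exact sub_self _
    refine ⟨(m, ⟨_, hk⟩), Subtype.ext ?_⟩
    rw [hθ]
    change ψ m + ((l : P) - ψ m) = l
    abel
  -- `α : (0 :_M a) → M ⊕ K`, `m ↦ (m, -ψ m)`
  have hψK : ∀ m : Submodule.torsionBy T M a, -ψ (m : M) ∈ K := fun m => by
    rw [LinearMap.mem_ker, map_neg, hψ, neg_eq_zero]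
    exact (Submodule.mem_torsionBy_iff a (m : M)).mp m.2
  let α : Submodule.torsionBy T M a →ₗ[T] (M × K) :=
    LinearMap.prod (Submodule.torsionBy T M a).subtype
      (LinearMap.codRestrict K (-(ψ ∘ₗ (Submodule.torsionBy T M a).subtype)) hψK)
  have hα : ∀ m : Submodule.torsionBy T M a, α m = ((m : M), ⟨-ψ (m : M), hψK m⟩) := fun m => rfl
  have hαinj : Function.Injective α := fun m₁ m₂ hm =>
    Subtype.ext (congrArg Prod.fst hm)
  have hαθ : Function.Exact α θ := by
    intro mk
    constructor
    · intro h0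
      have h1 : ψ mk.1 + (mk.2 : P) = 0 := by
        have := congrArg Subtype.val h0
        rwa [hθ] at this
      have h2 : (mk.2 : P) = -ψ mk.1 := eq_neg_of_add_eq_zero_right h1
      have h3 : a • mk.1 = 0 := by
        have hk2 : π (mk.2 : P) = 0 := LinearMap.mem_ker.mp mk.2.2
        rw [h2, map_neg, hψ, neg_eq_zero] at hk2
        exact hk2
      refine ⟨⟨mk.1, (Submodule.mem_torsionBy_iff a mk.1).mpr h3⟩, ?_⟩
      rw [hα]
      exact Prod.ext rfl (Subtype.ext h2.symm)
    · rintro ⟨m, rfl⟩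
      apply Subtype.ext
      rw [hθ, hα]
      change ψ (m : M) + -ψ (m : M) = ((0 : L) : P)
      rw [add_neg_cancel]
      rfl
  obtain ⟨w, hS⟩ := exists_shortExact_of_linearMap
    (Y := ModuleCat.of T (Submodule.torsionBy T M a)) (M := ModuleCat.of T (M × K))
    (X := ModuleCat.of T L) α θ hαinj hθsurj hαθ
  exact ⟨ModuleCat.of T K, ModuleCat.of T L, hK, hL, _, _, w, hS⟩

end Literature.RingTheory.CohomologyAnnihilator.BHST2015.CompletionAscentOneStep

end

end Part4

/-!
## Part 5 — port of `Summits/ResolutionOfSingularities/ResolutionOfSingularities/Theorems/HomologicalConductorPersistenceCompletionAscentLifting.lean`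

# Lifting an extension with finite-length kernel along a base change

`[OURS · L w44b · completion model, ascent half · res-type-015 gen 15]` — second brick towards the
discharge of the named fact `Literature.RingTheory.CohomologyAnnihilator.le_caCompletion_comap`
([BahlekehHakimianSalarianTakahashi2015, Thm. 4.5 (2)]), helper for the surface rung
`PersistenceSurface` (stmt-ResolutionOfSingularities-19970) of crux chain w44b.  NOT a statement of
the manuscript under adjudication in cell res-hironaka; pure linear algebra over Mathlib.

The printed proof of [BHST15, Cor. 4.4] lifts extensions of completed modules along `R → R̂` via
[Takahashi 2010, stcm] (an extension class in `Ext¹_R̂(N̂₂, N̂₁) = Ext¹_R(N₂, N₁)^` comes from `R`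
when that `Ext` group has finite length).  We use the following `Ext`-free form, for an ARBITRARY
algebra `R → S`:

* `exists_linearEquiv_baseChange_of_extension` — let `0 → S ⊗_R A₀ —f→ B —g→ S ⊗_R N → 0` be an
  exact sequence of `S`-modules with `N`, `A₀` finitely generated over `R` and such that
  `a ↦ 1 ⊗ a : A₀ → S ⊗_R A₀` is BIJECTIVE (e.g. `A₀` of finite length and `S = R̂`).  Then
  `B ≅ S ⊗_R N'` for a finitely generated `R`-module `N'`.

Proof: choose `0 → K → Rᵇ → N → 0`; lift `S ⊗ Rᵇ ↠ S ⊗ N` to `β : S ⊗ Rᵇ → B`; the induced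
`γ : S ⊗ K → S ⊗ A₀` (`f γ = β ∘ (S ⊗ ι)`) is `S ⊗ h₀` for the `R`-linear `h₀ k = 1⁻¹(γ (1 ⊗ k))`
(this is where bijectivity of `A₀ → S ⊗ A₀` enters); then `B` is the quotient of
`S ⊗ (A₀ × Rᵇ)` by the image of `S ⊗ K` under `S ⊗ (h₀, -ι)`, i.e. `B ≅ S ⊗_R N'` with
`N' = (A₀ × Rᵇ)/(h₀, -ι)(K)` the push-out (right exactness of `S ⊗_R -`).  No flatness is needed.

References: A. Bahlekeh, E. Hakimian, S. Salarian, R. Takahashi, arXiv:1504.06163, Cor. 4.4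
[`BahlekehHakimianSalarianTakahashi2015`]; R. Takahashi, *Classifying thick subcategories of the
stable category of Cohen–Macaulay modules*, Adv. Math. 225 (2010) [stcm].
-/

section Part5

noncomputable section

open scoped _root_.TensorProduct

universe u

namespace Literature.RingTheory.CohomologyAnnihilator.BHST2015.CompletionAscentLifting

variable {R S : Type u} [CommRing R] [CommRing S] [Algebra R S]

/-- Two `S`-linear maps out of `S ⊗_R M` agreeing on the elementary tensors `1 ⊗ m` are equal.
[cite: BahlekehHakimianSalarianTakahashi2015, Theorem 4.5 (2) (proof: completion ascent, Corollary 4.4)] -/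
theorem linearMap_ext_one_tmul {M : Type u} [AddCommGroup M] [Module R M] {P : Type u}
    [AddCommGroup P] [Module S P] {φ χ : S ⊗[R] M →ₗ[S] P}
    (h : ∀ m : M, φ ((1 : S) ⊗ₜ[R] m) = χ ((1 : S) ⊗ₜ[R] m)) : φ = χ := by
  refine LinearMap.ext fun x => ?_
  induction x using TensorProduct.induction_on with
  | zero => rw [map_zero, map_zero]
  | tmul s m =>
    have hs : s ⊗ₜ[R] m = s • ((1 : S) ⊗ₜ[R] m) := by
      rw [TensorProduct.smul_tmul', smul_eq_mul, mul_one]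
    rw [hs, map_smul, map_smul, h]
  | add x y hx hy => rw [map_add, map_add, hx, hy]

/-- `x = inl (fst x) + inr (snd x)` on `S ⊗_R (A × F)`, with the base-changed structure maps.
[cite: BahlekehHakimianSalarianTakahashi2015, Theorem 4.5 (2) (proof: completion ascent, Corollary 4.4)] -/
theorem baseChange_inl_fst_add_inr_snd {A F : Type u} [AddCommGroup A] [Module R A]
    [AddCommGroup F] [Module R F] (x : S ⊗[R] (A × F)) :
    (LinearMap.inl R A F).baseChange S ((LinearMap.fst R A F).baseChange S x) +
      (LinearMap.inr R A F).baseChange S ((LinearMap.snd R A F).baseChange S x) = x := by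
  induction x using TensorProduct.induction_on with
  | zero => simp
  | tmul s p =>
    obtain ⟨a, v⟩ := p
    simp only [LinearMap.baseChange_tmul, LinearMap.fst_apply, LinearMap.snd_apply,
      LinearMap.inl_apply, LinearMap.inr_apply, ← TensorProduct.tmul_add, Prod.mk_add_mk, add_zero,
      zero_add]
  | add x y hx hy =>
    rw [map_add, map_add, map_add, map_add, add_add_add_comm, hx, hy]

/-- **Lifting an extension with «finite-length» kernel along a base change.**  Let `R → S` be an
algebra, `A₀` and `N` finitely generated `R`-modules with `a ↦ 1 ⊗ a : A₀ → S ⊗_R A₀` bijective,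
and `0 → S ⊗_R A₀ —f→ B —g→ S ⊗_R N → 0` an exact sequence of `S`-modules.  Then `B ≅ S ⊗_R N'`
(`S`-linearly) for some finitely generated `R`-module `N'` (the push-out of a presentation
`K ↪ Rᵇ ↠ N` along the `R`-linear map `K → A₀` underlying the comparison map `S ⊗ K → S ⊗ A₀`).
[cite: BahlekehHakimianSalarianTakahashi2015, Corollary 4.4 (proof mechanism, via [stcm])] -/
theorem exists_linearEquiv_baseChange_of_extension
    {A₀ : Type u} [AddCommGroup A₀] [Module R A₀] [Module.Finite R A₀]
    (hA₀ : Function.Bijective (TensorProduct.mk R S A₀ 1))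
    {N : Type u} [AddCommGroup N] [Module R N] [Module.Finite R N]
    {B : Type u} [AddCommGroup B] [Module S B]
    (f : S ⊗[R] A₀ →ₗ[S] B) (g : B →ₗ[S] S ⊗[R] N)
    (hf : Function.Injective f) (hg : Function.Surjective g) (hfg : Function.Exact f g) :
    ∃ (N' : Type u) (_ : AddCommGroup N') (_ : Module R N') (_ : Module.Finite R N'),
      Nonempty (B ≃ₗ[S] S ⊗[R] N') := by
  classical
  -- a presentation `0 → K → Rᵇ → N → 0`
  obtain ⟨b, π₀, hπ₀⟩ := Module.Finite.exists_fin' R N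
  let F := Fin b → R
  let K : Submodule R F := LinearMap.ker π₀
  let ιK : K →ₗ[R] F := K.subtype
  have hιπ : Function.Exact ιK π₀ := LinearMap.exact_subtype_ker_map π₀
  -- base change of the presentation
  let πS : S ⊗[R] F →ₗ[S] S ⊗[R] N := π₀.baseChange S
  let ιS : S ⊗[R] K →ₗ[S] S ⊗[R] F := ιK.baseChange S
  have hιS : ∀ (s : S) (k : K), ιS (s ⊗ₜ[R] k) = s ⊗ₜ[R] (k : F) := fun s k =>
    LinearMap.baseChange_tmul _ _ _
  have hπS : Function.Surjective πS := by
    change Function.Surjective (π₀.baseChange S : S ⊗[R] F → S ⊗[R] N)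
    rw [LinearMap.baseChange_eq_ltensor]
    exact LinearMap.lTensor_surjective S hπ₀
  have hιπS : Function.Exact ιS πS := by
    change Function.Exact (ιK.baseChange S : S ⊗[R] K → S ⊗[R] F)
      (π₀.baseChange S : S ⊗[R] F → S ⊗[R] N)
    rw [LinearMap.baseChange_eq_ltensor, LinearMap.baseChange_eq_ltensor]
    exact lTensor_exact S hιπ hπ₀
  -- lift `πS` through `g`
  haveI : Module.Projective S (S ⊗[R] F) := Module.Projective.of_free
  obtain ⟨β, hβ⟩ := Module.projective_lifting_property g πS hg
  have hβ' : ∀ v, g (β v) = πS v := fun v => LinearMap.congr_fun hβ v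
  -- the comparison map `γ : S ⊗ K → S ⊗ A₀`, `f ∘ γ = β ∘ ιS`
  obtain ⟨γ, hγ⟩ : ∃ γ : S ⊗[R] K →ₗ[S] S ⊗[R] A₀, ∀ k, f (γ k) = β (ιS k) := by
    have hmem : ∀ k : S ⊗[R] K, β (ιS k) ∈ LinearMap.range f := fun k => by
      rw [← hfg.linearMap_ker_eq, LinearMap.mem_ker, hβ', hιπS.apply_apply_eq_zero]
    let eF := LinearEquiv.ofInjective f hf
    refine ⟨eF.symm.toLinearMap ∘ₗ LinearMap.codRestrict (LinearMap.range f) (β ∘ₗ ιS) hmem,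
      fun k => ?_⟩
    have h := congrArg Subtype.val (eF.apply_symm_apply ⟨β (ιS k), hmem k⟩)
    rw [LinearEquiv.ofInjective_apply] at h
    exact h
  -- descend `γ` to `R`: `γ (s ⊗ k) = s ⊗ h₀ k`
  obtain ⟨h₀, hh₀⟩ : ∃ h₀ : K →ₗ[R] A₀, ∀ (s : S) (k : K), γ (s ⊗ₜ[R] k) = s ⊗ₜ[R] h₀ k := by
    let eA : A₀ ≃ₗ[R] S ⊗[R] A₀ := LinearEquiv.ofBijective (TensorProduct.mk R S A₀ 1) hA₀
    have heA : ∀ a : A₀, eA a = (1 : S) ⊗ₜ[R] a := fun a => rfl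
    let h₀ : K →ₗ[R] A₀ := eA.symm.toLinearMap ∘ₗ (γ.restrictScalars R ∘ₗ TensorProduct.mk R S K 1)
    have hh₀ : ∀ k : K, (1 : S) ⊗ₜ[R] h₀ k = γ ((1 : S) ⊗ₜ[R] k) := fun k => by
      rw [← heA, show h₀ k = eA.symm (γ ((1 : S) ⊗ₜ[R] k)) from rfl, LinearEquiv.apply_symm_apply]
    have hγh₀ : γ = h₀.baseChange S :=
      linearMap_ext_one_tmul fun k => by rw [LinearMap.baseChange_tmul, hh₀]
    exact ⟨h₀, fun s k => by rw [hγh₀, LinearMap.baseChange_tmul]⟩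
  -- the push-out `N' = (A₀ × Rᵇ) / (h₀, -ι)(K)`
  let δ : K →ₗ[R] A₀ × F := LinearMap.prod h₀ (-ιK)
  have hδ : ∀ k : K, δ k = (h₀ k, -(k : F)) := fun k => rfl
  let N' := (A₀ × F) ⧸ LinearMap.range δ
  -- the structure maps of `S ⊗ (A₀ × Rᵇ)`
  let inlS : S ⊗[R] A₀ →ₗ[S] S ⊗[R] (A₀ × F) := (LinearMap.inl R A₀ F).baseChange S
  let inrS : S ⊗[R] F →ₗ[S] S ⊗[R] (A₀ × F) := (LinearMap.inr R A₀ F).baseChange S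
  let fstS : S ⊗[R] (A₀ × F) →ₗ[S] S ⊗[R] A₀ := (LinearMap.fst R A₀ F).baseChange S
  let sndS : S ⊗[R] (A₀ × F) →ₗ[S] S ⊗[R] F := (LinearMap.snd R A₀ F).baseChange S
  have hdec : ∀ x, inlS (fstS x) + inrS (sndS x) = x := baseChange_inl_fst_add_inr_snd
  have hfst_inl : ∀ a, fstS (inlS a) = a := fun a => by
    change ((LinearMap.fst R A₀ F).baseChange S ∘ₗ (LinearMap.inl R A₀ F).baseChange S) a = a
    rw [← LinearMap.baseChange_comp, LinearMap.fst_comp_inl, LinearMap.baseChange_id,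
      LinearMap.id_apply]
  have hsnd_inl : ∀ a, sndS (inlS a) = 0 := fun a => by
    change ((LinearMap.snd R A₀ F).baseChange S ∘ₗ (LinearMap.inl R A₀ F).baseChange S) a = 0
    rw [← LinearMap.baseChange_comp, LinearMap.snd_comp_inl, LinearMap.baseChange_zero,
      LinearMap.zero_apply]
  have hfst_inr : ∀ v, fstS (inrS v) = 0 := fun v => by
    change ((LinearMap.fst R A₀ F).baseChange S ∘ₗ (LinearMap.inr R A₀ F).baseChange S) v = 0
    rw [← LinearMap.baseChange_comp, LinearMap.fst_comp_inr, LinearMap.baseChange_zero,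
      LinearMap.zero_apply]
  have hsnd_inr : ∀ v, sndS (inrS v) = v := fun v => by
    change ((LinearMap.snd R A₀ F).baseChange S ∘ₗ (LinearMap.inr R A₀ F).baseChange S) v = v
    rw [← LinearMap.baseChange_comp, LinearMap.snd_comp_inr, LinearMap.baseChange_id,
      LinearMap.id_apply]
  -- `Θ : S ⊗ (A₀ × Rᵇ) → B`, `x ↦ f (fst x) + β (snd x)`
  let Θ : S ⊗[R] (A₀ × F) →ₗ[S] B := f ∘ₗ fstS + β ∘ₗ sndS
  have hΘ : ∀ x, Θ x = f (fstS x) + β (sndS x) := fun x => rfl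
  have hΘinl : ∀ a, Θ (inlS a) = f a := fun a => by
    rw [hΘ, hfst_inl, hsnd_inl, map_zero, add_zero]
  have hΘinr : ∀ v, Θ (inrS v) = β v := fun v => by
    rw [hΘ, hfst_inr, hsnd_inr, map_zero, zero_add]
  -- `δS = S ⊗ δ = inl ∘ γ - inr ∘ ιS`
  let δS : S ⊗[R] K →ₗ[S] S ⊗[R] (A₀ × F) := δ.baseChange S
  have hδS : ∀ k, δS k = inlS (γ k) - inrS (ιS k) := by
    intro k
    change δS k = (inlS ∘ₗ γ - inrS ∘ₗ ιS) k
    congr 1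
    refine linearMap_ext_one_tmul fun k => ?_
    rw [LinearMap.sub_apply, LinearMap.comp_apply, LinearMap.comp_apply, hh₀, hιS]
    change (1 : S) ⊗ₜ[R] δ k = (1 : S) ⊗ₜ[R] (LinearMap.inl R A₀ F (h₀ k)) -
      (1 : S) ⊗ₜ[R] (LinearMap.inr R A₀ F (k : F))
    rw [hδ, ← TensorProduct.tmul_sub, LinearMap.inl_apply, LinearMap.inr_apply, Prod.mk_sub_mk,
      sub_zero, zero_sub]
  have hΘsurj : Function.Surjective Θ := by
    intro x
    obtain ⟨v, hv⟩ := hπS (g x)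
    have hx : g (x - β v) = 0 := by rw [map_sub, hβ', hv, sub_self]
    obtain ⟨a, ha⟩ := (hfg _).1 hx
    refine ⟨inlS a + inrS v, ?_⟩
    rw [map_add, hΘinl, hΘinr, ha, sub_add_cancel]
  have hΘker : LinearMap.ker Θ = LinearMap.range δS := by
    apply le_antisymm
    · intro x hx
      rw [LinearMap.mem_ker, hΘ] at hx
      -- `g (β (snd x)) = 0`, so `snd x = ιS k`
      have hgv : πS (sndS x) = 0 := by
        rw [← hβ', show β (sndS x) = -f (fstS x) from eq_neg_of_add_eq_zero_right hx, map_neg,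
          hfg.apply_apply_eq_zero, neg_zero]
      obtain ⟨k, hk⟩ := (hιπS _).1 hgv
      -- `f (fst x) = -β (ιS k) = -f (γ k)`, so `fst x = -γ k`
      have hfa : f (fstS x) = f (-γ k) := by
        rw [map_neg, hγ, hk]
        exact eq_neg_of_add_eq_zero_left hx
      have hak : fstS x = -γ k := hf hfa
      refine ⟨-k, ?_⟩
      have hx' : x = inlS (-γ k) + inrS (ιS k) := by rw [← hak, hk, hdec]
      rw [hx', map_neg δS, hδS, map_neg inlS, neg_sub, sub_eq_neg_add]
    · rintro _ ⟨k, rfl⟩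
      rw [LinearMap.mem_ker, hδS, map_sub, hΘinl, hΘinr, hγ, sub_self]
  -- `S ⊗ N' ≅ (S ⊗ (A₀ × Rᵇ)) / range δS` (right exactness) `≅ B`
  have hexact : Function.Exact δS ((LinearMap.range δ).mkQ.baseChange S) := by
    change Function.Exact (δ.baseChange S : S ⊗[R] K → S ⊗[R] (A₀ × F))
      ((LinearMap.range δ).mkQ.baseChange S : S ⊗[R] (A₀ × F) → S ⊗[R] N')
    rw [LinearMap.baseChange_eq_ltensor, LinearMap.baseChange_eq_ltensor]
    exact lTensor_exact S (LinearMap.exact_map_mkQ_range δ) (Submodule.mkQ_surjective _)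
  have hmkS : Function.Surjective ((LinearMap.range δ).mkQ.baseChange S) := by
    rw [LinearMap.baseChange_eq_ltensor]
    exact LinearMap.lTensor_surjective S (Submodule.mkQ_surjective _)
  let e₂ : ((S ⊗[R] (A₀ × F)) ⧸ LinearMap.range δS) ≃ₗ[S] S ⊗[R] N' :=
    hexact.linearEquivOfSurjective hmkS
  let e₁ : ((S ⊗[R] (A₀ × F)) ⧸ LinearMap.ker Θ) ≃ₗ[S] B := Θ.quotKerEquivOfSurjective hΘsurj
  exact ⟨N', inferInstance, inferInstance, inferInstance,
    ⟨e₁.symm ≪≫ₗ Submodule.quotEquivOfEq _ _ hΘker ≪≫ₗ e₂⟩⟩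

end Literature.RingTheory.CohomologyAnnihilator.BHST2015.CompletionAscentLifting

end

end Part5

/-!
## Part 6 — port of `Summits/ResolutionOfSingularities/ResolutionOfSingularities/Theorems/HomologicalConductorPersistenceCompletionAscentPunctured.lean`

# Modules stably annihilated by a power of every element of the maximal ideal

`[OURS · L w44b · completion model, ascent half · res-type-015 gen 15]` — third brick towards the
discharge of the named fact `Literature.RingTheory.CohomologyAnnihilator.le_caCompletion_comap`
([BahlekehHakimianSalarianTakahashi2015, Thm. 4.5 (2)]), helper for the surface rung
`PersistenceSurface` (stmt-ResolutionOfSingularities-19970) of crux chain w44b.  NOT a statement of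
the manuscript under adjudication in cell res-hironaka; pure commutative algebra over Mathlib and the
tree's `StablyAnnihilates` (crux-chain W4.4 CA-layer, `…NoZenoStableAnnihilatorReduction`).

For a noetherian local ring `(S, 𝔫)` we work with finitely generated modules `M` that are
**punctured-free** in the operative sense
`∀ y ∈ 𝔫, ∃ e, StablyAnnihilates S (y ^ e) M` («`y^e • 𝟙 M` factors through a finitely generated
projective») — for `M` finitely generated this is the classical «locally free on the punctured
spectrum» (`Ext¹(M, ΩM)` of finite length), the class `mod₀ S` of [BHST15, §4]; no name is
introduced, the hypothesis is spelled out.  Bookkeeping for the induction of the sibling file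
`…CompletionAscentRetract`:

* `stablyAnnihilates_quotient` — stable annihilation passes to `M/JM` over `S/J`;
* `exists_pow_le_annihilator_of_associatedPrimes_subset` — a finitely generated module whose
  associated primes are all `= 𝔫` is killed by a power of `𝔫`;
* `exists_pow_forall_mul_eq_zero` — if `w` lies in no associated prime of `S` other than `𝔫`, then
  `(0 :_S w)` is killed by a power of `𝔫`;
* `exists_pow_forall_smul_eq_zero_of_torsion` — hence, for `M` punctured-free, `(0 :_M w)` is killed
  by a power of `𝔫` (embed a projective into a finite free module);
* `exists_mem_maximalIdeal_forall_notMem_associatedPrimes` — prime avoidance: for a local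
  homomorphism `R → S` of local rings with `𝔪S = 𝔫` there is `x ∈ 𝔪` whose image lies in no
  associated prime of `S` other than `𝔫`;
* `ringKrullDim_quotient_span_lt` — for such `w` (in no minimal prime), `dim S/(w) < dim S` when
  `dim S ≥ 1`; `exists_maximalIdeal_pow_eq_bot_of_ringKrullDim_eq_zero` — `dim S = 0 ⇒ 𝔫` nilpotent.

References: A. Bahlekeh, E. Hakimian, S. Salarian, R. Takahashi, arXiv:1504.06163, §4
[`BahlekehHakimianSalarianTakahashi2015`]; S. B. Iyengar, R. Takahashi, arXiv:1404.1476, Remark 2.12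
[`IyengarTakahashi2014`].
-/

section Part6

noncomputable section

open _root_.CategoryTheory _root_.IsLocalRing Literature.RingTheory.CohomologyAnnihilator
open Literature.RingTheory.CohomologyAnnihilator
open scoped _root_.Pointwise _root_.TensorProduct

universe u

namespace Literature.RingTheory.CohomologyAnnihilator.BHST2015.CompletionAscentPunctured

variable {S : Type u} [CommRing S]

/-! ## Stable annihilation modulo an ideal -/

/-- An `S`-linear map induces an `S/J`-linear map `M/JM → P/JP`. [cite: BahlekehHakimianSalarianTakahashi2015, Theorem 4.5 (2) (proof: completion ascent, Corollary 4.4)] -/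
theorem exists_hom_quotient (J : Ideal S) {M P : Type u} [AddCommGroup M] [Module S M]
    [AddCommGroup P] [Module S P] (f : M →ₗ[S] P) :
    ∃ fq : ModuleCat.of (S ⧸ J) (M ⧸ (J • ⊤ : Submodule S M)) ⟶
        ModuleCat.of (S ⧸ J) (P ⧸ (J • ⊤ : Submodule S P)),
      ∀ m : M, fq (Submodule.Quotient.mk m) = Submodule.Quotient.mk (f m) := by
  have h : (J • ⊤ : Submodule S M) ≤ (J • ⊤ : Submodule S P).comap f := by
    rw [← Submodule.map_le_iff_le_comap, Submodule.map_smul'']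
    exact Submodule.smul_mono le_rfl le_top
  exact ⟨ModuleCat.ofHom (LinearMap.extendScalarsOfSurjective Ideal.Quotient.mk_surjective
    ((J • ⊤ : Submodule S M).mapQ (J • ⊤ : Submodule S P) f h)), fun m => rfl⟩

/-- For `P` finitely generated projective over `S`, `P/JP` is finitely generated projective over
`S/J` (`(S/J) ⊗_S P ≅ P/JP`). [cite: BahlekehHakimianSalarianTakahashi2015, Theorem 4.5 (2) (proof: completion ascent, Corollary 4.4)] -/
theorem projective_quotient (J : Ideal S) (P : ModuleCat.{u} S) [Module.Finite S P]
    (hP : Projective P) :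
    Projective (ModuleCat.of (S ⧸ J) (P ⧸ (J • ⊤ : Submodule S P))) := by
  haveI := moduleProjective_of_projective P hP
  haveI : Module.Projective (S ⧸ J) ((S ⧸ J) ⊗[S] P) := inferInstance
  let e : ((S ⧸ J) ⊗[S] P) ≃ₗ[S ⧸ J] (P ⧸ (J • ⊤ : Submodule S P)) :=
    (TensorProduct.quotTensorEquivQuotSMul P J).extendScalarsOfSurjective
      Ideal.Quotient.mk_surjective
  haveI := Module.Projective.of_equiv e
  exact (IsProjective.iff_projective (R := S ⧸ J) (P ⧸ (J • ⊤ : Submodule S P))).mp inferInstance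

/-- **Stable annihilation passes to the quotient modulo an ideal**: if `c • 𝟙 M` factors through a
finitely generated projective `S`-module, then `c̄ • 𝟙 (M/JM)` factors through a finitely generated
projective `S/J`-module (reduce the factorisation). [cite: BahlekehHakimianSalarianTakahashi2015, Theorem 4.5 (2) (proof: completion ascent, Corollary 4.4)] -/
theorem stablyAnnihilates_quotient (J : Ideal S) {c : S} {M : ModuleCat.{u} S}
    (h : StablyAnnihilates S c M) :
    StablyAnnihilates (S ⧸ J) (Ideal.Quotient.mk J c)
      (ModuleCat.of (S ⧸ J) (M ⧸ (J • ⊤ : Submodule S M))) := by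
  obtain ⟨P, hPfin, hPproj, ι, π, hιπ⟩ := h
  haveI := hPfin
  obtain ⟨ιq, hιq⟩ := exists_hom_quotient J ι.hom
  obtain ⟨πq, hπq⟩ := exists_hom_quotient J π.hom
  refine ⟨ModuleCat.of (S ⧸ J) (P ⧸ (J • ⊤ : Submodule S P)),
    Module.Finite.of_restrictScalars_finite S _ _, projective_quotient J P hPproj, ιq, πq, ?_⟩
  apply ModuleCat.hom_ext
  refine LinearMap.ext fun z => ?_
  induction z using Submodule.Quotient.induction_on with
  | _ m =>
    have hm : π.hom (ι.hom m) = c • m := apply_apply_eq_smul_of_comp_eq_smul_id hιπ m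
    change πq (ιq (Submodule.Quotient.mk m)) =
      (Ideal.Quotient.mk J c) • (Submodule.Quotient.mk m : M ⧸ (J • ⊤ : Submodule S M))
    rw [hιq, hπq, hm]
    rfl

/-- Punctured-freeness passes to `M/JM` over `S/J` (`S` local, `J ≠ ⊤`): every `ȳ ∈ 𝔫̄` lifts to
`y ∈ 𝔫`. [cite: BahlekehHakimianSalarianTakahashi2015, Theorem 4.5 (2) (proof: completion ascent, Corollary 4.4)] -/
theorem puncturedFree_quotient [IsLocalRing S] (J : Ideal S) [IsLocalRing (S ⧸ J)]
    {M : ModuleCat.{u} S} (hM : ∀ y ∈ maximalIdeal S, ∃ e : ℕ, StablyAnnihilates S (y ^ e) M) :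
    ∀ y ∈ maximalIdeal (S ⧸ J), ∃ e : ℕ,
      StablyAnnihilates (S ⧸ J) (y ^ e) (ModuleCat.of (S ⧸ J) (M ⧸ (J • ⊤ : Submodule S M))) := by
  intro y hy
  obtain ⟨y, rfl⟩ := Ideal.Quotient.mk_surjective y
  have hy' : y ∈ maximalIdeal S := by
    rw [IsLocalRing.mem_maximalIdeal, mem_nonunits_iff] at hy ⊢
    exact fun hu => hy (hu.map _)
  obtain ⟨e, he⟩ := hM y hy'
  exact ⟨e, by rw [← map_pow]; exact stablyAnnihilates_quotient J he⟩

/-! ## Modules with associated primes inside `{𝔫}` -/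

/-- A finitely generated module over a noetherian local ring all of whose associated primes are the
maximal ideal is killed by a power of the maximal ideal (the minimal primes of its annihilator are
associated). [cite: BahlekehHakimianSalarianTakahashi2015, Theorem 4.5 (2) (proof: completion ascent, Corollary 4.4)] -/
theorem exists_pow_le_annihilator_of_associatedPrimes_subset [IsNoetherianRing S] [IsLocalRing S]
    {T : Type u} [AddCommGroup T] [Module S T] [Module.Finite S T]
    (h : associatedPrimes S T ⊆ {maximalIdeal S}) :
    ∃ k : ℕ, maximalIdeal S ^ k ≤ Module.annihilator S T := by
  by_cases hT : Module.annihilator S T = ⊤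
  · exact ⟨0, by rw [hT]; exact le_top⟩
  refine Ideal.exists_pow_le_of_le_radical_of_fg ?_ (maximalIdeal S).fg_of_isNoetherianRing
  rw [Ideal.radical_eq_sInf]
  refine le_sInf ?_
  rintro p ⟨hp, hpprime⟩
  obtain ⟨q, hq, hqp⟩ := Ideal.exists_minimalPrimes_le hp
  have hq' := Module.associatedPrimes.minimalPrimes_annihilator_subset_associatedPrimes S T hq
  rw [h hq'] at hqp
  exact hqp

/-- If `w` lies in no associated prime of `S` other than `𝔫` (`S` noetherian local), then the
annihilator `(0 :_S w)` is killed by a power of `𝔫`: its associated primes are associated primes of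
`S` containing `w`. [cite: BahlekehHakimianSalarianTakahashi2015, Theorem 4.5 (2) (proof: completion ascent, Corollary 4.4)] -/
theorem exists_pow_forall_mul_eq_zero [IsNoetherianRing S] [IsLocalRing S] {w : S}
    (hw : ∀ P ∈ associatedPrimes S S, P ≠ maximalIdeal S → w ∉ P) :
    ∃ k : ℕ, ∀ z ∈ maximalIdeal S ^ k, ∀ s : S, w * s = 0 → z * s = 0 := by
  let T := Submodule.torsionBy S S w
  have hT : associatedPrimes S T ⊆ {maximalIdeal S} := by
    intro P hP
    have hPS : P ∈ associatedPrimes S S := associatedPrimes.subset_of_injective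
      (f := T.subtype) Subtype.val_injective hP
    obtain ⟨hPprime, x, hx⟩ := hP
    have hwP : w ∈ P := by
      rw [hx]
      refine Ideal.le_radical ?_
      rw [Submodule.mem_colon_singleton, Submodule.mem_bot]
      exact Subtype.ext ((Submodule.mem_torsionBy_iff w (x : S)).mp x.2)
    by_contra hne
    exact hw P hPS hne hwP
  obtain ⟨k, hk⟩ := exists_pow_le_annihilator_of_associatedPrimes_subset hT
  refine ⟨k, fun z hz s hs => ?_⟩
  have hs' : s ∈ T := (Submodule.mem_torsionBy_iff w s).mpr (by rw [smul_eq_mul, hs])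
  have := Module.mem_annihilator.mp (hk hz) ⟨s, hs'⟩
  exact congrArg Subtype.val this

/-- **`(0 :_M w)` is killed by a power of `𝔫`** for `M` punctured-free over a noetherian local
`(S, 𝔫)` and `w` in no associated prime of `S` other than `𝔫`: if `yᵉ • 𝟙 M = π ∘ ι` through a
projective `P ⊆ Sⁿ`, then for `w m = 0` the coordinates of `ι m` lie in `(0 :_S w)`, which is
killed by `𝔫ᵏ`; so `y^{k+e} m = yᵏ π(ι m) = π(yᵏ ι m) = 0`, whence `𝔫 ⊆ √ann (0 :_M w)`.
[cite: BahlekehHakimianSalarianTakahashi2015, Theorem 4.5 (2) (proof: completion ascent, Corollary 4.4)] -/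
theorem exists_pow_forall_smul_eq_zero_of_torsion [IsNoetherianRing S] [IsLocalRing S] {w : S}
    (hw : ∀ P ∈ associatedPrimes S S, P ≠ maximalIdeal S → w ∉ P) {M : ModuleCat.{u} S}
    (hM : ∀ y ∈ maximalIdeal S, ∃ e : ℕ, StablyAnnihilates S (y ^ e) M) :
    ∃ k : ℕ, ∀ z ∈ maximalIdeal S ^ k, ∀ m : M, w • m = 0 → z • m = 0 := by
  obtain ⟨k₁, hk₁⟩ := exists_pow_forall_mul_eq_zero hw
  let A := Submodule.torsionBy S M w
  suffices hrad : maximalIdeal S ≤ (Module.annihilator S A).radical by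
    obtain ⟨k, hk⟩ := Ideal.exists_pow_le_of_le_radical_of_fg hrad
      (maximalIdeal S).fg_of_isNoetherianRing
    refine ⟨k, fun z hz m hm => ?_⟩
    have hm' : m ∈ A := (Submodule.mem_torsionBy_iff w m).mpr hm
    exact congrArg Subtype.val (Module.mem_annihilator.mp (hk hz) ⟨m, hm'⟩)
  intro y hy
  obtain ⟨e, P, hPfin, hPproj, ι, π, hιπ⟩ := hM y hy
  haveI := hPfin
  haveI := moduleProjective_of_projective P hPproj
  -- embed `P` into a finite free module
  obtain ⟨n, q, hq⟩ := Module.Finite.exists_fin' S P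
  obtain ⟨j, hj⟩ := Module.projective_lifting_property q LinearMap.id hq
  have hjinj : Function.Injective j := fun p₁ p₂ hp => by
    have := congrArg q hp
    rwa [← LinearMap.comp_apply, ← LinearMap.comp_apply, hj] at this
  refine ⟨k₁ + e, Module.mem_annihilator.mpr fun a => Subtype.ext ?_⟩
  have ha : w • (a : M) = 0 := (Submodule.mem_torsionBy_iff w (a : M)).mp a.2
  -- the coordinates of `ι a` are killed by `w`, hence by `y ^ k₁`
  have hcoord : (y ^ k₁) • ι.hom (a : M) = 0 := by
    apply hjinj
    rw [map_smul, map_zero]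
    funext i
    rw [Pi.smul_apply, smul_eq_mul, Pi.zero_apply]
    refine hk₁ _ (Ideal.pow_mem_pow hy k₁) _ ?_
    have h0 : j (ι.hom (w • (a : M))) = 0 := by rw [ha, map_zero, map_zero]
    rw [map_smul, map_smul] at h0
    simpa using congrFun h0 i
  change (y ^ (k₁ + e)) • (a : M) = ((0 : A) : M)
  rw [pow_add, mul_smul, ← apply_apply_eq_smul_of_comp_eq_smul_id hιπ (a : M), ← map_smul, hcoord,
    map_zero]
  rfl

/-! ## Choosing the element: prime avoidance from the base -/

/-- **Prime avoidance from the base.**  Let `R → S` be a homomorphism of local rings with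
`𝔪S = 𝔫`, `S` noetherian.  Then some `x ∈ 𝔪` maps into no associated prime of `S` other than `𝔫`
(the finitely many primes `𝔓 ∩ R`, `𝔓 ∈ Ass S ∖ {𝔫}`, are proper subideals… more precisely none
contains `𝔪`, since `𝔪 ⊆ 𝔓 ∩ R` forces `𝔫 = 𝔪S ⊆ 𝔓`). [cite: BahlekehHakimianSalarianTakahashi2015, Theorem 4.5 (2) (proof: completion ascent, Corollary 4.4)] -/
theorem exists_mem_maximalIdeal_forall_notMem_associatedPrimes {R : Type u} [CommRing R]
    [IsLocalRing R] [Algebra R S] [IsNoetherianRing S] [IsLocalRing S]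
    (hmap : (maximalIdeal R).map (algebraMap R S) = maximalIdeal S) :
    ∃ x ∈ maximalIdeal R, ∀ P ∈ associatedPrimes S S, P ≠ maximalIdeal S → algebraMap R S x ∉ P := by
  classical
  let F : Finset (Ideal S) := (associatedPrimes.finite S S).toFinset.filter (· ≠ maximalIdeal S)
  have hF : ∀ P, P ∈ F ↔ P ∈ associatedPrimes S S ∧ P ≠ maximalIdeal S := fun P => by
    simp only [F, Finset.mem_filter, Set.Finite.mem_toFinset]
  by_contra hcon
  push Not at hcon
  have hsub : ((maximalIdeal R : Set R)) ⊆ ⋃ P ∈ (↑F : Set (Ideal S)),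
      ((P.comap (algebraMap R S) : Ideal R) : Set R) := by
    intro x hx
    obtain ⟨P, hP, hne, hxP⟩ := hcon x hx
    simp only [Set.mem_iUnion, Finset.mem_coe]
    exact ⟨P, (hF P).mpr ⟨hP, hne⟩, hxP⟩
  have hprime : ∀ P ∈ F, P ≠ maximalIdeal S → P ≠ maximalIdeal S →
      (P.comap (algebraMap R S)).IsPrime := fun P hP _ _ => by
    haveI : P.IsPrime := IsAssociatedPrime.isPrime ((hF P).mp hP).1
    exact Ideal.comap_isPrime _ _
  obtain ⟨P, hP, hle⟩ := (Ideal.subset_union_prime (maximalIdeal S) (maximalIdeal S) hprime).mp hsub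
  obtain ⟨hPass, hPne⟩ := (hF P).mp hP
  haveI : P.IsPrime := IsAssociatedPrime.isPrime hPass
  have hle' : maximalIdeal S ≤ P := by
    rw [← hmap, Ideal.map_le_iff_le_comap]
    exact hle
  exact hPne ((IsLocalRing.maximalIdeal.isMaximal S).eq_of_le Ideal.IsPrime.ne_top' hle').symm

/-! ## Dimension -/

/-- The annihilator of a commutative ring as a module over itself is zero. [cite: BahlekehHakimianSalarianTakahashi2015, Theorem 4.5 (2) (proof: completion ascent, Corollary 4.4)] -/
theorem annihilator_self_eq_bot : Module.annihilator S S = ⊥ := by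
  rw [eq_bot_iff]
  intro r hr
  have := Module.mem_annihilator.mp hr 1
  rw [smul_eq_mul, mul_one] at this
  exact this

/-- **Cutting down the dimension**: if `dim S = d ≥ 1` (`S` noetherian local) and `w` lies in no
associated prime of `S` other than `𝔫`, then `w` lies in no minimal prime, so
`dim S/(w) + 1 ≤ dim S` (Mathlib's `Module.supportDim_quotSMulTop_succ_le_of_notMem_minimalPrimes`);
stated as the existence of `d' < d` with `dim S/J = d'` for any ideal `J = (w)`. [cite: BahlekehHakimianSalarianTakahashi2015, Theorem 4.5 (2) (proof: completion ascent, Corollary 4.4)] -/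
theorem exists_ringKrullDim_quotient_lt [IsNoetherianRing S] [IsLocalRing S] {w : S}
    (hwm : w ∈ maximalIdeal S)
    (hw : ∀ P ∈ associatedPrimes S S, P ≠ maximalIdeal S → w ∉ P) {d : ℕ} (hd : 1 ≤ d)
    (hdim : ringKrullDim S = d) {J : Ideal S} (hJ : J = Ideal.span {w}) :
    ∃ d' : ℕ, d' < d ∧ ringKrullDim (S ⧸ J) = d' := by
  -- `w` avoids the minimal primes
  have hmin : ∀ p ∈ (Module.annihilator S S).minimalPrimes, w ∉ p := by
    intro p hp
    have hpass := Module.associatedPrimes.minimalPrimes_annihilator_subset_associatedPrimes S S hp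
    refine hw p hpass fun hpm => ?_
    rw [annihilator_self_eq_bot] at hp
    have h0 : (maximalIdeal S).height = 0 := Ideal.height_eq_zero_iff.mpr (hpm ▸ hp)
    have := IsLocalRing.maximalIdeal_height_eq_ringKrullDim (R := S)
    rw [h0, hdim] at this
    norm_cast at this
    omega
  have hle := Module.supportDim_quotSMulTop_succ_le_of_notMem_minimalPrimes (M := S) hmin
  rw [Module.supportDim_self_eq_ringKrullDim, hdim] at hle
  -- `QuotSMulTop w S = S ⧸ w • ⊤` and `w • ⊤ = span {w} = J`
  have hJ' : J = w • (⊤ : Submodule S S) := by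
    rw [hJ, ← Submodule.ideal_span_singleton_smul, smul_eq_mul, Ideal.mul_top]
  have hq : Module.supportDim S (QuotSMulTop w S) = ringKrullDim (S ⧸ J) := by
    rw [hJ']
    exact Module.supportDim_quotient_eq_ringKrullDim _
  rw [hq] at hle
  -- extract a natural number
  haveI : Nontrivial (S ⧸ J) := by
    rw [Ideal.Quotient.nontrivial_iff, hJ, Ne, Ideal.span_singleton_eq_top]
    exact (IsLocalRing.mem_maximalIdeal w).mp hwm
  haveI := IsLocalRing.of_surjective' (Ideal.Quotient.mk J) Ideal.Quotient.mk_surjective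
  have hfin : ((maximalIdeal (S ⧸ J)).height : WithBot ℕ∞) = ringKrullDim (S ⧸ J) :=
    IsLocalRing.maximalIdeal_height_eq_ringKrullDim
  have hne : (maximalIdeal (S ⧸ J)).height ≠ ⊤ := Ideal.height_ne_top (Ideal.IsPrime.ne_top')
  obtain ⟨d', hd'⟩ := ENat.ne_top_iff_exists.mp hne
  refine ⟨d', ?_, by rw [← hfin, ← hd']; rfl⟩
  rw [← hfin, ← hd'] at hle
  have : ((d' : ℕ∞) : WithBot ℕ∞) + 1 ≤ (d : WithBot ℕ∞) := hle
  norm_cast at this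

/-- A noetherian local ring of Krull dimension `0` has nilpotent maximal ideal (it is artinian).
[cite: BahlekehHakimianSalarianTakahashi2015, Theorem 4.5 (2) (proof: completion ascent, Corollary 4.4)] -/
theorem exists_maximalIdeal_pow_eq_bot_of_ringKrullDim_eq_zero [IsNoetherianRing S] [IsLocalRing S]
    (h0 : ringKrullDim S = 0) : ∃ k : ℕ, maximalIdeal S ^ k = ⊥ := by
  haveI : Ring.KrullDimLE 0 S := Ring.krullDimLE_iff.mpr (by rw [h0]; rfl)
  haveI : IsArtinianRing S := isArtinianRing_iff_isNoetherianRing_krullDimLE_zero.mpr ⟨‹_›, ‹_›⟩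
  obtain ⟨k, hk⟩ := (isArtinianRing_iff_isNilpotent_maximalIdeal S).mp ‹_›
  exact ⟨k, hk⟩

end Literature.RingTheory.CohomologyAnnihilator.BHST2015.CompletionAscentPunctured

end

end Part6

/-!
## Part 7 — port of `Summits/ResolutionOfSingularities/ResolutionOfSingularities/Theorems/HomologicalConductorPersistenceCompletionAscentQuotientPair.lean`

# Completion-like pairs: finite-length transfer, passage to a quotient pair, tensor translation

`[OURS · L w44b · completion model, ascent half · res-type-015 gen 15]` — fourth brick towards the
discharge of the named fact `Literature.RingTheory.CohomologyAnnihilator.le_caCompletion_comap`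
([BahlekehHakimianSalarianTakahashi2015, Thm. 4.5 (2)]), helper for the surface rung
`PersistenceSurface` (stmt-ResolutionOfSingularities-19970) of crux chain w44b.  NOT a statement of
the manuscript under adjudication in cell res-hironaka; pure commutative algebra over Mathlib.

A **completion-like pair** is an algebra `R → S` of local rings with `𝔪S = 𝔫` and `R` dense in `S`
(`∀ k s, ∃ r, s - r ∈ 𝔫ᵏ`); with `S` flat over `R` this is what the induction of the sibling file
`…CompletionAscentRetract` uses of `R → R̂` (no name is introduced; the two hypotheses are spelled
out).  This file proves:

* `mk_one_bijective_of_pow_smul_eq_zero` — **finite-length transfer**: for such a pair with `S`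
  faithfully flat and an `R`-module `A` killed by `𝔪ᵏ`, `a ↦ 1 ⊗ a : A → S ⊗_R A` is bijective;
  `finite_restrictScalars_of_pow_smul_eq_zero` — an `S`-finite module killed by `𝔫ᵏ` is `R`-finite;
* passage to the quotient pair `(R/I, S/IS)`: `map_mk_maximalIdeal`, `map_maximalIdeal_quotient`,
  `dense_quotient` (the two hypotheses are inherited; flatness is Mathlib's
  `Algebra.TensorProduct.quotIdealMapEquivQuotTensor`);
* `exists_retract_of_retract_quotientPair` — **tensor translation**: for an `R/I`-module `N`, a
  retract (over `S/IS`) of `(S/IS) ⊗_{R/I} N` is, after restriction of scalars to `S`, a retract of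
  `S ⊗_R N` (the two tensor products agree; we only construct the two comparison maps as additive
  homomorphisms with the evident semilinearity, which is all a retract needs).

References: A. Bahlekeh, E. Hakimian, S. Salarian, R. Takahashi, arXiv:1504.06163, §4
[`BahlekehHakimianSalarianTakahashi2015`]; H. Matsumura, *Commutative Ring Theory*, §8
[`Matsumura1987`].
-/

section Part7

noncomputable section

open _root_.IsLocalRing
open scoped _root_.TensorProduct

universe u

namespace Literature.RingTheory.CohomologyAnnihilator.BHST2015.CompletionAscentQuotientPair

variable {R S : Type u} [CommRing R] [CommRing S] [Algebra R S]

/-! ## Finite-length transfer -/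

/-- For `n` in the extension of an ideal `I` of `R` and `a` killed by `I`, `n ⊗ a = 0` in
`S ⊗_R A`. [cite: BahlekehHakimianSalarianTakahashi2015, Theorem 4.5 (2) (proof: completion ascent, Corollary 4.4)] -/
theorem tmul_eq_zero_of_mem_map {I : Ideal R} {A : Type u} [AddCommGroup A] [Module R A]
    (hA : ∀ x ∈ I, ∀ a : A, x • a = 0) {n : S} (hn : n ∈ I.map (algebraMap R S)) (a : A) :
    n ⊗ₜ[R] a = 0 := by
  induction hn using Submodule.span_induction with
  | mem x hx =>
    obtain ⟨y, hy, rfl⟩ := hx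
    rw [Algebra.algebraMap_eq_smul_one, TensorProduct.smul_tmul, hA y hy a, TensorProduct.tmul_zero]
  | zero => exact TensorProduct.zero_tmul _ _
  | add x y _ _ hx hy => rw [TensorProduct.add_tmul, hx, hy, add_zero]
  | smul s x _ hx => rw [← TensorProduct.smul_tmul', hx, smul_zero]

/-- **Finite-length transfer.**  Let `R → S` be faithfully flat with `𝔪S = 𝔫` and `R` dense in `S`
(`s ≡ r mod 𝔫ᵏ`).  If the `R`-module `A` is killed by `𝔪ᵏ`, then `a ↦ 1 ⊗ a : A → S ⊗_R A` is
bijective (`A ≅ Â` for modules of finite length).  Injectivity is faithful flatness; for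
surjectivity, `s ⊗ a = (r + n) ⊗ a = 1 ⊗ r a` with `n ∈ 𝔫ᵏ = 𝔪ᵏS`.
[cite: Matsumura1987, Theorem 8.7 / §8 (3) (mechanism)] -/
theorem mk_one_bijective_of_pow_smul_eq_zero [IsLocalRing R] [IsLocalRing S]
    [Module.FaithfullyFlat R S]
    (hmap : (maximalIdeal R).map (algebraMap R S) = maximalIdeal S)
    (hdense : ∀ (k : ℕ) (s : S), ∃ r : R, s - algebraMap R S r ∈ maximalIdeal S ^ k)
    {A : Type u} [AddCommGroup A] [Module R A] {k : ℕ}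
    (hA : ∀ x ∈ maximalIdeal R ^ k, ∀ a : A, x • a = 0) :
    Function.Bijective (TensorProduct.mk R S A 1) := by
  constructor
  · rw [← LinearMap.ker_eq_bot, LinearMap.ker_eq_bot']
    intro a ha
    exact (Module.FaithfullyFlat.one_tmul_eq_zero_iff (R := R) (M := A) (A := S) a).mp ha
  · intro u
    induction u using TensorProduct.induction_on with
    | zero => exact ⟨0, map_zero _⟩
    | tmul s a =>
      obtain ⟨r, hr⟩ := hdense k s
      have hn : (s - algebraMap R S r) ∈ (maximalIdeal R ^ k).map (algebraMap R S) := by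
        rw [Ideal.map_pow, hmap]
        exact hr
      refine ⟨r • a, ?_⟩
      have hs : s = algebraMap R S r + (s - algebraMap R S r) := by ring
      rw [TensorProduct.mk_apply, hs, TensorProduct.add_tmul, tmul_eq_zero_of_mem_map hA hn a,
        add_zero, Algebra.algebraMap_eq_smul_one, TensorProduct.smul_tmul]
    | add x y hx hy =>
      obtain ⟨a, rfl⟩ := hx
      obtain ⟨b, rfl⟩ := hy
      exact ⟨a + b, map_add _ _ _⟩

/-- An `S`-finite module killed by `𝔫ᵏ` is `R`-finite when `R` is dense in `S` (the same
generators work: `s • t = r • t` for `s ≡ r mod 𝔫ᵏ`). [cite: BahlekehHakimianSalarianTakahashi2015, Theorem 4.5 (2) (proof: completion ascent, Corollary 4.4)] -/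
theorem finite_restrictScalars_of_pow_smul_eq_zero [IsLocalRing S]
    (hdense : ∀ (k : ℕ) (s : S), ∃ r : R, s - algebraMap R S r ∈ maximalIdeal S ^ k)
    {T : Type u} [AddCommGroup T] [Module S T] [Module R T] [IsScalarTower R S T]
    [Module.Finite S T] {k : ℕ} (hT : ∀ x ∈ maximalIdeal S ^ k, ∀ t : T, x • t = 0) :
    Module.Finite R T := by
  obtain ⟨G, hG⟩ := Module.Finite.fg_top (R := S) (M := T)
  refine ⟨⟨G, ?_⟩⟩
  rw [eq_top_iff]
  rintro t -
  have ht : t ∈ Submodule.span S (G : Set T) := by rw [hG]; exact Submodule.mem_top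
  induction ht using Submodule.span_induction with
  | mem x hx => exact Submodule.subset_span hx
  | zero => exact Submodule.zero_mem _
  | add x y _ _ hx hy => exact Submodule.add_mem _ hx hy
  | smul s x _ hx =>
    obtain ⟨r, hr⟩ := hdense k s
    have hs : s • x = r • x := by
      have h0 := hT _ hr x
      rw [sub_smul, sub_eq_zero, algebraMap_smul] at h0
      exact h0
    rw [hs]
    exact Submodule.smul_mem _ r hx

/-! ## Passage to a quotient pair -/

/-- In a local ring, the image of the maximal ideal in a non-trivial quotient is the maximal ideal.
[cite: BahlekehHakimianSalarianTakahashi2015, Theorem 4.5 (2) (proof: completion ascent, Corollary 4.4)] -/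
theorem map_mk_maximalIdeal [IsLocalRing R] (I : Ideal R) [IsLocalRing (R ⧸ I)] :
    (maximalIdeal R).map (Ideal.Quotient.mk I) = maximalIdeal (R ⧸ I) := by
  rcases Ideal.map_eq_top_or_isMaximal_of_surjective (Ideal.Quotient.mk I)
    Ideal.Quotient.mk_surjective (IsLocalRing.maximalIdeal.isMaximal R) with h | h
  · exfalso
    have hI : I ≤ maximalIdeal R :=
      IsLocalRing.le_maximalIdeal ((Ideal.Quotient.nontrivial_iff).mp inferInstance)
    have := Ideal.comap_map_of_surjective (Ideal.Quotient.mk I) Ideal.Quotient.mk_surjective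
      (maximalIdeal R)
    rw [h, Ideal.comap_top, ← RingHom.ker_eq_comap_bot, Ideal.mk_ker, sup_eq_left.mpr hI] at this
    exact (IsLocalRing.maximalIdeal.isMaximal R).ne_top this.symm
  · exact IsLocalRing.eq_maximalIdeal h

/-- A non-trivial quotient of a local ring is local. [cite: BahlekehHakimianSalarianTakahashi2015, Theorem 4.5 (2) (proof: completion ascent, Corollary 4.4)] -/
theorem isLocalRing_quotient [IsLocalRing R] (I : Ideal R) [Nontrivial (R ⧸ I)] :
    IsLocalRing (R ⧸ I) :=
  IsLocalRing.of_surjective' (Ideal.Quotient.mk I) Ideal.Quotient.mk_surjective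

/-- `𝔪S = 𝔫` is inherited by the quotient pair `(R/I, S/IS)`. [cite: BahlekehHakimianSalarianTakahashi2015, Theorem 4.5 (2) (proof: completion ascent, Corollary 4.4)] -/
theorem map_maximalIdeal_quotient [IsLocalRing R] [IsLocalRing S] (I : Ideal R)
    [IsLocalRing (R ⧸ I)] [IsLocalRing (S ⧸ I.map (algebraMap R S))]
    (hmap : (maximalIdeal R).map (algebraMap R S) = maximalIdeal S) :
    (maximalIdeal (R ⧸ I)).map (algebraMap (R ⧸ I) (S ⧸ I.map (algebraMap R S))) =
      maximalIdeal (S ⧸ I.map (algebraMap R S)) := by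
  rw [← map_mk_maximalIdeal I, Ideal.map_map, ← map_mk_maximalIdeal (I.map (algebraMap R S)),
    ← hmap, Ideal.map_map]
  congr 1

/-- Density `s ≡ r mod 𝔫ᵏ` is inherited by the quotient pair `(R/I, S/IS)`. [cite: BahlekehHakimianSalarianTakahashi2015, Theorem 4.5 (2) (proof: completion ascent, Corollary 4.4)] -/
theorem dense_quotient [IsLocalRing S] (I : Ideal R) [IsLocalRing (S ⧸ I.map (algebraMap R S))]
    (hdense : ∀ (k : ℕ) (s : S), ∃ r : R, s - algebraMap R S r ∈ maximalIdeal S ^ k) :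
    ∀ (k : ℕ) (s : S ⧸ I.map (algebraMap R S)), ∃ r : R ⧸ I,
      s - algebraMap (R ⧸ I) (S ⧸ I.map (algebraMap R S)) r ∈
        maximalIdeal (S ⧸ I.map (algebraMap R S)) ^ k := by
  intro k s
  obtain ⟨s, rfl⟩ := Ideal.Quotient.mk_surjective s
  obtain ⟨r, hr⟩ := hdense k s
  refine ⟨Ideal.Quotient.mk I r, ?_⟩
  rw [← map_mk_maximalIdeal (I.map (algebraMap R S)), ← Ideal.map_pow]
  have h : algebraMap (R ⧸ I) (S ⧸ I.map (algebraMap R S)) (Ideal.Quotient.mk I r) =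
      Ideal.Quotient.mk (I.map (algebraMap R S)) (algebraMap R S r) := rfl
  rw [h, ← map_sub]
  exact Ideal.mem_map_of_mem _ hr

/-! ## Tensor translation along a quotient pair -/

section Translation

variable (I : Ideal R) {N : Type u} [AddCommGroup N] [Module (R ⧸ I) N] [Module R N]
  [IsScalarTower R (R ⧸ I) N]

/-- The comparison map `S ⊗_R N → (S/IS) ⊗_{R/I} N`, `s ⊗ n ↦ s̄ ⊗ n` (additive). [cite: BahlekehHakimianSalarianTakahashi2015, Theorem 4.5 (2) (proof: completion ascent, Corollary 4.4)] -/
theorem exists_toQuotientPair :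
    ∃ Φ : S ⊗[R] N →+ (S ⧸ Ideal.map (algebraMap R S) I) ⊗[R ⧸ I] N,
      ∀ (s : S) (n : N), Φ (s ⊗ₜ[R] n) = (Ideal.Quotient.mk _ s) ⊗ₜ[R ⧸ I] n := by
  let F : S →+ (N →+ (S ⧸ Ideal.map (algebraMap R S) I) ⊗[R ⧸ I] N) :=
    { toFun := fun s =>
        (TensorProduct.mk (R ⧸ I) (S ⧸ Ideal.map (algebraMap R S) I) N
          (Ideal.Quotient.mk _ s)).toAddMonoidHom
      map_zero' := by
        ext n
        change (Ideal.Quotient.mk _ (0 : S)) ⊗ₜ[R ⧸ I] n = 0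
        rw [map_zero, TensorProduct.zero_tmul]
      map_add' := fun s t => by
        ext n
        change (Ideal.Quotient.mk _ (s + t)) ⊗ₜ[R ⧸ I] n =
          (Ideal.Quotient.mk _ s) ⊗ₜ[R ⧸ I] n + (Ideal.Quotient.mk _ t) ⊗ₜ[R ⧸ I] n
        rw [map_add, TensorProduct.add_tmul] }
  have hF : ∀ (s : S) (n : N), F s n = (Ideal.Quotient.mk _ s) ⊗ₜ[R ⧸ I] n := fun s n => rfl
  refine ⟨TensorProduct.liftAddHom F (fun r s n => ?_), fun s n => ?_⟩
  · rw [hF, hF]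
    have h1 : Ideal.Quotient.mk (Ideal.map (algebraMap R S) I) (r • s) =
        (Ideal.Quotient.mk I r) • Ideal.Quotient.mk (Ideal.map (algebraMap R S) I) s := by
      rw [Algebra.smul_def, map_mul, Algebra.smul_def]
      rfl
    have h2 : (Ideal.Quotient.mk I r) • n = r • n := by
      rw [← Ideal.Quotient.algebraMap_eq I]
      exact IsScalarTower.algebraMap_smul (R ⧸ I) r n
    rw [h1, TensorProduct.smul_tmul, h2]
  · rw [TensorProduct.liftAddHom_tmul, hF]

/-- The comparison map `(S/IS) ⊗_{R/I} N → S ⊗_R N`, `s̄ ⊗ n ↦ s ⊗ n` (additive; well defined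
because `IS` kills `S ⊗_R N`). [cite: BahlekehHakimianSalarianTakahashi2015, Theorem 4.5 (2) (proof: completion ascent, Corollary 4.4)] -/
theorem exists_ofQuotientPair :
    ∃ Ψ : (S ⧸ Ideal.map (algebraMap R S) I) ⊗[R ⧸ I] N →+ S ⊗[R] N,
      ∀ (s : S) (n : N), Ψ ((Ideal.Quotient.mk _ s) ⊗ₜ[R ⧸ I] n) = s ⊗ₜ[R] n := by
  -- for each `n`, `s̄ ↦ s ⊗ n : S/IS → S ⊗ N` (well defined because `IS` kills `S ⊗_R N`)
  have hJ : ∀ n : N, Ideal.map (algebraMap R S) I ≤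
      LinearMap.ker (LinearMap.toSpanSingleton S (S ⊗[R] N) ((1 : S) ⊗ₜ[R] n)) := by
    intro n
    rw [Ideal.map_le_iff_le_comap]
    intro a ha
    rw [Ideal.mem_comap, LinearMap.mem_ker, LinearMap.toSpanSingleton_apply,
      TensorProduct.smul_tmul', smul_eq_mul, mul_one, Algebra.algebraMap_eq_smul_one,
      TensorProduct.smul_tmul, ← IsScalarTower.algebraMap_smul (R ⧸ I) a n,
      Ideal.Quotient.algebraMap_eq, Ideal.Quotient.eq_zero_iff_mem.mpr ha, zero_smul,
      TensorProduct.tmul_zero]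
  let g : N → ((S ⧸ Ideal.map (algebraMap R S) I) →ₗ[S] S ⊗[R] N) := fun n =>
    Submodule.liftQ (Ideal.map (algebraMap R S) I)
      (LinearMap.toSpanSingleton S (S ⊗[R] N) ((1 : S) ⊗ₜ[R] n)) (hJ n)
  have hg : ∀ (s : S) (n : N), g n (Ideal.Quotient.mk _ s) = s ⊗ₜ[R] n := fun s n => by
    change Submodule.liftQ (Ideal.map (algebraMap R S) I)
      (LinearMap.toSpanSingleton S (S ⊗[R] N) ((1 : S) ⊗ₜ[R] n)) (hJ n) (Ideal.Quotient.mk _ s) = _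
    rw [← Ideal.Quotient.mk_eq_mk, Submodule.liftQ_apply, LinearMap.toSpanSingleton_apply,
      TensorProduct.smul_tmul', smul_eq_mul, mul_one]
  let F : (S ⧸ Ideal.map (algebraMap R S) I) →+ (N →+ S ⊗[R] N) :=
    { toFun := fun s =>
        { toFun := fun n => g n s
          map_zero' := by
            obtain ⟨s, rfl⟩ := Ideal.Quotient.mk_surjective s
            rw [hg, TensorProduct.tmul_zero]
          map_add' := fun n n' => by
            obtain ⟨s, rfl⟩ := Ideal.Quotient.mk_surjective s
            rw [hg, hg, hg, TensorProduct.tmul_add] }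
      map_zero' := by ext n; exact map_zero (g n)
      map_add' := fun s t => by ext n; exact map_add (g n) s t }
  have hF : ∀ (s : S) (n : N), F (Ideal.Quotient.mk _ s) n = s ⊗ₜ[R] n := fun s n => hg s n
  refine ⟨TensorProduct.liftAddHom F (fun r s n => ?_), fun s n => ?_⟩
  · obtain ⟨r, rfl⟩ := Ideal.Quotient.mk_surjective r
    obtain ⟨s, rfl⟩ := Ideal.Quotient.mk_surjective s
    have h1 : (Ideal.Quotient.mk I r) • (Ideal.Quotient.mk (Ideal.map (algebraMap R S) I) s) =
        Ideal.Quotient.mk _ (algebraMap R S r * s) := by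
      rw [Algebra.smul_def, map_mul]
      rfl
    have h2 : (Ideal.Quotient.mk I r) • n = r • n := by
      rw [← Ideal.Quotient.algebraMap_eq I]
      exact IsScalarTower.algebraMap_smul (R ⧸ I) r n
    rw [h1, hF, hF, h2, ← TensorProduct.smul_tmul, Algebra.smul_def]
  · rw [TensorProduct.liftAddHom_tmul, hF]

/-- **Tensor translation along a quotient pair.**  Let `I ⊆ R`, `N` an `R/I`-module (an `R`-module
through `R → R/I`) and `X` an `S`-module on which `IS` acts trivially, with its `S/IS`-structure. If
`X` is a retract of `(S/IS) ⊗_{R/I} N` over `S/IS`, then `X` is a retract of `S ⊗_R N` over `S`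
(compose with the comparison maps `s ⊗ n ↔ s̄ ⊗ n`, which are mutually inverse). [cite: BahlekehHakimianSalarianTakahashi2015, Theorem 4.5 (2) (proof: completion ascent, Corollary 4.4)] -/
theorem exists_retract_of_retract_quotientPair {X : Type u} [AddCommGroup X] [Module S X]
    [Module (S ⧸ Ideal.map (algebraMap R S) I) X]
    [IsScalarTower S (S ⧸ Ideal.map (algebraMap R S) I) X]
    (i : X →ₗ[S ⧸ Ideal.map (algebraMap R S) I] (S ⧸ Ideal.map (algebraMap R S) I) ⊗[R ⧸ I] N)
    (p : (S ⧸ Ideal.map (algebraMap R S) I) ⊗[R ⧸ I] N →ₗ[S ⧸ Ideal.map (algebraMap R S) I] X)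
    (h : p ∘ₗ i = LinearMap.id) :
    ∃ (i' : X →ₗ[S] S ⊗[R] N) (p' : S ⊗[R] N →ₗ[S] X), p' ∘ₗ i' = LinearMap.id := by
  obtain ⟨Φ, hΦ⟩ := exists_toQuotientPair (S := S) I (N := N)
  obtain ⟨Ψ, hΨ⟩ := exists_ofQuotientPair (S := S) I (N := N)
  -- `Φ ∘ Ψ = id`
  have hΦΨ : ∀ v, Φ (Ψ v) = v := by
    intro v
    induction v using TensorProduct.induction_on with
    | zero => rw [map_zero, map_zero]
    | tmul s n =>
      obtain ⟨s, rfl⟩ := Ideal.Quotient.mk_surjective s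
      rw [hΨ, hΦ]
    | add x y hx hy => rw [map_add, map_add, hx, hy]
  -- semilinearity
  have hΨsmul : ∀ (s : S) (v : (S ⧸ Ideal.map (algebraMap R S) I) ⊗[R ⧸ I] N),
      Ψ ((Ideal.Quotient.mk (Ideal.map (algebraMap R S) I) s) • v) = s • Ψ v := by
    intro s v
    induction v using TensorProduct.induction_on with
    | zero => rw [smul_zero, map_zero, smul_zero]
    | tmul t n =>
      obtain ⟨t, rfl⟩ := Ideal.Quotient.mk_surjective t
      rw [TensorProduct.smul_tmul', smul_eq_mul,
        ← map_mul (Ideal.Quotient.mk (Ideal.map (algebraMap R S) I)), hΨ, hΨ,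
        TensorProduct.smul_tmul', smul_eq_mul]
    | add x y hx hy => rw [smul_add, map_add, hx, hy, map_add, smul_add]
  have hΦsmul : ∀ (s : S) (u : S ⊗[R] N),
      Φ (s • u) = (Ideal.Quotient.mk (Ideal.map (algebraMap R S) I) s) • Φ u := by
    intro s u
    induction u using TensorProduct.induction_on with
    | zero => rw [smul_zero, map_zero, smul_zero]
    | tmul t n =>
      rw [TensorProduct.smul_tmul', smul_eq_mul, hΦ, hΦ, TensorProduct.smul_tmul', smul_eq_mul,
        map_mul]
    | add x y hx hy => rw [smul_add, map_add, hx, hy, map_add, smul_add]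
  have hpi : ∀ x, p (i x) = x := fun x => LinearMap.congr_fun h x
  let i' : X →ₗ[S] S ⊗[R] N :=
    { toFun := fun x => Ψ (i x)
      map_add' := fun x y => by rw [map_add, map_add]
      map_smul' := fun s x => by
        rw [RingHom.id_apply, ← hΨsmul, ← map_smul,
          ← IsScalarTower.algebraMap_smul (S ⧸ Ideal.map (algebraMap R S) I) s x,
          Ideal.Quotient.algebraMap_eq (Ideal.map (algebraMap R S) I)] }
  let p' : S ⊗[R] N →ₗ[S] X :=
    { toFun := fun u => p (Φ u)
      map_add' := fun u v => by rw [map_add, map_add]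
      map_smul' := fun s u => by
        rw [RingHom.id_apply, hΦsmul, map_smul,
          ← Ideal.Quotient.algebraMap_eq (Ideal.map (algebraMap R S) I), IsScalarTower.algebraMap_smul] }
  refine ⟨i', p', LinearMap.ext fun x => ?_⟩
  change p (Φ (Ψ (i x))) = x
  rw [hΦΨ, hpi]

end Translation

end Literature.RingTheory.CohomologyAnnihilator.BHST2015.CompletionAscentQuotientPair

end

end Part7

/-!
## Part 8 — port of `Summits/ResolutionOfSingularities/ResolutionOfSingularities/Theorems/HomologicalConductorPersistenceCompletionAscentSyzygyRetract.lean`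

# Syzygies of retracts of base changes; stable annihilation under base change and retracts

`[OURS · L w44b · completion model, ascent half · res-type-015 gen 15]` — fifth brick towards the
discharge of the named fact `Literature.RingTheory.CohomologyAnnihilator.le_caCompletion_comap`
([BahlekehHakimianSalarianTakahashi2015, Thm. 4.5 (2)]), helper for the surface rung
`PersistenceSurface` (stmt-ResolutionOfSingularities-19970) of crux chain w44b.  NOT a statement of
the manuscript under adjudication in cell res-hironaka; folklore homological bookkeeping over the
tree's `IsSyzygy` / `StablyAnnihilates` (`Literature.RingTheory.CohomologyAnnihilator.*`,
`…NoZenoStableAnnihilatorReduction`).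

* `StablyAnnihilates.mul_left`, `.of_retract`, `.prod_projective`, `.baseChange` — closure
  properties of «`c • 𝟙 M` factors through a finitely generated projective»;
* `exists_projective_isSyzygy_self` — a finitely generated projective has finitely generated
  projective `t`-th syzygies (itself, or `0`);
* `exists_retract_isSyzygy_of_retract_of_isSyzygy` — `t`-th syzygies of a retract: if `X` is a
  retract of `Z`, `K_X = Ωᵗ X`, `K_Z = Ωᵗ Z`, then `K_X` is a retract of `K_Z ⊕ Q`, `Q` finitely
  generated projective (the tree's `exists_retract_isSyzygy_of_retract` is `t = 1`);
* `exists_retract_baseChange_syzygy` — if `X` is an `S`-retract of `S ⊗_R N` (`S` flat over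
  noetherian `R`, `N` finitely generated) then `Ωᵗ_S X` is a retract of `(S ⊗_R Ωᵗ_R N) ⊕ Q`;
  `exists_retract_baseChange_syzygy_local` — for `S` local, of `S ⊗_R (Ωᵗ_R N ⊕ Rⁿ)`.

References: S. B. Iyengar, R. Takahashi, arXiv:1404.1476, §2 («syzygies are defined up to projective
summands») [`IyengarTakahashi2014`].
-/

section Part8

noncomputable section

open _root_.CategoryTheory _root_.CategoryTheory.Limits Literature.RingTheory.CohomologyAnnihilator
open Literature.RingTheory.CohomologyAnnihilator
open scoped _root_.TensorProduct

universe u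

namespace Literature.RingTheory.CohomologyAnnihilator.BHST2015.CompletionAscentSyzygyRetract

variable {T : Type u} [CommRing T]

/-! ## Closure properties of stable annihilation -/

/-- If `c • 𝟙 M` factors through a finitely generated projective, so does `(c' c) • 𝟙 M`.
[cite: BahlekehHakimianSalarianTakahashi2015, Theorem 4.5 (2) (proof: completion ascent, Corollary 4.4)] -/
theorem StablyAnnihilates.mul_left {c : T} (c' : T) {M : ModuleCat.{u} T}
    (h : StablyAnnihilates T c M) : StablyAnnihilates T (c' * c) M := by
  obtain ⟨P, hPfin, hPproj, ι, π, hιπ⟩ := h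
  exact ⟨P, hPfin, hPproj, c' • ι, π, by rw [Linear.smul_comp, hιπ, smul_smul]⟩

/-- Stable annihilation passes to retracts. [cite: BahlekehHakimianSalarianTakahashi2015, Theorem 4.5 (2) (proof: completion ascent, Corollary 4.4)] -/
theorem StablyAnnihilates.of_retract {c : T} {X Z : ModuleCat.{u} T} (i : X ⟶ Z) (p : Z ⟶ X)
    (hip : i ≫ p = 𝟙 X) (h : StablyAnnihilates T c Z) : StablyAnnihilates T c X := by
  obtain ⟨P, hPfin, hPproj, ι, π, hιπ⟩ := h
  refine ⟨P, hPfin, hPproj, i ≫ ι, π ≫ p, ?_⟩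
  rw [Category.assoc, ← Category.assoc ι, hιπ, Linear.smul_comp, Linear.comp_smul,
    Category.id_comp, hip]

/-- Stable annihilation is stable under adding a finitely generated projective summand.
[cite: BahlekehHakimianSalarianTakahashi2015, Theorem 4.5 (2) (proof: completion ascent, Corollary 4.4)] -/
theorem StablyAnnihilates.prod_projective {c : T} {K Q : ModuleCat.{u} T}
    (h : StablyAnnihilates T c K) (hQ : Module.Finite T Q) (hQproj : Projective Q) :
    StablyAnnihilates T c (ModuleCat.of T (K × Q)) := by
  obtain ⟨P, hPfin, hPproj, ι, π, hιπ⟩ := h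
  haveI := hPfin
  haveI := hQ
  refine ⟨ModuleCat.of T (P × Q), inferInstance, projective_prod hPproj hQproj,
    ModuleCat.ofHom (ι.hom.prodMap LinearMap.id), ModuleCat.ofHom (π.hom.prodMap (c • LinearMap.id)),
    ?_⟩
  apply ModuleCat.hom_ext
  refine LinearMap.ext fun x => ?_
  obtain ⟨k, q⟩ := x
  change (π.hom (ι.hom k), (c • LinearMap.id (R := T) (M := Q)) q) = c • (k, q)
  rw [apply_apply_eq_smul_of_comp_eq_smul_id hιπ k]
  rfl

/-- **Stable annihilation ascends along base change**: if `a • 𝟙 M` factors through a finitely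
generated projective `R`-module, then `a • 𝟙 (S ⊗_R M)` factors through a finitely generated
projective `S`-module. [cite: BahlekehHakimianSalarianTakahashi2015, Theorem 4.5 (2) (proof: completion ascent, Corollary 4.4)] -/
theorem StablyAnnihilates.baseChange {R : Type u} [CommRing R] (S : Type u) [CommRing S]
    [Algebra R S] {a : R} {M : ModuleCat.{u} R} (h : StablyAnnihilates R a M) :
    StablyAnnihilates S (algebraMap R S a) (ModuleCat.of S (S ⊗[R] M)) := by
  obtain ⟨P, hPfin, hPproj, ι, π, hιπ⟩ := h
  haveI := hPfin
  haveI := moduleProjective_of_projective P hPproj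
  refine ⟨ModuleCat.of S (S ⊗[R] P), Module.Finite.base_change R S P,
    (IsProjective.iff_projective (R := S) (S ⊗[R] P)).mp inferInstance,
    ModuleCat.ofHom (ι.hom.baseChange S), ModuleCat.ofHom (π.hom.baseChange S), ?_⟩
  apply ModuleCat.hom_ext
  refine LinearMap.ext fun x => ?_
  change π.hom.baseChange S (ι.hom.baseChange S x) = algebraMap R S a • x
  induction x using TensorProduct.induction_on with
  | zero => rw [map_zero, map_zero, smul_zero]
  | tmul s m =>
    rw [LinearMap.baseChange_tmul, LinearMap.baseChange_tmul,
      apply_apply_eq_smul_of_comp_eq_smul_id hιπ m, TensorProduct.tmul_smul, algebraMap_smul]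
  | add x y hx hy => rw [map_add, map_add, hx, hy, smul_add]

/-! ## Syzygies of projectives and of retracts -/

/-- A zero module is an `s`-th syzygy of a zero module, for every `s`. [cite: BahlekehHakimianSalarianTakahashi2015, Theorem 4.5 (2) (proof: completion ascent, Corollary 4.4)] -/
theorem isSyzygy_punit_punit : ∀ s : ℕ,
    IsSyzygy s (ModuleCat.of T PUnit.{u + 1}) (ModuleCat.of T PUnit.{u + 1})
  | 0 => ⟨Iso.refl _⟩
  | s + 1 => by
      have h : IsSyzygy (1 + s) (ModuleCat.of T PUnit.{u + 1}) (ModuleCat.of T PUnit.{u + 1}) :=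
        (isSyzygy_punit_punit s).trans
          (isSyzygy_one_of_isZero (ModuleCat.isZero_of_subsingleton _)
            (ModuleCat.isZero_of_subsingleton _))
      exact Nat.add_comm 1 s ▸ h

/-- A finitely generated projective module has, for every `t`, a finitely generated projective
`t`-th syzygy (itself for `t = 0`, zero for `t ≥ 1`). [cite: BahlekehHakimianSalarianTakahashi2015, Theorem 4.5 (2) (proof: completion ascent, Corollary 4.4)] -/
theorem exists_projective_isSyzygy_self {Q : ModuleCat.{u} T} (hQ : Module.Finite T Q)
    (hQproj : Projective Q) :
    ∀ t : ℕ, ∃ Q' : ModuleCat.{u} T, Module.Finite T Q' ∧ Projective Q' ∧ IsSyzygy t Q Q'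
  | 0 => ⟨Q, hQ, hQproj, ⟨Iso.refl Q⟩⟩
  | t + 1 => ⟨ModuleCat.of T PUnit.{u + 1}, inferInstance, projective_punit, by
      have h := (isSyzygy_one_projective hQ hQproj).trans (isSyzygy_punit_punit (T := T) t)
      exact Nat.add_comm 1 t ▸ h⟩

/-- **`t`-th syzygies of a retract**: if `X` is a retract of `Z` (`i ≫ p = 𝟙 X`), `K_Z` is a `t`-th
syzygy of `Z` and `K_X` one of `X`, then `K_X` is a retract of `K_Z ⊕ Q` for some finitely generated
projective `Q` (induction on `t` from the tree's first-syzygy case). [cite: BahlekehHakimianSalarianTakahashi2015, Theorem 4.5 (2) (proof: completion ascent, Corollary 4.4)] -/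
theorem exists_retract_isSyzygy_of_retract_of_isSyzygy :
    ∀ (t : ℕ) {X Z KX KZ : ModuleCat.{u} T} (i : X ⟶ Z) (p : Z ⟶ X), i ≫ p = 𝟙 X →
      IsSyzygy t Z KZ → IsSyzygy t X KX →
      ∃ Q : ModuleCat.{u} T, Module.Finite T Q ∧ Projective Q ∧
        ∃ (i' : KX ⟶ ModuleCat.of T (KZ × Q)) (p' : ModuleCat.of T (KZ × Q) ⟶ KX),
          i' ≫ p' = 𝟙 KX
  | 0, X, Z, KX, KZ, i, p, hip, ⟨eZ⟩, ⟨eX⟩ => by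
    refine ⟨ModuleCat.of T PUnit.{u + 1}, inferInstance, projective_punit,
      eX.hom ≫ i ≫ eZ.inv ≫ ModuleCat.ofHom (LinearMap.inl T KZ PUnit.{u + 1}),
      ModuleCat.ofHom (LinearMap.fst T KZ PUnit.{u + 1}) ≫ eZ.hom ≫ p ≫ eX.inv, ?_⟩
    have h1 : ModuleCat.ofHom (LinearMap.inl T KZ PUnit.{u + 1}) ≫
        ModuleCat.ofHom (LinearMap.fst T KZ PUnit.{u + 1}) = 𝟙 KZ := by
      apply ModuleCat.hom_ext
      exact LinearMap.fst_comp_inl T KZ PUnit.{u + 1}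
    simp only [Category.assoc]
    rw [← Category.assoc (ModuleCat.ofHom (LinearMap.inl T KZ PUnit.{u + 1})), h1,
      Category.id_comp, eZ.inv_hom_id_assoc, ← Category.assoc i, hip, Category.id_comp,
      eX.hom_inv_id]
  | t + 1, X, Z, KX, KZ, i, p, hip, hZ, hX => by
    obtain ⟨Z₁, hZ₁, hZ'⟩ := isSyzygy_succ_iff_exists_first.mp hZ
    obtain ⟨X₁, hX₁, hX'⟩ := isSyzygy_succ_iff_exists_first.mp hX
    -- first step: `X₁` is a retract of `Z₁ ⊕ Q₁`
    obtain ⟨Q₁, hQ₁, hQ₁proj, i₁, p₁, hip₁⟩ := exists_retract_isSyzygy_of_retract i p hip hZ₁ hX₁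
    -- a `t`-th syzygy of `Z₁ ⊕ Q₁` is `K_Z ⊕ Q₁'`
    obtain ⟨Q₁', hQ₁', hQ₁'proj, hQsyz⟩ := exists_projective_isSyzygy_self hQ₁ hQ₁proj t
    have hZQ : IsSyzygy t (ModuleCat.of T (Z₁ × Q₁)) (ModuleCat.of T (KZ × Q₁')) := hZ'.prod hQsyz
    obtain ⟨Q₂, hQ₂, hQ₂proj, i₂, p₂, hip₂⟩ :=
      exists_retract_isSyzygy_of_retract_of_isSyzygy t i₁ p₁ hip₁ hZQ hX'
    -- reassociate `(K_Z ⊕ Q₁') ⊕ Q₂ ≅ K_Z ⊕ (Q₁' ⊕ Q₂)`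
    haveI := hQ₁'
    haveI := hQ₂
    let e : ((KZ × Q₁') × Q₂) ≃ₗ[T] (KZ × (Q₁' × Q₂)) := LinearEquiv.prodAssoc T KZ Q₁' Q₂
    refine ⟨ModuleCat.of T (Q₁' × Q₂), inferInstance, projective_prod hQ₁'proj hQ₂proj,
      i₂ ≫ ModuleCat.ofHom (X := ModuleCat.of T ((KZ × Q₁') × Q₂))
        (Y := ModuleCat.of T (KZ × (Q₁' × Q₂))) e.toLinearMap,
      ModuleCat.ofHom (X := ModuleCat.of T (KZ × (Q₁' × Q₂)))
        (Y := ModuleCat.of T ((KZ × Q₁') × Q₂)) e.symm.toLinearMap ≫ p₂, ?_⟩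
    rw [Category.assoc, ← Category.assoc (ModuleCat.ofHom e.toLinearMap)]
    have he : ModuleCat.ofHom (X := ModuleCat.of T ((KZ × Q₁') × Q₂))
        (Y := ModuleCat.of T (KZ × (Q₁' × Q₂))) e.toLinearMap ≫
        ModuleCat.ofHom (X := ModuleCat.of T (KZ × (Q₁' × Q₂)))
        (Y := ModuleCat.of T ((KZ × Q₁') × Q₂)) e.symm.toLinearMap =
          𝟙 (ModuleCat.of T ((KZ × Q₁') × Q₂)) := by
      apply ModuleCat.hom_ext
      exact LinearMap.ext fun x => e.symm_apply_apply x
    rw [he, Category.id_comp, hip₂]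

/-! ## Syzygies of a retract of a base change -/

/-- **Syzygies of a retract of a base change.**  Let `S` be flat over the noetherian ring `R`, `N` a
finitely generated `R`-module and `X` an `S`-retract of `S ⊗_R N`.  Then every `t`-th syzygy `K_X`
of `X` over `S` is a retract of `(S ⊗_R K_N) ⊕ Q` with `K_N` a (finitely generated) `t`-th syzygy of
`N` over `R` and `Q` finitely generated projective over `S` (base change of syzygies,
`IsSyzygy.baseChange`, and `exists_retract_isSyzygy_of_retract_of_isSyzygy`). [cite: BahlekehHakimianSalarianTakahashi2015, Theorem 4.5 (2) (proof: completion ascent, Corollary 4.4)] -/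
theorem exists_retract_baseChange_syzygy {R S : Type u} [CommRing R] [CommRing S] [Algebra R S]
    [IsNoetherianRing R] [Module.Flat R S] {X : ModuleCat.{u} S} {N : Type u} [AddCommGroup N]
    [Module R N] [Module.Finite R N]
    (i : X ⟶ ModuleCat.of S (S ⊗[R] N)) (p : ModuleCat.of S (S ⊗[R] N) ⟶ X) (hip : i ≫ p = 𝟙 X)
    (t : ℕ) {KX : ModuleCat.{u} S} (hKX : IsSyzygy t X KX) :
    ∃ (KN : ModuleCat.{u} R) (_ : Module.Finite R KN) (_ : IsSyzygy t (ModuleCat.of R N) KN)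
      (Q : ModuleCat.{u} S) (_ : Module.Finite S Q) (_ : Projective Q)
      (i' : KX ⟶ ModuleCat.of S ((S ⊗[R] KN) × Q)) (p' : ModuleCat.of S ((S ⊗[R] KN) × Q) ⟶ KX),
      i' ≫ p' = 𝟙 KX := by
  obtain ⟨KN, hKNfin, hKN⟩ := exists_isSyzygy (ModuleCat.of R N) t
  have hZ : IsSyzygy t (ModuleCat.of S (S ⊗[R] N)) (ModuleCat.of S (S ⊗[R] KN)) :=
    IsSyzygy.baseChange S t hKN
  obtain ⟨Q, hQ, hQproj, i', p', hip'⟩ :=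
    exists_retract_isSyzygy_of_retract_of_isSyzygy t i p hip hZ hKX
  exact ⟨KN, hKNfin, hKN, Q, hQ, hQproj, i', p', hip'⟩

/-- Over a LOCAL ring `S`, a finitely generated projective `Q` is free, hence a base change:
`Q ≅ S ⊗_R (ι → R)` for a finite type `ι`. [cite: BahlekehHakimianSalarianTakahashi2015, Theorem 4.5 (2) (proof: completion ascent, Corollary 4.4)] -/
theorem exists_linearEquiv_baseChange_pi_of_projective {R S : Type u} [CommRing R] [CommRing S]
    [Algebra R S] [IsLocalRing S] {Q : ModuleCat.{u} S} (hQ : Module.Finite S Q)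
    (hQproj : Projective Q) :
    ∃ (ι : Type u) (_ : Fintype ι), Nonempty (Q ≃ₗ[S] S ⊗[R] (ι → R)) := by
  classical
  haveI := hQ
  haveI := moduleProjective_of_projective Q hQproj
  haveI : Module.Free S Q := Module.free_of_flat_of_isLocalRing
  let b := Module.Free.chooseBasis S Q
  refine ⟨Module.Free.ChooseBasisIndex S Q, inferInstance,
    ⟨b.equivFun ≪≫ₗ (TensorProduct.piScalarRight R S S (Module.Free.ChooseBasisIndex S Q)).symm⟩⟩

/-- **Syzygies of a retract of a base change, local case.**  With `S` moreover local, every `t`-th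
syzygy `K_X` of an `S`-retract `X` of `S ⊗_R N` is a retract of `S ⊗_R N'` with
`N' = K_N ⊕ (ι → R)` finitely generated, `K_N` a `t`-th syzygy of `N`. [cite: BahlekehHakimianSalarianTakahashi2015, Theorem 4.5 (2) (proof: completion ascent, Corollary 4.4)] -/
theorem exists_retract_baseChange_syzygy_local {R S : Type u} [CommRing R] [CommRing S]
    [Algebra R S] [IsNoetherianRing R] [Module.Flat R S] [IsLocalRing S] {X : ModuleCat.{u} S}
    {N : Type u} [AddCommGroup N] [Module R N] [Module.Finite R N]
    (i : X ⟶ ModuleCat.of S (S ⊗[R] N)) (p : ModuleCat.of S (S ⊗[R] N) ⟶ X) (hip : i ≫ p = 𝟙 X)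
    (t : ℕ) {KX : ModuleCat.{u} S} (hKX : IsSyzygy t X KX) :
    ∃ (N' : Type u) (_ : AddCommGroup N') (_ : Module R N') (_ : Module.Finite R N')
      (i' : KX →ₗ[S] S ⊗[R] N') (p' : S ⊗[R] N' →ₗ[S] KX), p' ∘ₗ i' = LinearMap.id := by
  classical
  obtain ⟨KN, hKNfin, -, Q, hQ, hQproj, i₁, p₁, hip₁⟩ := exists_retract_baseChange_syzygy i p hip t hKX
  obtain ⟨ι, hι, ⟨eQ⟩⟩ := exists_linearEquiv_baseChange_pi_of_projective (R := R) hQ hQproj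
  haveI := hKNfin
  -- `(S ⊗ K_N) × Q ≅ (S ⊗ K_N) × (S ⊗ (ι → R)) ≅ S ⊗ (K_N × (ι → R))`
  let e : ((S ⊗[R] KN) × Q) ≃ₗ[S] S ⊗[R] (KN × (ι → R)) :=
    (LinearEquiv.refl S (S ⊗[R] KN)).prodCongr eQ ≪≫ₗ (TensorProduct.prodRight R S S KN (ι → R)).symm
  have hpi : ∀ x, p₁.hom (i₁.hom x) = x := fun x => by
    have := congrArg (fun φ => φ.hom x) hip₁
    simpa using this
  refine ⟨KN × (ι → R), inferInstance, inferInstance, inferInstance,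
    e.toLinearMap ∘ₗ i₁.hom, p₁.hom ∘ₗ e.symm.toLinearMap, LinearMap.ext fun x => ?_⟩
  change p₁.hom (e.symm (e (i₁.hom x))) = x
  rw [e.symm_apply_apply, hpi]

end Literature.RingTheory.CohomologyAnnihilator.BHST2015.CompletionAscentSyzygyRetract

end

end Part8

/-!
## Part 9 — port of `Summits/ResolutionOfSingularities/ResolutionOfSingularities/Theorems/HomologicalConductorPersistenceCompletionAscentRetract.lean`

# Punctured-free modules over a completion-like pair are retracts of base changes

`[OURS · L w44b · completion model, ascent half · res-type-015 gen 15]` — sixth brick towards the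
discharge of the named fact `Literature.RingTheory.CohomologyAnnihilator.le_caCompletion_comap`
([BahlekehHakimianSalarianTakahashi2015, Thm. 4.5 (2)]), helper for the surface rung
`PersistenceSurface` (stmt-ResolutionOfSingularities-19970) of crux chain w44b.  NOT a statement of
the manuscript under adjudication in cell res-hironaka; commutative algebra over Mathlib and the
sibling bricks `…CompletionAscent{OneStep,Lifting,Punctured,QuotientPair,SyzygyRetract}`.

**Theorem** (`exists_retract_baseChange_of_puncturedFree`, our Koszul-free substitute for
[BHST15, Cor. 4.4] «every `M ∈ mod₀ R̂` is a direct summand of some `N̂`»).  Let `R → S` be a flat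
homomorphism of noetherian local rings with `𝔪S = 𝔫` and `R` dense in `S` (`∀ k s, ∃ r, s - r ∈ 𝔫ᵏ`;
e.g. `S = R̂`).  Then every finitely generated `S`-module `M` which is stably annihilated by a power
of every element of `𝔫` is an `S`-linear retract of `S ⊗_R N` for some finitely generated `R`-module
`N`.

Proof: induction on `dim S`.  If `dim S = 0` then `𝔫ᵏ = 0`, `R → S` is onto and `N = M`.  If
`dim S ≥ 1`, prime avoidance gives `x ∈ 𝔪` outside the associated primes `≠ 𝔫` of `S`; a power
`w = x^{e+1}` stably annihilates `M`; the one-step lemma gives `0 → (0 :_M w) → M ⊕ ΩM → Ω(M/wM) → 0`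
with `(0 :_M w)` killed by `𝔫ᵏ`; `M/wM` is punctured-free over the quotient pair `(R/(w), S/(w))`
of smaller dimension, so by induction a retract of a base change, hence so is `Ω(M/wM)`; the
lifting lemma then shows `M ⊕ ΩM ⊕ L' ≅ S ⊗_R N`.

References: A. Bahlekeh, E. Hakimian, S. Salarian, R. Takahashi, arXiv:1504.06163, Cor. 4.4
[`BahlekehHakimianSalarianTakahashi2015`]; S. B. Iyengar, R. Takahashi, arXiv:1404.1476,
Remark 2.12 [`IyengarTakahashi2014`].
-/

section Part9

noncomputable section

open _root_.CategoryTheory _root_.IsLocalRing Literature.RingTheory.CohomologyAnnihilator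
open Literature.RingTheory.CohomologyAnnihilator
open Literature.RingTheory.CohomologyAnnihilator.BHST2015.CompletionAscentOneStep
open Literature.RingTheory.CohomologyAnnihilator.BHST2015.CompletionAscentLifting
open Literature.RingTheory.CohomologyAnnihilator.BHST2015.CompletionAscentPunctured
open Literature.RingTheory.CohomologyAnnihilator.BHST2015.CompletionAscentQuotientPair
open Literature.RingTheory.CohomologyAnnihilator.BHST2015.CompletionAscentSyzygyRetract
open scoped _root_.Pointwise _root_.TensorProduct

universe u

namespace Literature.RingTheory.CohomologyAnnihilator.BHST2015.CompletionAscentRetract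

/-- Base case: if `R → S` is onto (as happens when `dim S = 0`, `𝔫ᵏ = 0`), every `S`-module `M` is
the base change of itself: `M ≅ S ⊗_R M`, in particular a retract. [cite: BahlekehHakimianSalarianTakahashi2015, Theorem 4.5 (2) (proof: completion ascent, Corollary 4.4)] -/
theorem exists_retract_baseChange_of_surjective {R S : Type u} [CommRing R] [CommRing S]
    [Algebra R S] (hsurj : Function.Surjective (algebraMap R S)) (M : Type u) [AddCommGroup M]
    [Module S M] [Module R M] [IsScalarTower R S M] :
    ∃ (i : M →ₗ[S] S ⊗[R] M) (p : S ⊗[R] M →ₗ[S] M), p ∘ₗ i = LinearMap.id := by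
  refine ⟨{ toFun := fun m => (1 : S) ⊗ₜ[R] m
            map_add' := fun m m' => TensorProduct.tmul_add _ _ _
            map_smul' := fun s m => ?_ }, LinearMap.liftBaseChange S LinearMap.id, ?_⟩
  · obtain ⟨r, rfl⟩ := hsurj s
    rw [RingHom.id_apply, algebraMap_smul, algebraMap_smul, ← TensorProduct.smul_tmul,
      TensorProduct.smul_tmul', ]
  · refine LinearMap.ext fun m => ?_
    change LinearMap.liftBaseChange S LinearMap.id ((1 : S) ⊗ₜ[R] m) = m
    rw [LinearMap.liftBaseChange_tmul, one_smul, LinearMap.id_apply]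

/-- **Punctured-free modules over a completion-like pair are retracts of base changes** (our
substitute for [BahlekehHakimianSalarianTakahashi2015, Cor. 4.4]): for a flat homomorphism `R → S`
of noetherian local rings with `𝔪S = 𝔫` and `R` dense in `S`, of Krull dimension `dim S = d`, every
finitely generated `S`-module stably annihilated by a power of every element of `𝔫` is an
`S`-retract of `S ⊗_R N` with `N` finitely generated over `R`.  Induction on `d` (see the module
docstring). [cite: BahlekehHakimianSalarianTakahashi2015, Corollary 4.4 (substitute)] -/
theorem exists_retract_baseChange_of_puncturedFree (d : ℕ) :
    ∀ {R S : Type u} [CommRing R] [CommRing S] [Algebra R S] [IsNoetherianRing R]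
      [IsNoetherianRing S] [IsLocalRing R] [IsLocalRing S] [Module.Flat R S],
      (maximalIdeal R).map (algebraMap R S) = maximalIdeal S →
      (∀ (k : ℕ) (s : S), ∃ r : R, s - algebraMap R S r ∈ maximalIdeal S ^ k) →
      ringKrullDim S = d →
      ∀ (M : ModuleCat.{u} S), Module.Finite S M →
        (∀ y ∈ maximalIdeal S, ∃ e : ℕ, StablyAnnihilates S (y ^ e) M) →
        ∃ (N : Type u) (_ : AddCommGroup N) (_ : Module R N) (_ : Module.Finite R N)
          (i : M →ₗ[S] S ⊗[R] N) (p : S ⊗[R] N →ₗ[S] M), p ∘ₗ i = LinearMap.id := by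
  induction d using Nat.strong_induction_on with
  | _ d ih => ?_
  intro R S _ _ _ _ _ _ _ _ hmap hdense hdim M hMfin hPF
  haveI := hMfin
  haveI : IsLocalHom (algebraMap R S) :=
    ((IsLocalRing.local_hom_TFAE (algebraMap R S)).out 0 2).mpr hmap.le
  haveI : Module.FaithfullyFlat R S := Module.FaithfullyFlat.of_flat_of_isLocalHom
  by_cases hd : d = 0
  · -- base case: `𝔫ᵏ = 0`, so `R → S` is onto and `N = M`
    subst hd
    obtain ⟨k, hk⟩ := exists_maximalIdeal_pow_eq_bot_of_ringKrullDim_eq_zero (S := S)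
      (by rw [hdim]; rfl)
    have hsurj : Function.Surjective (algebraMap R S) := fun s => by
      obtain ⟨r, hr⟩ := hdense k s
      rw [hk, Ideal.mem_bot, sub_eq_zero] at hr
      exact ⟨r, hr.symm⟩
    letI : Module R M := Module.compHom M (algebraMap R S)
    haveI : IsScalarTower R S M := IsScalarTower.of_algebraMap_smul fun r m => rfl
    haveI : Module.Finite R M := finite_restrictScalars_of_pow_smul_eq_zero hdense (k := k)
      (fun x hx m => by rw [hk, Ideal.mem_bot] at hx; rw [hx, zero_smul])
    obtain ⟨i, p, hip⟩ := exists_retract_baseChange_of_surjective hsurj M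
    exact ⟨M, inferInstance, inferInstance, inferInstance, i, p, hip⟩
  · -- induction step
    have hd1 : 1 ≤ d := Nat.one_le_iff_ne_zero.mpr hd
    -- choose `x ∈ 𝔪` outside the associated primes `≠ 𝔫` of `S`, and a power stably annihilating `M`
    obtain ⟨x, hxm, hxass⟩ :=
      exists_mem_maximalIdeal_forall_notMem_associatedPrimes (R := R) (S := S) hmap
    have hy : algebraMap R S x ∈ maximalIdeal S := hmap ▸ Ideal.mem_map_of_mem _ hxm
    obtain ⟨e, he⟩ := hPF _ hy
    obtain ⟨z, hz⟩ : ∃ z : R, z = x ^ (e + 1) := ⟨_, rfl⟩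
    have hzm : z ∈ maximalIdeal R := hz ▸ Ideal.pow_mem_of_mem _ hxm _ e.succ_pos
    have hwM : StablyAnnihilates S (algebraMap R S z) M := by
      rw [hz, map_pow, pow_succ']
      exact StablyAnnihilates.mul_left _ he
    have hwn : algebraMap R S z ∈ maximalIdeal S := hmap ▸ Ideal.mem_map_of_mem _ hzm
    have hwass : ∀ P ∈ associatedPrimes S S, P ≠ maximalIdeal S → algebraMap R S z ∉ P := by
      intro P hP hne hwP
      haveI := IsAssociatedPrime.isPrime hP
      rw [hz, map_pow] at hwP
      exact hxass P hP hne (Ideal.IsPrime.mem_of_pow_mem ‹_› _ hwP)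
    -- the one-step lemma
    obtain ⟨K, L, hK, hL, f, g, wfg, hS⟩ := exists_shortExact_torsionBy_prod_syzygy hwM
    obtain ⟨hfinj, hgsurj, hfg⟩ := shortExact_unpack hS
    obtain ⟨k, hk⟩ := exists_pow_forall_smul_eq_zero_of_torsion hwass hPF
    -- the quotient pair `(R/(z), S/(z)S)`
    obtain ⟨I, hI⟩ : ∃ I : Ideal R, I = Ideal.span {z} := ⟨_, rfl⟩
    have hJ : I.map (algebraMap R S) = Ideal.span {algebraMap R S z} := by
      rw [hI, Ideal.map_span, Set.image_singleton]
    have hIm : I ≤ maximalIdeal R := by rw [hI, Ideal.span_singleton_le_iff_mem]; exact hzm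
    have hJn : I.map (algebraMap R S) ≤ maximalIdeal S := by
      rw [hJ, Ideal.span_singleton_le_iff_mem]; exact hwn
    haveI : Nontrivial (R ⧸ I) := Ideal.Quotient.nontrivial_iff.mpr
      (ne_top_of_le_ne_top (IsLocalRing.maximalIdeal.isMaximal R).ne_top hIm)
    haveI : IsLocalRing (R ⧸ I) := isLocalRing_quotient I
    haveI : Nontrivial (S ⧸ I.map (algebraMap R S)) := Ideal.Quotient.nontrivial_iff.mpr
      (ne_top_of_le_ne_top (IsLocalRing.maximalIdeal.isMaximal S).ne_top hJn)
    haveI : IsLocalRing (S ⧸ I.map (algebraMap R S)) := isLocalRing_quotient _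
    haveI : Module.Flat (R ⧸ I) (S ⧸ I.map (algebraMap R S)) :=
      Module.Flat.of_linearEquiv (Algebra.TensorProduct.quotIdealMapEquivQuotTensor S I).toLinearEquiv
    have hmap' := map_maximalIdeal_quotient (S := S) I hmap
    have hdense' := dense_quotient (S := S) I hdense
    obtain ⟨d', hd'lt, hdim'⟩ := exists_ringKrullDim_quotient_lt hwn hwass hd1 hdim hJ
    -- `M/(z)M` is punctured-free over the quotient pair: induction hypothesis
    have hMqfin : Module.Finite (S ⧸ I.map (algebraMap R S))
        (ModuleCat.of (S ⧸ I.map (algebraMap R S))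
          (M ⧸ ((I.map (algebraMap R S)) • ⊤ : Submodule S M))) :=
      Module.Finite.of_restrictScalars_finite S _ _
    have hPFq := puncturedFree_quotient (I.map (algebraMap R S)) hPF
    obtain ⟨Nq, _, _, _, iq, pq, hiq⟩ := ih d' hd'lt hmap' hdense' hdim' _ hMqfin hPFq
    -- translate: `M/(z)M` is an `S`-retract of `S ⊗_R Nq`
    letI : Module R Nq := Module.compHom Nq (Ideal.Quotient.mk I)
    haveI : IsScalarTower R (R ⧸ I) Nq := IsScalarTower.of_algebraMap_smul fun r n => rfl
    haveI : Module.Finite R Nq := Module.Finite.trans (R ⧸ I) Nq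
    obtain ⟨i₁, p₁, hip₁⟩ := exists_retract_of_retract_quotientPair I iq pq hiq
    have hJw : ((I.map (algebraMap R S)) • ⊤ : Submodule S M) =
        algebraMap R S z • (⊤ : Submodule S M) := by
      rw [hJ, Submodule.ideal_span_singleton_smul]
    let eq : (M ⧸ ((I.map (algebraMap R S)) • ⊤ : Submodule S M)) ≃ₗ[S]
        (M ⧸ (algebraMap R S z • (⊤ : Submodule S M))) := Submodule.quotEquivOfEq _ _ hJw
    have hip₁' : ∀ v, p₁ (i₁ v) = v := fun v => LinearMap.congr_fun hip₁ v
    have hret : ModuleCat.ofHom (X := ModuleCat.of S (M ⧸ (algebraMap R S z • (⊤ : Submodule S M))))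
        (Y := ModuleCat.of S (S ⊗[R] Nq)) (i₁ ∘ₗ eq.symm.toLinearMap) ≫
        ModuleCat.ofHom (X := ModuleCat.of S (S ⊗[R] Nq))
        (Y := ModuleCat.of S (M ⧸ (algebraMap R S z • (⊤ : Submodule S M)))) (eq.toLinearMap ∘ₗ p₁) =
        𝟙 _ := by
      apply ModuleCat.hom_ext
      refine LinearMap.ext fun v => ?_
      change eq (p₁ (i₁ (eq.symm v))) = v
      rw [hip₁', LinearEquiv.apply_symm_apply]
    -- `L = Ω(M/zM)` is a retract of `S ⊗_R N'`
    obtain ⟨N', _, _, _, iL, pL, hipL⟩ := exists_retract_baseChange_syzygy_local _ _ hret 1 hL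
    have hipL' : ∀ l, pL (iL l) = l := fun l => LinearMap.congr_fun hipL l
    obtain ⟨εL⟩ := exists_iso_prod_of_retract (ModuleCat.ofHom iL) (ModuleCat.ofHom pL)
      (ModuleCat.hom_ext (LinearMap.ext fun l => hipL' l))
    -- `A = (0 :_M z)` is killed by `𝔫ᵏ`: finite-length transfer
    let A := Submodule.torsionBy S M (algebraMap R S z)
    letI : Module R A := Module.compHom A (algebraMap R S)
    haveI : IsScalarTower R S A := IsScalarTower.of_algebraMap_smul fun r a => rfl
    have hAn : ∀ xx ∈ maximalIdeal S ^ k, ∀ a : A, xx • a = 0 := fun xx hxx a =>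
      Subtype.ext (hk xx hxx (a : M) ((Submodule.mem_torsionBy_iff _ (a : M)).mp a.2))
    haveI : IsNoetherian S M := isNoetherian_of_isNoetherianRing_of_finite S M
    haveI : Module.Finite S A := Module.IsNoetherian.finite S A
    haveI : Module.Finite R A := finite_restrictScalars_of_pow_smul_eq_zero hdense hAn
    have hAm : ∀ xx ∈ maximalIdeal R ^ k, ∀ a : A, xx • a = 0 := fun xx hxx a => by
      have h1 : algebraMap R S xx ∈ maximalIdeal S ^ k := by
        rw [← hmap, ← Ideal.map_pow]; exact Ideal.mem_map_of_mem _ hxx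
      exact hAn _ h1 a
    have hbij := mk_one_bijective_of_pow_smul_eq_zero hmap hdense hAm
    let eA : S ⊗[R] A →ₗ[S] A := LinearMap.liftBaseChange S LinearMap.id
    have heA : ∀ a : A, eA ((1 : S) ⊗ₜ[R] a) = a := fun a => by
      change LinearMap.liftBaseChange S LinearMap.id ((1 : S) ⊗ₜ[R] a) = a
      rw [LinearMap.liftBaseChange_tmul, one_smul, LinearMap.id_apply]
    have heAinj : Function.Injective eA := by
      intro u v huv
      obtain ⟨a, rfl⟩ := hbij.2 u
      obtain ⟨b, rfl⟩ := hbij.2 v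
      change eA ((1 : S) ⊗ₜ[R] a) = eA ((1 : S) ⊗ₜ[R] b) at huv
      rw [heA, heA] at huv
      rw [huv]
    -- the extension `0 → S ⊗ A → (M ⊕ K) ⊕ L' → S ⊗ N' → 0`
    let L' := LinearMap.ker pL
    let f₂ : S ⊗[R] A →ₗ[S] (M × K) × L' := LinearMap.inl S (M × K) L' ∘ₗ f.hom ∘ₗ eA
    let g₂ : (M × K) × L' →ₗ[S] S ⊗[R] N' := εL.inv.hom ∘ₗ g.hom.prodMap LinearMap.id
    have hf₂ : ∀ u, f₂ u = (f.hom (eA u), 0) := fun u => rfl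
    have hg₂ : ∀ b : (M × K) × L', g₂ b = εL.inv.hom (g.hom b.1, b.2) := fun b => rfl
    have hεinj : Function.Injective εL.inv.hom := fun a b hab => by
      have := congrArg εL.hom.hom hab
      rwa [← ModuleCat.comp_apply, ← ModuleCat.comp_apply, εL.inv_hom_id] at this
    have hεsurj : Function.Surjective εL.inv.hom := fun v =>
      ⟨εL.hom.hom v, by rw [← ModuleCat.comp_apply, εL.hom_inv_id]; rfl⟩
    have hf₂inj : Function.Injective f₂ := fun u v huv => by
      rw [hf₂, hf₂, Prod.mk.injEq] at huv
      exact heAinj (hfinj huv.1)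
    have hg₂surj : Function.Surjective g₂ := by
      intro v
      obtain ⟨⟨l, l'⟩, rfl⟩ := hεsurj v
      obtain ⟨mk, rfl⟩ := hgsurj l
      exact ⟨(mk, l'), rfl⟩
    have hfg₂ : Function.Exact f₂ g₂ := by
      intro b
      constructor
      · intro hb
        rw [hg₂] at hb
        have h0 : (g.hom b.1, b.2) = 0 := hεinj (by rw [hb, map_zero])
        rw [Prod.mk_eq_zero] at h0
        obtain ⟨a, ha⟩ := (hfg _).1 h0.1
        obtain ⟨u, hu⟩ : ∃ u, eA u = a := ⟨(1 : S) ⊗ₜ[R] a, heA a⟩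
        refine ⟨u, ?_⟩
        rw [hf₂, hu]
        exact Prod.ext ha h0.2.symm
      · rintro ⟨u, rfl⟩
        rw [hg₂, hf₂]
        change εL.inv.hom (g.hom (f.hom (eA u)), 0) = 0
        rw [hfg.apply_apply_eq_zero, Prod.mk_zero_zero, map_zero]
    obtain ⟨NB, _, _, _, ⟨eB⟩⟩ :=
      exists_linearEquiv_baseChange_of_extension (A₀ := A) (N := N') (B := (M × K) × L') hbij f₂ g₂
        hf₂inj hg₂surj hfg₂
    refine ⟨NB, inferInstance, inferInstance, inferInstance,
      eB.toLinearMap ∘ₗ (LinearMap.inl S (M × K) L' ∘ₗ LinearMap.inl S M K),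
      (LinearMap.fst S M K ∘ₗ LinearMap.fst S (M × K) L') ∘ₗ eB.symm.toLinearMap,
      LinearMap.ext fun m => ?_⟩
    change ((eB.symm (eB ((m, 0), 0))).1).1 = m
    rw [LinearEquiv.symm_apply_apply]

end Literature.RingTheory.CohomologyAnnihilator.BHST2015.CompletionAscentRetract

end

end Part9

/-!
## Part 10 — port of `Summits/ResolutionOfSingularities/ResolutionOfSingularities/Theorems/HomologicalConductorPersistenceCompletionAscentIsolated.lean`

# Over an isolated singularity of dimension `d`, `d`-th syzygies are punctured-free

`[OURS · L w44b · completion model, ascent half · res-type-015 gen 15]` — seventh brick towards the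
discharge of the named fact `Literature.RingTheory.CohomologyAnnihilator.le_caCompletion_comap`
([BahlekehHakimianSalarianTakahashi2015, Thm. 4.5 (2)]), helper for the surface rung
`PersistenceSurface` (stmt-ResolutionOfSingularities-19970) of crux chain w44b.  NOT a statement of
the manuscript under adjudication in cell res-hironaka; commutative algebra over Mathlib and the
tree's cohomology-annihilator library (`IsIsolatedSingularity` of `Completion.lean`, Serre's theorem
`cohomologyAnnihilatorOfDegree_eq_top_of_isRegularLocalRing`, the reduction lemma CA1
`mem_cohomologyAnnihilatorOfDegree_succ_iff_forall_isSyzygy`, flat base change of syzygies).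

The sentence «since `R̂` is an isolated singularity, `Ω^d X` is in `mod₀ R̂`» of the printed proof of
[BHST15, Thm. 4.5 (2)], in the operative form used by the sibling file `…CompletionAscentRetract`:

* `projective_baseChange_atPrime_of_isSyzygy` — over a noetherian local isolated singularity
  `(S, 𝔫)` of dimension `d`, for `W = Ωᵈ X` and a prime `𝔭 ≠ 𝔫`, the `S_𝔭`-module `S_𝔭 ⊗_S W` is
  projective (`S_𝔭` is regular of dimension `≤ d`, so `ca^{d+1}(S_𝔭) = S_𝔭` by Serre, and by CA1
  the identity of the `d`-th syzygy `S_𝔭 ⊗ W` of `S_𝔭 ⊗ X` factors through a projective);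
* `exists_stablyAnnihilates_pow_of_projective_atPrime` — a finitely generated module `W` over a
  noetherian local ring whose localisations `S_𝔭 ⊗ W` at all primes `𝔭 ≠ 𝔫` are projective is
  stably annihilated by a power of every `y ∈ 𝔫` (the ideal of scalars `u` with `u • 𝟙 W` lifting
  to a free cover is contained in no prime `≠ 𝔫`: lift a splitting of the localised cover with
  `Module.FinitePresentation.exists_lift_of_isLocalizedModule`);
* `puncturedFree_of_isSyzygy_of_isIsolatedSingularity` — the combination.

References: A. Bahlekeh, E. Hakimian, S. Salarian, R. Takahashi, arXiv:1504.06163, Thm. 4.5 (2)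
[`BahlekehHakimianSalarianTakahashi2015`].
-/

section Part10

noncomputable section

open _root_.CategoryTheory _root_.IsLocalRing Literature.RingTheory.CohomologyAnnihilator
open Literature.RingTheory.CohomologyAnnihilator
open scoped _root_.TensorProduct

universe u

namespace Literature.RingTheory.CohomologyAnnihilator.BHST2015.CompletionAscentIsolated

variable {S : Type u} [CommRing S]

/-! ## Isolated singularity: `d`-th syzygies are free on the punctured spectrum -/

/-- A module whose identity factors through a finitely generated projective (stable annihilation by
`1`) is projective. [cite: BahlekehHakimianSalarianTakahashi2015, Theorem 4.5 (2) (proof: completion ascent, Corollary 4.4)] -/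
theorem moduleProjective_of_stablyAnnihilates_one {W : ModuleCat.{u} S} (h : StablyAnnihilates S 1 W) :
    Module.Projective S W := by
  obtain ⟨P, _, hP, ι, π, hιπ⟩ := h
  haveI := moduleProjective_of_projective P hP
  refine Module.Projective.of_split ι.hom π.hom (LinearMap.ext fun w => ?_)
  rw [LinearMap.comp_apply, apply_apply_eq_smul_of_comp_eq_smul_id hιπ w, one_smul, LinearMap.id_apply]

/-- **`Ωᵈ X` is free on the punctured spectrum of a `d`-dimensional isolated singularity.**  Let
`(S, 𝔫)` be a noetherian local ring of Krull dimension `d` which is an isolated singularity, `X` a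
finitely generated `S`-module and `W` a `d`-th syzygy of `X`.  Then for every prime `𝔭 ≠ 𝔫` the
`S_𝔭`-module `S_𝔭 ⊗_S W` is projective: it is a `d`-th syzygy of `S_𝔭 ⊗_S X` over the regular local
ring `S_𝔭` of dimension `ht 𝔭 ≤ d`, whose `ca^{d+1}` is the unit ideal (Serre), so by the reduction
lemma CA1 its identity factors through a projective.
[cite: BahlekehHakimianSalarianTakahashi2015, Theorem 4.5 (2) (proof, «`Ω^d_R̂ X ∈ mod₀ R̂`»)] -/
theorem projective_baseChange_atPrime_of_isSyzygy [IsNoetherianRing S] [IsLocalRing S]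
    (hiso : IsIsolatedSingularity S) {d : ℕ} (hd : ringKrullDim S = d) {X W : ModuleCat.{u} S}
    [Module.Finite S X] (hW : IsSyzygy d X W) (𝔭 : Ideal S) [𝔭.IsPrime] (h𝔭 : 𝔭 ≠ maximalIdeal S) :
    Module.Projective (Localization.AtPrime 𝔭) (Localization.AtPrime 𝔭 ⊗[S] W) := by
  haveI : IsRegularLocalRing (Localization.AtPrime 𝔭) := hiso 𝔭 h𝔭
  -- `dim S_𝔭 = ht 𝔭 = r ≤ d`
  have hht : (𝔭.height : WithBot ℕ∞) ≤ d := by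
    rw [← hd, ← IsLocalRing.maximalIdeal_height_eq_ringKrullDim]
    exact_mod_cast Ideal.height_mono (IsLocalRing.le_maximalIdeal Ideal.IsPrime.ne_top')
  have hne : 𝔭.height ≠ ⊤ := Ideal.height_ne_top Ideal.IsPrime.ne_top'
  obtain ⟨r, hr⟩ := ENat.ne_top_iff_exists.mp hne
  have hdim : ringKrullDim (Localization.AtPrime 𝔭) = r := by
    rw [IsLocalization.AtPrime.ringKrullDim_eq_height 𝔭, ← hr]
    rfl
  have hrd : r ≤ d := by
    rw [← hr] at hht
    exact_mod_cast hht
  -- `ca^{d+1}(S_𝔭) = ⊤`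
  have htop : cohomologyAnnihilatorOfDegree (Localization.AtPrime 𝔭) (d + 1) = ⊤ := by
    rw [eq_top_iff, ← cohomologyAnnihilatorOfDegree_eq_top_of_isRegularLocalRing _ hdim]
    exact cohomologyAnnihilatorOfDegree_mono (by omega)
  -- `S_𝔭 ⊗ W` is a `d`-th syzygy of `S_𝔭 ⊗ X`; CA1 with `x = 1`
  have hW' : IsSyzygy d (ModuleCat.of (Localization.AtPrime 𝔭) (Localization.AtPrime 𝔭 ⊗[S] X))
      (ModuleCat.of (Localization.AtPrime 𝔭) (Localization.AtPrime 𝔭 ⊗[S] W)) :=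
    IsSyzygy.baseChange (Localization.AtPrime 𝔭) d hW
  have h1 : (1 : Localization.AtPrime 𝔭) ∈
      cohomologyAnnihilatorOfDegree (Localization.AtPrime 𝔭) (d + 1) := by
    rw [htop]; exact Submodule.mem_top
  have hst := (mem_cohomologyAnnihilatorOfDegree_succ_iff_forall_isSyzygy (1 : Localization.AtPrime 𝔭)).mp
    h1 _ _ (Module.Finite.base_change S (Localization.AtPrime 𝔭) X) hW'
  exact moduleProjective_of_stablyAnnihilates_one hst

/-! ## Free on the punctured spectrum ⇒ stably annihilated by a power of every element of `𝔫` -/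

/-- If a linear map out of a finitely generated module dies pointwise after multiplication by
elements of a submonoid, a single element of the submonoid kills it. [cite: BahlekehHakimianSalarianTakahashi2015, Theorem 4.5 (2) (proof: completion ascent, Corollary 4.4)] -/
theorem exists_smul_eq_zero_of_forall {W V : Type u} [AddCommGroup W] [Module S W] [Module.Finite S W]
    [AddCommGroup V] [Module S V] (M : Submonoid S) (φ : W →ₗ[S] V)
    (h : ∀ w : W, ∃ t ∈ M, t • φ w = 0) : ∃ t ∈ M, t • φ = 0 := by
  classical
  obtain ⟨G, hG⟩ := Module.Finite.fg_top (R := S) (M := W)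
  choose t ht htφ using h
  refine ⟨∏ g ∈ G, t g, Submonoid.prod_mem M fun g _ => ht g, ?_⟩
  refine LinearMap.ext_on (s := (G : Set W)) hG fun g hg => ?_
  rw [LinearMap.zero_apply, LinearMap.smul_apply, ← Finset.prod_erase_mul G t hg, mul_smul, htφ,
    smul_zero]

/-- **Free on the punctured spectrum ⇒ punctured-free.**  Let `(S, 𝔫)` be noetherian local and `W`
a finitely generated `S`-module such that `S_𝔭 ⊗_S W` is a projective `S_𝔭`-module for every prime
`𝔭 ≠ 𝔫`.  Then for every `y ∈ 𝔫` some power `yᵉ` stably annihilates `W`: with a finite free cover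
`π : Sⁿ ↠ W`, the scalars `u` such that `u • 𝟙 W = π ψ` for some `ψ` form an ideal `J` contained in no
prime `𝔭 ≠ 𝔫` (localise a splitting of `π ⊗ S_𝔭` and lift it to `S` on the finitely presented `W`),
hence `𝔫 ⊆ √J`. [cite: BahlekehHakimianSalarianTakahashi2015, Theorem 4.5 (2) (proof: completion ascent, Corollary 4.4)] -/
theorem exists_stablyAnnihilates_pow_of_projective_atPrime [IsNoetherianRing S] [IsLocalRing S]
    {W : ModuleCat.{u} S} [Module.Finite S W]
    (hW : ∀ (𝔭 : Ideal S) [𝔭.IsPrime], 𝔭 ≠ maximalIdeal S →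
      Module.Projective (Localization.AtPrime 𝔭) (Localization.AtPrime 𝔭 ⊗[S] W)) :
    ∀ y ∈ maximalIdeal S, ∃ e : ℕ, StablyAnnihilates S (y ^ e) W := by
  classical
  haveI : Module.FinitePresentation S W := Module.finitePresentation_of_finite S W
  obtain ⟨n, π, hπ⟩ := Module.Finite.exists_fin' S W
  -- the ideal of scalars whose homothety lifts to the cover
  let J : Ideal S :=
    { carrier := {u | ∃ ψ : W →ₗ[S] (Fin n → S), π ∘ₗ ψ = u • LinearMap.id}
      add_mem' := by
        rintro u v ⟨ψ, hψ⟩ ⟨χ, hχ⟩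
        exact ⟨ψ + χ, by rw [LinearMap.comp_add, hψ, hχ, add_smul]⟩
      zero_mem' := ⟨0, by rw [LinearMap.comp_zero, zero_smul]⟩
      smul_mem' := by
        rintro c u ⟨ψ, hψ⟩
        exact ⟨c • ψ, by rw [LinearMap.comp_smul, hψ, smul_eq_mul, mul_smul]⟩ }
  have hJ : ∀ u, u ∈ J ↔ ∃ ψ : W →ₗ[S] (Fin n → S), π ∘ₗ ψ = u • LinearMap.id := fun u => Iff.rfl
  -- `J ⊄ 𝔭` for every prime `𝔭 ≠ 𝔫`
  have hJp : ∀ (𝔭 : Ideal S) [𝔭.IsPrime], 𝔭 ≠ maximalIdeal S → ¬ J ≤ 𝔭 := by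
    intro 𝔭 _ h𝔭 hle
    haveI := hW 𝔭 h𝔭
    let Sp := Localization.AtPrime 𝔭
    let fW : W →ₗ[S] Sp ⊗[S] W := TensorProduct.mk S Sp W 1
    let fP : (Fin n → S) →ₗ[S] Sp ⊗[S] (Fin n → S) := TensorProduct.mk S Sp (Fin n → S) 1
    let πp : Sp ⊗[S] (Fin n → S) →ₗ[Sp] Sp ⊗[S] W := π.baseChange Sp
    have hπp : Function.Surjective πp := by
      change Function.Surjective (π.baseChange Sp)
      rw [LinearMap.baseChange_eq_ltensor]
      exact LinearMap.lTensor_surjective Sp hπ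
    obtain ⟨σ, hσ⟩ := Module.projective_lifting_property πp LinearMap.id hπp
    have hσ' : ∀ v, πp (σ v) = v := fun v => LinearMap.congr_fun hσ v
    -- lift `σ ∘ fW` to `S`
    obtain ⟨h, s, hhs⟩ := Module.FinitePresentation.exists_lift_of_isLocalizedModule 𝔭.primeCompl fP
      (σ.restrictScalars S ∘ₗ fW)
    -- `fW ∘ (π h - s • 𝟙) = 0`
    let δ : W →ₗ[S] W := π ∘ₗ h - (s : S) • LinearMap.id
    have hδ : ∀ w : W, δ w = π (h w) - (s : S) • w := fun w => rfl
    have hzero : ∀ w : W, fW (δ w) = 0 := by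
      intro w
      have hnat : fW (π (h w)) = πp (fP (h w)) := by
        change (1 : Sp) ⊗ₜ[S] π (h w) = π.baseChange Sp ((1 : Sp) ⊗ₜ[S] h w)
        rw [LinearMap.baseChange_tmul]
      have hfP : fP (h w) = (s : S) • σ (fW w) := by
        have := LinearMap.congr_fun hhs w
        rw [LinearMap.comp_apply, LinearMap.smul_apply, Submonoid.smul_def] at this
        exact this
      rw [hδ, map_sub, hnat, hfP, LinearMap.map_smul_of_tower, hσ', LinearMap.map_smul, sub_self]
    have hkill : ∀ w : W, ∃ t ∈ 𝔭.primeCompl, t • δ w = 0 := by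
      intro w
      obtain ⟨c, hc⟩ := (IsLocalizedModule.exists_of_eq (S := 𝔭.primeCompl) (f := fW)
        (x₁ := δ w) (x₂ := 0) (by rw [hzero, map_zero]))
      exact ⟨c, c.2, by rw [← Submonoid.smul_def, hc, smul_zero]⟩
    obtain ⟨t, ht, htφ⟩ := exists_smul_eq_zero_of_forall 𝔭.primeCompl δ hkill
    -- `(t s) • 𝟙 = π ∘ (t • h)`, so `t s ∈ J ∖ 𝔭`
    have hmem : t * s ∈ J := by
      refine (hJ _).mpr ⟨t • h, ?_⟩
      have htφ' : t • (π ∘ₗ h) = t • ((s : S) • (LinearMap.id : W →ₗ[S] W)) := by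
        rw [← sub_eq_zero, ← smul_sub]
        exact htφ
      rw [LinearMap.comp_smul, htφ', smul_smul]
    exact (𝔭.primeCompl.mul_mem ht s.2) (hle hmem)
  -- hence `𝔫 ⊆ √J`
  have hrad : maximalIdeal S ≤ J.radical := by
    rw [Ideal.radical_eq_sInf]
    refine le_sInf ?_
    rintro 𝔭 ⟨hJ𝔭, h𝔭prime⟩
    by_cases h𝔭 : 𝔭 = maximalIdeal S
    · exact h𝔭.ge
    · exact absurd hJ𝔭 (hJp 𝔭 h𝔭)
  intro y hy
  obtain ⟨e, he⟩ := (Ideal.mem_radical_iff.mp (hrad hy))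
  obtain ⟨ψ, hψ⟩ := (hJ _).mp he
  refine ⟨e, ModuleCat.of S (Fin n → S), inferInstance,
    (IsProjective.iff_projective (R := S) (Fin n → S)).mp inferInstance,
    ModuleCat.ofHom ψ, ModuleCat.ofHom π, ?_⟩
  apply ModuleCat.hom_ext
  change π ∘ₗ ψ = _
  rw [hψ]
  rfl

/-- **Over a `d`-dimensional isolated singularity, `d`-th syzygies are punctured-free**: for
`(S, 𝔫)` noetherian local of Krull dimension `d` and an isolated singularity, every `d`-th syzygy
`W = Ωᵈ X` of a finitely generated module is stably annihilated by a power of every `y ∈ 𝔫`.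
[cite: BahlekehHakimianSalarianTakahashi2015, Theorem 4.5 (2) (proof)] -/
theorem puncturedFree_of_isSyzygy_of_isIsolatedSingularity [IsNoetherianRing S] [IsLocalRing S]
    (hiso : IsIsolatedSingularity S) {d : ℕ} (hd : ringKrullDim S = d) {X W : ModuleCat.{u} S}
    [Module.Finite S X] (hW : IsSyzygy d X W) :
    ∀ y ∈ maximalIdeal S, ∃ e : ℕ, StablyAnnihilates S (y ^ e) W := by
  haveI : Module.Finite S W := finite_of_isSyzygy d ‹_› hW
  exact exists_stablyAnnihilates_pow_of_projective_atPrime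
    (fun 𝔭 _ h𝔭 => projective_baseChange_atPrime_of_isSyzygy hiso hd hW 𝔭 h𝔭)

end Literature.RingTheory.CohomologyAnnihilator.BHST2015.CompletionAscentIsolated

end

end Part10

/-!
## Part 11 — port of `Summits/ResolutionOfSingularities/ResolutionOfSingularities/Theorems/HomologicalConductorPersistenceCompletionAscentHolds.lean`

# [BHST15, Theorem 4.5 (2)] proved: `caⁿ(R) ⊆ caⁿ⁺ᵈ(R̂) ∩ R` when `R̂` is an isolated singularity

`[OURS · L w44b · completion model, ascent half · res-type-015 gen 15]` — final brick: the NAMED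
FACT `Literature.RingTheory.CohomologyAnnihilator.le_caCompletion_comap`
([BahlekehHakimianSalarianTakahashi2015, Thm. 4.5 (2)]: for a noetherian local ring `R` of Krull
dimension `d` whose `𝔪`-adic completion `R̂ = AdicCompletion 𝔪 R` is an isolated singularity,
`caⁿ(R) ⊆ caⁿ⁺ᵈ(R̂) ∩ R` for every `n`) is DISCHARGED as `le_caCompletion_comap_holds`, helper for the
surface rung `PersistenceSurface` (stmt-ResolutionOfSingularities-19970) of crux chain w44b and for
the «C-comp» transfer of W4.4 (the conditional consequences in `Completion.lean` —
`cohomologyAnnihilator_eq_comap_completion`, `cohomologyAnnihilator_completion_eq_map`, … — can now be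
fed `caCompletion_comap_le_holds` (p512917) and `le_caCompletion_comap_holds`).  NOT a statement of the
manuscript under adjudication in cell res-hironaka.

Proof (ours; the printed proof's Cor. 4.4 is replaced by the Koszul-free
`exists_retract_baseChange_of_puncturedFree`): for `a ∈ ca^{t+1}(R)` and a `(t+d)`-th syzygy
`K = Ωᵗ W`, `W = Ωᵈ X`, over `R̂`: `W` is punctured-free (`R̂` is an isolated singularity of
dimension `d`, `…CompletionAscentIsolated`), hence a retract of `R̂ ⊗_R N`
(`…CompletionAscentRetract`, the pair `R → R̂` being flat, `𝔪R̂ = 𝔫̂`, dense); so `K` is a retract of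
`(R̂ ⊗_R Ωᵗ N) ⊕ Q` (`…CompletionAscentSyzygyRetract`); `a` stably annihilates `Ωᵗ N` (CA1 over `R`),
hence `a` stably annihilates `K`; by CA1 over `R̂` (noetherian, `Resolution.Stacks0316`),
`a ∈ ca^{t+d+1}(R̂)`.  Degree `n = 0`: `ca⁰(R) = 0`.

References: A. Bahlekeh, E. Hakimian, S. Salarian, R. Takahashi, arXiv:1504.06163, Thm. 4.5 (2)
[`BahlekehHakimianSalarianTakahashi2015`]; S. B. Iyengar, R. Takahashi, arXiv:1404.1476, §2
[`IyengarTakahashi2014`].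
-/

section Part11

noncomputable section

open _root_.CategoryTheory _root_.IsLocalRing Literature.RingTheory.CohomologyAnnihilator
open Literature.AlgebraicGeometry.Resolution
open Literature.RingTheory.CohomologyAnnihilator
open Literature.RingTheory.CohomologyAnnihilator.BHST2015.CompletionAscentRetract
open Literature.RingTheory.CohomologyAnnihilator.BHST2015.CompletionAscentIsolated
open Literature.RingTheory.CohomologyAnnihilator.BHST2015.CompletionAscentSyzygyRetract
open scoped _root_.TensorProduct

universe u

namespace Literature.RingTheory.CohomologyAnnihilator.BHST2015.CompletionAscentHolds

/-- Splitting a syzygy chain: a `(t + d)`-th syzygy of `X` is a `t`-th syzygy of a `d`-th syzygy of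
`X`. [cite: BahlekehHakimianSalarianTakahashi2015, Theorem 4.5 (2) (proof: completion ascent, Corollary 4.4)] -/
theorem exists_isSyzygy_split {S : Type u} [CommRing S] (t : ℕ) :
    ∀ (d : ℕ) {X K : ModuleCat.{u} S}, IsSyzygy (t + d) X K →
      ∃ W : ModuleCat.{u} S, IsSyzygy d X W ∧ IsSyzygy t W K
  | 0, X, _, hK => ⟨X, ⟨Iso.refl X⟩, hK⟩
  | d + 1, X, K, hK => by
    obtain ⟨X₁, h₁, hK'⟩ := isSyzygy_succ_iff_exists_first.mp
      (show IsSyzygy (t + d + 1) X K by rwa [← Nat.add_assoc] at hK)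
    obtain ⟨W, hW, hKW⟩ := exists_isSyzygy_split t d hK'
    exact ⟨W, isSyzygy_succ_iff_exists_first.mpr ⟨X₁, h₁, hW⟩, hKW⟩

/-- `R` is dense in `R̂`: every element of the completion is congruent to an element of `R` modulo
any power of the maximal ideal (`R̂/𝔪ᵏR̂ = R/𝔪ᵏ`, Mathlib's `AdicCompletion.pow_smul_top_eq_ker_eval`).
[cite: Matsumura1987, §8 (3)] -/
theorem dense_adicCompletion (R : Type u) [CommRing R] [IsNoetherianRing R] [IsLocalRing R] :
    ∀ (k : ℕ) (s : AdicCompletion (maximalIdeal R) R), ∃ r : R,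
      s - algebraMap R (AdicCompletion (maximalIdeal R) R) r ∈
        maximalIdeal (AdicCompletion (maximalIdeal R) R) ^ k := by
  intro k x
  have hfg : (maximalIdeal R).FG := (maximalIdeal R).fg_of_isNoetherianRing
  obtain ⟨r, hr⟩ := Submodule.Quotient.mk_surjective _ (x.val k)
  refine ⟨r, ?_⟩
  have hker : x - algebraMap R (AdicCompletion (maximalIdeal R) R) r ∈
      LinearMap.ker (AdicCompletion.eval (maximalIdeal R) R k) := by
    rw [LinearMap.mem_ker, map_sub, sub_eq_zero, AdicCompletion.eval_apply,
      AdicCompletion.eval_apply, AdicCompletion.algebraMap_apply, AdicCompletion.of_apply,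
      Submodule.mkQ_apply, Algebra.algebraMap_self, RingHom.id_apply]
    exact hr.symm
  rw [← AdicCompletion.pow_smul_top_eq_ker_eval (M := R) hfg, Ideal.smul_top_eq_map,
    Submodule.restrictScalars_mem] at hker
  rw [AdicCompletion.maximalIdeal_eq_map, ← Ideal.map_pow]
  exact hker

/-- **[BahlekehHakimianSalarianTakahashi2015, Theorem 4.5 (2)] PROVED** — the named fact
`Literature.RingTheory.CohomologyAnnihilator.le_caCompletion_comap` holds: for every noetherian local
ring `R` of Krull dimension `d` whose `𝔪`-adic completion `R̂` is an isolated singularity and every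
`n`, `caⁿ(R) ⊆ caⁿ⁺ᵈ(R̂) ∩ R`.  See the module docstring for the (Koszul-free) proof.
[cite: BahlekehHakimianSalarianTakahashi2015, Theorem 4.5 (2)] -/
theorem _root_.Literature.RingTheory.CohomologyAnnihilator.le_caCompletion_comap_holds :
    Literature.RingTheory.CohomologyAnnihilator.le_caCompletion_comap.{u} := by
  intro R _ _ _ d hd hiso n
  haveI : IsNoetherianRing (AdicCompletion (maximalIdeal R) R) :=
    isNoetherianRing_adicCompletion_maximalIdeal R
  have hmapS : (maximalIdeal R).map (algebraMap R (AdicCompletion (maximalIdeal R) R)) =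
      maximalIdeal (AdicCompletion (maximalIdeal R) R) := AdicCompletion.maximalIdeal_eq_map.symm
  have hdense := dense_adicCompletion R
  have hdS : ringKrullDim (AdicCompletion (maximalIdeal R) R) = d := by
    rw [ringKrullDim_adicCompletion, hd]
  cases n with
  | zero =>
    rw [cohomologyAnnihilatorOfDegree_zero]
    exact bot_le
  | succ t =>
    intro a ha
    rw [Ideal.mem_comap, show t + 1 + d = (t + d) + 1 by omega,
      mem_cohomologyAnnihilatorOfDegree_succ_iff_forall_isSyzygy]
    intro X K hX hK
    haveI := hX
    obtain ⟨W, hW, hKW⟩ := exists_isSyzygy_split t d hK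
    haveI : Module.Finite (AdicCompletion (maximalIdeal R) R) W := finite_of_isSyzygy d hX hW
    have hPF := puncturedFree_of_isSyzygy_of_isIsolatedSingularity hiso hdS hW
    obtain ⟨N, _, _, _, i, p, hip⟩ :=
      exists_retract_baseChange_of_puncturedFree d hmapS hdense hdS W inferInstance hPF
    have hip' : ModuleCat.ofHom i ≫ ModuleCat.ofHom p = 𝟙 W :=
      ModuleCat.hom_ext (LinearMap.ext fun w => LinearMap.congr_fun hip w)
    obtain ⟨KN, hKNfin, hKN, Q, hQ, hQproj, i', p', hip''⟩ :=
      exists_retract_baseChange_syzygy (ModuleCat.ofHom i) (ModuleCat.ofHom p) hip' t hKW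
    have haKN : StablyAnnihilates R a KN :=
      (mem_cohomologyAnnihilatorOfDegree_succ_iff_forall_isSyzygy a).mp ha _ _ inferInstance hKN
    exact StablyAnnihilates.of_retract i' p' hip''
      (StablyAnnihilates.prod_projective
        (StablyAnnihilates.baseChange (AdicCompletion (maximalIdeal R) R) haKN) hQ hQproj)

end Literature.RingTheory.CohomologyAnnihilator.BHST2015.CompletionAscentHolds

end

end Part11

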